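import Literature.Computability.Complexity.HardcoreInapproximability
import Literature.Computability.Complexity.HardcoreInapproximabilityPhi
import HarnessLib

/-!
# Ingredients of Sly's gadget theorem (Theorem 2.1), proved

Companion to `HardcoreInapproximability.lean` (same namespace). There, Sly's gadget theorem and
reduction estimate are the named fact `slyGadgetReduction`, and its elementary half — Lemma 2.2,
`(GpropA) ∧ (GpropB) ⟹ (phaseProbs) ∧ (cutProb)` — is proved (`slyCutEstimate_of_slyProps`,
`slyGadgetReduction_of_gadgets`, `slyGadgetReduction_of_gadgetsAt`), so that what remains of the
fact is the derandomised content of Sly 2010, Theorem 2.1: for `λ > λ_c(𝕋_d)`, gadgets of maximum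
degree `d` whose phases are balanced and whose ports are, given the phase, within `1 ± n^{-2θ}` of
the product measures `Q^{±}` with parameters `0 < q⁻ < q⁺ < 1`, "the occupation densities of the
root of the `(d-1)`-ary tree under the two extremal semi-translation-invariant measures"
(Sly §1.3). This file proves, bottom-up, ingredients of that theorem that are self-contained real
analysis; first the very constants `q^{±}`:

* `hardCoreThreshold_eq_critical` — `λ_c(𝕋_{K+2}) = t_c (1 + t_c)^{K+1}` with `t_c = 1/K`: the
  tree threshold is the value of `t ↦ t(1+t)^k` (`k = d - 1 = K + 1`) where the symmetric fixed
  point of the tree recursion loses stability;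
* `card_perm_filter_forall_not_mem`, `card_perm_filter_forall_not_mem_div_factorial` — the
  first-moment input for gadgets built from random perfect matchings (Sly, proof of Lemma 3.1,
  eq. (e:gtEZ1); Mossel–Weitz–Wormald 2009, Prop. 3.1): among the `n!` perfect matchings of two
  `n`-sets, those matching no element of `A` to an element of `B` number
  `(n-|B|)(n-|B|-1)⋯(n-|B|-|A|+1) · (n-|A|)!`, i.e. a uniformly random perfect matching "does not
  connect two 1's of the configuration" with probability `C(n-|B|,|A|)/C(n,|A|)` (via
  `card_perm_filter_forall_mem`: permutations with `σ(A) ⊆ C`, and `card_perm_filter_eqOn`);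
* `mww_firstMoment` — the Mossel–Weitz–Wormald first moment as an exact finite average over
  `(Perm [n])^d` (the random bipartite `d`-regular multigraph as `d` independent uniform perfect
  matchings): `E Z^{a,b} = λ^{a+b} C(n,a) C(n,b) [C(n-b,a)/C(n,a)]^d` (Sly §3, display for
  `Z^{α,β}_{MWW}`; MWW09 Prop. 3.1);
* `sly_firstMoment` — the same for Sly's gadget core `G̃` with the boundary configuration `η` on
  `U` prescribed (Sly, proof of Lemma 3.1, eq. (e:gtEZ1)):
  `E Z^{a,b}(η) = λ^{a+b+η⁺+η⁻} C(n,a) C(n,b) [C(n+m'-b-η⁻, a+η⁺)/C(n+m', a+η⁺)]^{d-1} C(n-b,a)/C(n,a)`;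
* `sly_lemma31_abs_log_ratio_sub_le` — **Sly's Lemma 3.1** in quantitative form: the logarithm
  of the ratio of the two first moments is
  `(η⁺+η⁻) log λ + (d-1)[(m'-η⁻) log((n-b)/(n-b-a)) + η⁺ log((n-b-a)/a) - m' log(n/(n-a)) - η⁺ log((n-a)/a)]`
  up to `8(d-1)[(m'-η⁻)² + m'² + 2(η⁺)²]/min{a, n-a-b}` (two applications of Lemma 3.2);
* `abs_log_choose_sub_le` — **Sly's Lemma 3.2** (perturbation of binomial coefficients, "used
  repeatedly throughout" his §3) with an explicit constant: for `0 < b < a` and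
  `4|a'-a|, 4|b'-b| ≤ min{b, a-b}`,
  `|log C(a',b') - log C(a,b) - (a'-a) log(a/(a-b)) - (b'-b) log((a-b)/b)| ≤ 8((a'-a)²+(b'-b)²)/min{b, a-b}`,
  from `abs_log_factorial_sub_le` (`|log N'! - log N! - (N'-N) log N| ≤ 2(N'-N)²/N` for `2|N'-N| ≤ N`);
* `exists_slyCriticalDensities` — for `λ > λ_c(𝕋_d)`, densities `0 < p⁻ < p⁺`, `p⁺ + p⁻ < 1`
  solving both critical equations `λ(1-p⁺-p⁻)^d = p^{±}(1-p^{±})^{d-1}` of Sly's first-moment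
  exponent `Φ₁` (i.e. `p^{∓} = h(p^{±})`, Sly §1.3 first bullet after MWW09 §4 / DFJ02 Claim 2.2),
  with `q^{±} = p^{±}/(1-p^{∓})` (eq. (e:pqRelation)) the two-cycle below;
* `existsUnique_hardCore_treeFixedPoint`, `hardCore_treeFixedPoint_unstable_iff` — the recursion
  has exactly one fixed point `q* ∈ (0,1)` (Sly's free-measure density `p* = q*/(1+q*)`), and
  `(d-1) q* > 1 ⟺ λ > λ_c(𝕋_d)`;
* `exists_hardCore_treeTwoCycle` — **non-uniqueness above `λ_c`** (Kelly 1985; Sly §1.3 "standard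
  tree recursions"; Mossel–Weitz–Wormald 2009 §4): for `d ≥ 3` and `λ > λ_c(𝕋_d)` the recursion
  `q ↦ λ(1-q)^{d-1}/(1+λ(1-q)^{d-1})` for the occupation probability of the root of the `(d-1)`-ary
  tree has a genuine two-cycle `0 < q⁻ < q⁺ < 1`, `q^{±} = λ(1-q^{∓})^{d-1}/(1+λ(1-q^{∓})^{d-1})`
  (Sly's display after (e:pqRelation)). Proof: in `s = 1 - q` the recursion is `f(s) = 1/(1+λs^k)`;
  its fixed point `s*` (intermediate value theorem) has `k q* > 1` exactly because
  `λ = t*(1+t*)^k > λ_c` (`t* = λ (s*)^k`, monotonicity of `t(1+t)^k`); the points of period `≤ 2`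
  are the zeros of `P(s) = (1-s)(1+λs^k)^k - λs`, and `P(s*) = 0`,
  `P'(s*) (s*)^{k+1} = (k q*)² - 1 > 0` (`HasDerivAt`, slope at `s*`), `P(0) = 1`, so `P` has a
  zero `s₀ ∈ (0, s*)` (intermediate value theorem again), and `(1 - s₀, 1 - f(s₀))` is the two-cycle;
* `hardCore_treeTwoCycle_unique`, `not_hardCore_treeTwoCycle_of_le` — **Kelly's uniqueness**
  (Kelly 1985, as quoted in Sly §1.3: "uniqueness when `λ ≤ λ_c` and non-uniqueness when
  `λ > λ_c`"): the recursion has at most one two-cycle `q⁻ < q⁺ < 1`, and none for `λ ≤ λ_c(𝕋_d)`.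
  Proof: a two-cycle lies on Kelly's curve `λ = Λ(r) = (1 + rS)^{d-1}/(r S^d)`,
  `S = 1 + r + ⋯ + r^{d-3}`, `r = (1-q⁻)/(1-q⁺) > 1` (`hardCore_treeTwoCycle_param`), and `Λ` is
  strictly increasing on `[1, ∞)` with `Λ(1) = λ_c` (`kelly_curve_strictMonoOn`, `kelly_curve_one`;
  the sign of `Λ'` is an AM–GM inequality, `kelly_key_pos`);
* `slyPhi1_local_gap`, `slyPhi1_uniform_gap` — **the gap of `Φ₁` away from its maxima** (Sly,
  proof of Lemma 3.3): `Φ₁(α,β) + C‖(α,β) - (p⁺,p⁻)‖_∞^ℓ ≤ Φ₁(p⁺,p⁻)` on an `ℓ_∞`-box around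
  `(p⁺,p⁻)` for some `ℓ ∈ ℕ`, `C > 0` (real-analyticity of `a ↦ Φ₁(a, h(a))`,
  `analyticAt_slyPhi1_dfjH`, and the isolated-zeros principle, `exists_pow_le_of_analyticAt_of_nonneg`;
  `slyPhi1_curve_gap`, `dfjH_local_inverse`, `slyPhi1_dfjH_section_le`), and a uniform gap `δ > 0`
  at `ℓ_∞`-distance `≥ ε` from both maximisers (compactness);
* `slyPhi1_max_triangle` — **the maxima of `Φ₁` on the triangle** (Sly §1.3, second bullet, after
  MWW09 §4 / DFJ02 Claim 2.2): for `λ > λ_c(𝕋_d)`, on the closed triangle `{α, β ≥ 0, α + β ≤ 1}`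
  Sly's first-moment exponent `Φ₁` (`slyPhi1`, file `HardcoreInapproximabilityPhi`) is maximal
  exactly at `(p⁺,p⁻)` and `(p⁻,p⁺)`: `Φ₁` is continuous (`continuous_slyPhi1`), so a maximiser on
  the compact triangle exists; boundary points and points off the critical curves are improved by
  the strictly concave sections (`slyPhi1_right_max_Icc`, endpoints and `α = 0` included) and the
  symmetry `Φ₁(α,β) = Φ₁(β,α)`, leaving the three critical points of `sly_criticalPoints`, of
  which `(p*,p*)` is a saddle because `d p* > 1` (`slyPhi1_symm_lt_offDiagonal`);
* `sly_criticalPoints`, `sly_criticalPoints_of_le` — **the critical points of `Φ₁`** (Sly §1.3,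
  first bullet, after MWW09 §4 / DFJ02 Claim 2.2): for `λ > λ_c(𝕋_d)` the solutions of both
  critical equations in the open triangle are exactly `(p⁺,p⁻)`, `(p⁻,p⁺)`, `(p*,p*)`, with
  `0 < p⁻ < p* < p⁺`, `p* > 1/d`; for `0 < λ ≤ λ_c` only `(p*,p*)`, with `p* ≤ 1/d`
  (`hardCore_treeTwoCycle_of_critical`: an asymmetric critical point gives a two-cycle
  `q⁺ = α/(1-β)`, `q⁻ = β/(1-α)`; `slyCritical_asymm_unique`, `exists_slyCritical_symm`,
  `slyCritical_symm_unique`, `inv_lt_slyCritical_symm_iff`, `slyCritical_order`).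

## What is NOT here

That `q^{±}` ARE the root densities of the extremal semi-translation-invariant Gibbs measures
(weak limits under even/odd occupied boundary conditions), Sly's extra
inequalities `q⁺q⁻(d-1) < 1`, `q⁺ < 3/5`, `E Z^{α,β} ≈ exp(nΦ₁)` (MWW09 Prop. 3.1) and the summation over `(α, β)` in Lemma 3.3;
and everything probabilistic in Theorem 2.1 (the random
graph `G(n, θ, ψ)`, first and second moments, small subgraph conditioning, reconstruction).

## References

* A. Sly, *Computational transition at the uniqueness threshold*, FOCS 2010, 287–296,
  arXiv:1005.5584: §1.3 (Preliminaries: `λ_c(d)`, the measures `μ̂_±`, densities `q^{±}` and the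
  tree recursion), §2.1 (Theorem 2.1), §3 (Lemma 3.1 and its proof, Lemma 3.2) [Sly2010].
* F. P. Kelly, *Stochastic models of computer communication systems*, J. Roy. Statist. Soc. B 47
  (1985) (the threshold `λ_c(𝕋_d)`; quoted from Sly §1.3).
* E. Mossel, D. Weitz, N. Wormald, *On the hardness of sampling independent sets beyond the tree
  threshold*, Probab. Theory Related Fields 143 (2009), Prop. 3.1 (first moment; quoted from Sly §3).
-/

namespace Literature.Computability.Complexity

open Literature.Probability.LatticeModels
open _root_.Filter _root_.Topology

/-- **The tree threshold as the critical activity of the recursion** (`k = d - 1`, here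
`d = K + 2`): `λ_c(𝕋_{K+2}) = (K+1)^{K+1}/K^{K+2} = t_c (1 + t_c)^{K+1}` with `t_c = 1/K`, the value
of `t ↦ t(1+t)^{K+1}` at the point where the symmetric fixed point of the `(K+1)`-ary tree recursion
loses stability. [cite: Sly2010, §1.3 (the threshold `λ_c(d) = (d-1)^{d-1}/(d-2)^d`, after Kelly 1985)] -/
theorem hardCoreThreshold_eq_critical (K : ℕ) (hK : 1 ≤ K) :
    hardCoreThreshold (K + 2) = (1 / (K : ℝ)) * (1 + 1 / (K : ℝ)) ^ (K + 1) := by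
  rw [hardCoreThreshold, show K + 2 - 1 = K + 1 from rfl]
  have hK0 : (K : ℝ) ≠ 0 := by exact_mod_cast (show K ≠ 0 by omega)
  push_cast
  rw [show (K : ℝ) + 2 - 1 = K + 1 by ring, show (K : ℝ) + 2 - 2 = K by ring,
    show 1 + 1 / (K : ℝ) = ((K : ℝ) + 1) / K by rw [add_div, div_self hK0], div_pow,
    pow_succ (K : ℝ) (K + 1), div_mul_div_comm, one_mul, mul_comm (K : ℝ) ((K : ℝ) ^ (K + 1))]

/-- **Non-uniqueness on the tree above `λ_c`: the two-cycle of the hard-core recursion**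
(Sly 2010 §1.3, "standard tree recursions"; Kelly 1985; Mossel–Weitz–Wormald 2009 §4). For `d ≥ 3`
and `λ > λ_c(𝕋_d) = (d-1)^{d-1}/(d-2)^d` there are `0 < q⁻ < q⁺ < 1` with
`q^{±} = λ(1-q^{∓})^{d-1}/(1+λ(1-q^{∓})^{d-1})` — the occupation probabilities of the root of the
infinite `(d-1)`-ary tree under the two extremal semi-translation-invariant measures, the
constants `q⁺, q⁻` of Sly's Theorem 2.1. Proof: with `s = 1 - q` the recursion is
`s ↦ f(s) = 1/(1+λ s^k)`, `k = d-1`; its fixed point `s*` has `q* = 1 - s* > 1/k` exactly when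
`λ = t*(1+t*)^k > λ_c` (`t* = λ s*^k`), which makes `P(s) = (1-s)(1+λ s^k)^k - λ s` (whose zeros are
the points of period `≤ 2`, `P(s*) = 0`) increase through `s*` (`P'(s*) s*^{k+1} = k²(q*)² - 1 > 0`);
as `P(0) = 1 > 0`, `P` vanishes at some `s₀ ∈ (0, s*)`, and `(1 - s₀, 1 - f(s₀))` is the two-cycle.
[cite: Sly2010, §1.3 (the densities `q⁺, q⁻`, display `q^± = λ(1-q^∓)^{d-1}/(1+λ(1-q^∓)^{d-1})`)] -/
theorem exists_hardCore_treeTwoCycle {d : ℕ} (hd : 3 ≤ d) {lam : ℝ}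
    (hlam : hardCoreThreshold d < lam) :
    ∃ qp qm : ℝ, 0 < qm ∧ qm < qp ∧ qp < 1 ∧
      qp = lam * (1 - qm) ^ (d - 1) / (1 + lam * (1 - qm) ^ (d - 1)) ∧
      qm = lam * (1 - qp) ^ (d - 1) / (1 + lam * (1 - qp) ^ (d - 1)) := by
  obtain ⟨K, rfl⟩ : ∃ K, d = K + 2 := ⟨d - 2, by omega⟩
  have hK : 1 ≤ K := by omega
  rw [show K + 2 - 1 = K + 1 from rfl]
  have hK0 : (0 : ℝ) < K := by exact_mod_cast (show 0 < K by omega)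
  have hlam0 : 0 < lam := (hardCoreThreshold_pos (by omega)).trans hlam
  -- Step 1: the fixed point `s*` of `f(s) = 1/(1 + λ s^k)` in `(0, 1)`
  obtain ⟨s, ⟨hs0, hs1⟩, hfix⟩ : ∃ s ∈ Set.Ioo (0 : ℝ) 1, s * (1 + lam * s ^ (K + 1)) - 1 = 0 := by
    have hcont : ContinuousOn (fun s : ℝ => s * (1 + lam * s ^ (K + 1)) - 1) (Set.Icc 0 1) := by
      fun_prop
    have h := intermediate_value_Ioo (zero_le_one' ℝ) hcont
    have h0 : (0 : ℝ) ∈ Set.Ioo ((fun s : ℝ => s * (1 + lam * s ^ (K + 1)) - 1) 0)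
        ((fun s : ℝ => s * (1 + lam * s ^ (K + 1)) - 1) 1) := by
      constructor <;> simp [hlam0]
    exact h h0
  have hfix' : s * (1 + lam * s ^ (K + 1)) = 1 := by linarith
  have hls : lam * s ^ (K + 2) = 1 - s := by
    have : s * (1 + lam * s ^ (K + 1)) = s + lam * s ^ (K + 2) := by ring
    linarith
  -- Step 2: instability of the fixed point: `(K+1) (1 - s*) > 1`, from `λ > λ_c`
  have hinst : 1 < ((K : ℝ) + 1) * (1 - s) := by
    by_contra hle
    push Not at hle
    -- `t* = λ s*^k` satisfies `K t* ≤ 1`, hence `λ = t*(1+t*)^k ≤ λ_c`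
    set t : ℝ := lam * s ^ (K + 1) with ht
    have ht0 : 0 ≤ t := by positivity
    have hst : s * (1 + t) = 1 := hfix'
    have htK : t ≤ 1 / K := by
      rw [le_div_iff₀ hK0]
      nlinarith [hst, hle]
    have hlam_eq : lam = t * (1 + t) ^ (K + 1) := by
      have h1t : 1 + t = 1 / s := by
        field_simp
        linarith
      have hss : s ^ (K + 1) * (1 / s) ^ (K + 1) = 1 := by
        rw [← mul_pow, mul_one_div_cancel hs0.ne', one_pow]
      rw [h1t, ht, mul_assoc, hss, mul_one]
    have hle' : lam ≤ hardCoreThreshold (K + 2) := by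
      rw [hardCoreThreshold_eq_critical K hK, hlam_eq]
      exact mul_le_mul htK (pow_le_pow_left₀ (by positivity) (by linarith) _)
        (by positivity) (by positivity)
    exact absurd hlam (not_lt.2 hle')
  -- Step 3: the period-`≤ 2` polynomial `P`, with `P(s*) = 0`, `P(0) = 1`, `P'(s*) > 0`
  set P : ℝ → ℝ := fun x => (1 - x) * (1 + lam * x ^ (K + 1)) ^ (K + 1) - lam * x with hP
  have hAs : (1 + lam * s ^ (K + 1)) * s = 1 := by linarith
  have e1 : (1 + lam * s ^ (K + 1)) ^ (K + 1) * s ^ (K + 1) = 1 := by rw [← mul_pow, hAs, one_pow]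
  have e2 : (1 + lam * s ^ (K + 1)) ^ K * s ^ K = 1 := by rw [← mul_pow, hAs, one_pow]
  have hPs : P s = 0 := by
    have h : P s * s ^ (K + 1) = 0 := by
      have : P s * s ^ (K + 1) =
          (1 - s) * ((1 + lam * s ^ (K + 1)) ^ (K + 1) * s ^ (K + 1)) - lam * s ^ (K + 2) := by
        simp only [hP]; ring
      rw [this, e1, hls]; ring
    rcases mul_eq_zero.1 h with h | h
    · exact h
    · exact absurd h (pow_ne_zero _ hs0.ne')
  have hP0 : P 0 = 1 := by simp [hP]
  set D : ℝ := -1 * (1 + lam * s ^ (K + 1)) ^ (K + 1) +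
    (1 - s) * (↑(K + 1) * (1 + lam * s ^ (K + 1)) ^ (K + 1 - 1) *
      (lam * (↑(K + 1) * s ^ (K + 1 - 1)))) - lam * 1 with hD
  have hderiv : HasDerivAt P D s := by
    have h1 : HasDerivAt (fun x : ℝ => 1 - x) (-1) s := (hasDerivAt_id' s).const_sub 1
    have h2 : HasDerivAt (fun x : ℝ => 1 + lam * x ^ (K + 1)) (lam * (↑(K + 1) * s ^ (K + 1 - 1))) s :=
      ((hasDerivAt_pow (K + 1) s).const_mul lam).const_add 1
    have h3 := h2.fun_pow (K + 1)
    have h4 := h1.mul h3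
    have h5 : HasDerivAt (fun x : ℝ => lam * x) (lam * 1) s := (hasDerivAt_id' s).const_mul lam
    exact h4.sub h5
  have hDpos : 0 < D := by
    have key : D * s ^ (K + 2) = (((K : ℝ) + 1) * (1 - s)) ^ 2 - 1 := by
      simp only [hD, Nat.add_sub_cancel]
      push_cast
      have : (-1 * (1 + lam * s ^ (K + 1)) ^ (K + 1) +
          (1 - s) * (((K : ℝ) + 1) * (1 + lam * s ^ (K + 1)) ^ K * (lam * (((K : ℝ) + 1) * s ^ K))) -
            lam * 1) * s ^ (K + 2) =
          -((1 + lam * s ^ (K + 1)) ^ K * s ^ K) * ((1 + lam * s ^ (K + 1)) * s) * s +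
            (1 - s) * ((K : ℝ) + 1) ^ 2 * ((1 + lam * s ^ (K + 1)) ^ K * s ^ K) *
              (lam * s ^ (K + 2)) -
            lam * s ^ (K + 2) := by ring
      rw [this, e2, hAs, hls]
      ring
    have hpos : 0 < (((K : ℝ) + 1) * (1 - s)) ^ 2 - 1 := by nlinarith
    have hsK : 0 < s ^ (K + 2) := pow_pos hs0 _
    by_contra hD0
    push Not at hD0
    have : D * s ^ (K + 2) ≤ 0 := mul_nonpos_of_nonpos_of_nonneg hD0 hsK.le
    linarith
  -- Step 4: `P < 0` somewhere in `(0, s*)` (slope at `s*`), hence a zero `s₀ ∈ (0, s*)` of `P`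
  obtain ⟨s₁, hs₁0, hs₁s, hPs₁⟩ : ∃ s₁, 0 < s₁ ∧ s₁ < s ∧ P s₁ < 0 := by
    have hsl : Tendsto (slope P s) (𝓝[≠] s) (𝓝 D) := hasDerivAt_iff_tendsto_slope.1 hderiv
    have hsl' : Tendsto (slope P s) (𝓝[<] s) (𝓝 D) :=
      hsl.mono_left (nhdsWithin_mono _ fun t ht => ne_of_lt ht)
    have hev : ∀ᶠ t in 𝓝[<] s, 0 < slope P s t := hsl'.eventually (lt_mem_nhds hDpos)
    have hev2 : ∀ᶠ t in 𝓝[<] s, t ∈ Set.Ioo 0 s := Ioo_mem_nhdsLT hs0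
    obtain ⟨t, ht1, ht2⟩ := (hev.and hev2).exists
    refine ⟨t, ht2.1, ht2.2, ?_⟩
    rw [slope_def_field, hPs] at ht1
    have hts : t - s < 0 := by linarith [ht2.2]
    have hmul := mul_neg_of_pos_of_neg ht1 hts
    rw [div_mul_cancel₀ _ hts.ne] at hmul
    linarith
  obtain ⟨s₀, ⟨hs₀0, hs₀1⟩, hPs₀⟩ : ∃ s₀ ∈ Set.Ioo (0 : ℝ) s₁, P s₀ = 0 := by
    have hcont : ContinuousOn P (Set.Icc 0 s₁) := by
      simp only [hP]
      fun_prop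
    have h := intermediate_value_Ioo' hs₁0.le hcont
    exact h ⟨hPs₁, by rw [hP0]; exact zero_lt_one⟩
  -- Step 5: the two-cycle `(s₀, s₂ = f(s₀))` and the occupation probabilities `q = 1 - s`
  have hs₀s : s₀ < s := hs₀1.trans hs₁s
  have hs₀lt1 : s₀ < 1 := hs₀s.trans hs1
  set s₂ : ℝ := 1 / (1 + lam * s₀ ^ (K + 1)) with hs₂
  have hden₀ : 0 < 1 + lam * s₀ ^ (K + 1) := by positivity
  have hs₂lt1 : s₂ < 1 := by
    rw [hs₂, div_lt_one hden₀]
    have : 0 < lam * s₀ ^ (K + 1) := by positivity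
    linarith
  have hs₂gt : s < s₂ := by
    -- `f` is decreasing and `f(s*) = s*`
    have hss : s = 1 / (1 + lam * s ^ (K + 1)) := by
      field_simp
      linarith
    rw [hss, hs₂]
    refine one_div_lt_one_div_of_lt hden₀ ?_
    have : s₀ ^ (K + 1) < s ^ (K + 1) := pow_lt_pow_left₀ hs₀s hs₀0.le (by omega)
    nlinarith
  have hs₂pos : 0 < s₂ := hs0.trans hs₂gt
  -- `f(s₂) = s₀`, from `P(s₀) = 0`
  have hP₀ : (1 - s₀) * (1 + lam * s₀ ^ (K + 1)) ^ (K + 1) = lam * s₀ := by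
    have := hPs₀
    simp only [hP] at this
    linarith
  have hfs₂ : 1 / (1 + lam * s₂ ^ (K + 1)) = s₀ := by
    rw [hs₂, div_pow, one_pow]
    rw [div_eq_iff (by positivity), eq_comm]
    field_simp
    linear_combination (-1 : ℝ) * hP₀
  refine ⟨1 - s₀, 1 - s₂, by linarith, by linarith, by linarith, ?_, ?_⟩
  · -- `q⁺ = λ(1-q⁻)^k/(1+λ(1-q⁻)^k)`, i.e. `1 - s₀ = 1 - f(s₂)`
    rw [sub_sub_cancel, ← hfs₂]
    field_simp
    ring
  · -- `q⁻ = λ(1-q⁺)^k/(1+λ(1-q⁺)^k)`, i.e. `1 - s₂ = 1 - f(s₀)`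
    rw [sub_sub_cancel, hs₂]
    field_simp
    ring


/-! ### Perfect matchings avoiding a rectangle (first-moment input)

Sly's gadget `G̃(n, θ, ψ)` (§2.1) and the Mossel–Weitz–Wormald graph are superpositions of
independent uniformly random perfect matchings between the two sides; the first moment of their
phase-restricted partition functions (Sly, proof of Lemma 3.1, eq. (e:gtEZ1); MWW09 Prop. 3.1) rests
on one computation: for a configuration occupying `A` on one side and `B` on the other, "the
probability that a perfect matching does not connect two 1's of the configuration" is
`C(n-|B|, |A|)/C(n, |A|)`. Identifying perfect matchings with permutations, this is the count
`card_perm_filter_forall_not_mem` (`= (n-|B|)^{(|A|)} (n-|A|)!`, falling factorial) and the ratio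
`card_perm_filter_forall_not_mem_div_factorial`. -/

section Matchings

open Finset

variable {α : Type*} [Fintype α] [DecidableEq α]

/-- The permutations agreeing with a fixed permutation `σ₀` on a set `A` are as many as the
permutations of the complement of `A`: `(|α| - |A|)!`. [folklore] -/
theorem card_perm_filter_eqOn (A : Finset α) (σ₀ : Equiv.Perm α) :
    (Finset.univ.filter fun σ : Equiv.Perm α => ∀ a ∈ A, σ a = σ₀ a).card =
      (Fintype.card α - A.card).factorial := by
  -- translate by `σ₀⁻¹`: permutations fixing `A` pointwise
  have h1 : (Finset.univ.filter fun σ : Equiv.Perm α => ∀ a ∈ A, σ a = σ₀ a).card =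
      (Finset.univ.filter fun τ : Equiv.Perm α => ∀ a ∈ A, τ a = a).card := by
    refine Finset.card_nbij' (fun σ => σ₀⁻¹ * σ) (fun τ => σ₀ * τ) ?_ ?_ ?_ ?_
    · intro σ hσ
      simp only [Finset.coe_filter, Finset.mem_univ, true_and, Set.mem_setOf_eq] at hσ ⊢
      intro a ha
      rw [Equiv.Perm.mul_apply, hσ a ha]
      simp
    · intro τ hτ
      simp only [Finset.coe_filter, Finset.mem_univ, true_and, Set.mem_setOf_eq] at hτ ⊢
      intro a ha
      rw [Equiv.Perm.mul_apply, hτ a ha]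
    · intro σ _
      exact mul_inv_cancel_left σ₀ σ
    · intro τ _
      exact inv_mul_cancel_left σ₀ τ
  rw [h1]
  -- permutations fixing `A` pointwise = permutations of `{x // x ∉ A}`
  have h2 : (Finset.univ.filter fun τ : Equiv.Perm α => ∀ a ∈ A, τ a = a).card =
      Fintype.card {f : Equiv.Perm α // ∀ a, ¬ (a ∉ A) → f a = a} := by
    rw [Fintype.card_subtype]
    congr 1
    ext τ
    simp only [Finset.mem_filter, Finset.mem_univ, true_and, not_not]
  rw [h2, ← Fintype.card_congr (Equiv.Perm.subtypeEquivSubtypePerm fun x => x ∉ A),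
    Fintype.card_perm, Fintype.card_subtype_compl, Fintype.card_coe]

/-- **Permutations mapping `A` into `C`.** The number of permutations `σ` of a finite type with
`σ(A) ⊆ C` is `|C|(|C|-1)⋯(|C|-|A|+1) · (|α| - |A|)!`: an injection `A ↪ C` followed by an
arbitrary bijection of the complements. [folklore] -/
theorem card_perm_filter_forall_mem (A C : Finset α) :
    (Finset.univ.filter fun σ : Equiv.Perm α => ∀ a ∈ A, σ a ∈ C).card =
      C.card.descFactorial A.card * (Fintype.card α - A.card).factorial := by
  classical
  -- the restriction of a permutation to `A`
  set φ : Equiv.Perm α → (A → α) := fun σ a => σ a with hφ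
  set T : Finset (A → α) := Finset.univ.filter fun h => Function.Injective h ∧ ∀ a, h a ∈ C
    with hT
  have hmaps : ∀ σ ∈ Finset.univ.filter (fun σ : Equiv.Perm α => ∀ a ∈ A, σ a ∈ C), φ σ ∈ T := by
    intro σ hσ
    simp only [Finset.mem_filter, Finset.mem_univ, true_and] at hσ
    simp only [hT, hφ, Finset.mem_filter, Finset.mem_univ, true_and]
    exact ⟨fun a b hab => Subtype.ext (σ.injective hab), fun a => hσ a a.2⟩
  rw [Finset.card_eq_sum_card_fiberwise hmaps]
  -- every fibre has `(|α| - |A|)!` elements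
  have hfib : ∀ h ∈ T, ((Finset.univ.filter fun σ : Equiv.Perm α => ∀ a ∈ A, σ a ∈ C).filter
      fun σ => φ σ = h).card = (Fintype.card α - A.card).factorial := by
    intro h hmem
    simp only [hT, Finset.mem_filter, Finset.mem_univ, true_and] at hmem
    obtain ⟨hinj, hC⟩ := hmem
    obtain ⟨σ₀, hσ₀⟩ :=
      Equiv.Perm.exists_extending_pair (Subtype.val : A → α) h Subtype.val_injective hinj
    rw [← card_perm_filter_eqOn A σ₀, Finset.filter_filter]
    congr 1
    ext σ
    simp only [Finset.mem_filter, Finset.mem_univ, true_and, hφ]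
    constructor
    · rintro ⟨-, hφσ⟩ a ha
      rw [hσ₀ ⟨a, ha⟩]
      exact congrFun hφσ ⟨a, ha⟩
    · intro hσ
      refine ⟨fun a ha => ?_, funext fun a => ?_⟩
      · rw [hσ a ha, hσ₀ ⟨a, ha⟩]
        exact hC ⟨a, ha⟩
      · rw [hσ a a.2, hσ₀ ⟨a, a.2⟩]
  rw [Finset.sum_congr rfl hfib, Finset.sum_const, smul_eq_mul]
  congr 1
  -- `#T` = number of injections `A ↪ C`
  have hTcard : T.card = Fintype.card (A ↪ C) := by
    rw [hT, ← Fintype.card_subtype]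
    refine Fintype.card_congr
      { toFun := fun h => ⟨fun a => ⟨h.1 a, h.2.2 a⟩, fun a b hab => h.2.1 (congrArg Subtype.val hab)⟩
        invFun := fun e => ⟨fun a => (e a).val,
          ⟨fun a b hab => e.injective (Subtype.ext hab), fun a => (e a).2⟩⟩
        left_inv := fun h => rfl
        right_inv := fun e => by ext; rfl }
  rw [hTcard, Fintype.card_embedding_eq, Fintype.card_coe, Fintype.card_coe]

/-- **Perfect matchings avoiding a rectangle** (the first-moment computation for random bipartite
graphs built from perfect matchings). Identify the perfect matchings between two copies of a finite
set with its permutations: among the `|α|!` of them, exactly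
`(|α|-|B|)(|α|-|B|-1)⋯(|α|-|B|-|A|+1) · (|α|-|A|)!` match no element of `A` (on one side) to an
element of `B` (on the other) — "the probability that a perfect matching does not connect two 1's
of the configuration" occupying `A` and `B` is `C(|α|-|B|, |A|)/C(|α|, |A|)`
(`card_perm_filter_forall_not_mem_div_factorial`).
[cite: Sly2010, proof of Lemma 3.1 (eq. (e:gtEZ1), after Mossel–Weitz–Wormald 2009)] -/
theorem card_perm_filter_forall_not_mem (A B : Finset α) :
    (Finset.univ.filter fun σ : Equiv.Perm α => ∀ a ∈ A, σ a ∉ B).card =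
      (Fintype.card α - B.card).descFactorial A.card * (Fintype.card α - A.card).factorial := by
  rw [← Finset.card_compl, ← card_perm_filter_forall_mem A Bᶜ]
  congr 1
  ext σ
  simp only [Finset.mem_filter, Finset.mem_univ, true_and, Finset.mem_compl]

/-- The matching-avoidance probability: `#{σ : σ(A) ∩ B = ∅}/|α|! = C(|α|-|B|, |A|)/C(|α|, |A|)`.
[cite: Sly2010, proof of Lemma 3.1 (eq. (e:gtEZ1)), and the formula for `E Z^{α,β}_{MWW}`] -/
theorem card_perm_filter_forall_not_mem_div_factorial (A B : Finset α) :
    ((Finset.univ.filter fun σ : Equiv.Perm α => ∀ a ∈ A, σ a ∉ B).card : ℝ) /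
        (Fintype.card α).factorial =
      ((Fintype.card α - B.card).choose A.card : ℝ) / ((Fintype.card α).choose A.card) := by
  rw [card_perm_filter_forall_not_mem]
  set n := Fintype.card α with hn
  have hA : A.card ≤ n := by rw [hn]; exact A.card_le_univ
  have h1 : (n.choose A.card : ℝ) * (A.card.factorial : ℝ) * ((n - A.card).factorial : ℝ) =
      (n.factorial : ℝ) := by
    exact_mod_cast Nat.choose_mul_factorial_mul_factorial hA
  have h2 : ((n - B.card).descFactorial A.card : ℝ) =
      (A.card.factorial : ℝ) * ((n - B.card).choose A.card : ℝ) := by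
    exact_mod_cast Nat.descFactorial_eq_factorial_mul_choose _ _
  have hc : (0 : ℝ) < n.choose A.card := by exact_mod_cast Nat.choose_pos hA
  have hf1 : (0 : ℝ) < A.card.factorial := by exact_mod_cast Nat.factorial_pos _
  have hf2 : (0 : ℝ) < (n - A.card).factorial := by exact_mod_cast Nat.factorial_pos _
  push_cast
  rw [h2, ← h1]
  field_simp

end Matchings


/-! ### Sly's Lemma 3.2: perturbation of binomial coefficients

"To complete Lemma 3.1 we give the following lemma which [is] a simple expansion of factorials
which [we] will use repeatedly throughout this section": for `0 < b < a` and `x² + y² ≤ min{b, a-b}`,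
`C(a+x, b+y)/C(a, b) = (1 + O((x²+y²)/min{b, a-b})) (a/(a-b))^x ((a-b)/b)^y`. Here with an explicit
constant, in logarithmic form and for perturbations of either sign (`abs_log_choose_sub_le`), from
the one-factorial estimates `log (N ± t)! - log N! ∓ t log N = O(t²/N)`
(`log_factorial_add_sub_mem`, `log_factorial_sub_sub_mem`, `abs_log_factorial_sub_le`). -/

section Binomial

open Finset

/-- `log (N+t)! = log N! + Σ_{i<t} log (N+1+i)`. [folklore] -/
theorem log_factorial_add (N t : ℕ) :
    Real.log ((N + t).factorial : ℝ) =
      Real.log (N.factorial : ℝ) + ∑ i ∈ Finset.range t, Real.log ((N : ℝ) + 1 + i) := by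
  induction t with
  | zero => simp
  | succ t ih =>
    rw [show N + (t + 1) = (N + t) + 1 by ring, Nat.factorial_succ, Nat.cast_mul,
      Real.log_mul (by positivity) (by positivity), ih, Finset.sum_range_succ]
    push_cast
    ring

/-- Upward perturbation of `log N!`: for `N > 0`,
`0 ≤ log (N+t)! - log N! - t log N ≤ t²/N` (the sum of `log (1 + (i+1)/N) ≤ (i+1)/N ≤ t/N`).
[cite: Sly2010, proof of Lemma 3.2 (expansion of factorials)] -/
theorem log_factorial_add_sub_mem (N t : ℕ) (hN : 0 < N) :
    0 ≤ Real.log ((N + t).factorial : ℝ) - Real.log (N.factorial : ℝ) - t * Real.log N ∧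
      Real.log ((N + t).factorial : ℝ) - Real.log (N.factorial : ℝ) - t * Real.log N ≤
        (t : ℝ) ^ 2 / N := by
  have hNr : (0 : ℝ) < N := by exact_mod_cast hN
  have key : Real.log ((N + t).factorial : ℝ) - Real.log (N.factorial : ℝ) - t * Real.log N =
      ∑ i ∈ Finset.range t, Real.log (1 + ((i : ℝ) + 1) / N) := by
    rw [log_factorial_add]
    have : (t : ℝ) * Real.log N = ∑ _i ∈ Finset.range t, Real.log (N : ℝ) := by
      rw [Finset.sum_const, Finset.card_range, nsmul_eq_mul]
    rw [this, add_sub_cancel_left, ← Finset.sum_sub_distrib]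
    refine Finset.sum_congr rfl fun i _ => ?_
    rw [← Real.log_div (by positivity) hNr.ne']
    congr 1
    field_simp
    ring
  rw [key]
  constructor
  · exact Finset.sum_nonneg fun i _ => Real.log_nonneg (by
      have : (0 : ℝ) ≤ ((i : ℝ) + 1) / N := by positivity
      linarith)
  · calc ∑ i ∈ Finset.range t, Real.log (1 + ((i : ℝ) + 1) / N)
        ≤ ∑ _i ∈ Finset.range t, (t : ℝ) / N := by
          refine Finset.sum_le_sum fun i hi => ?_
          have hi' : (i : ℝ) + 1 ≤ t := by
            have := Finset.mem_range.1 hi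
            exact_mod_cast this
          have hpos : (0 : ℝ) < 1 + ((i : ℝ) + 1) / N := by positivity
          calc Real.log (1 + ((i : ℝ) + 1) / N) ≤ (1 + ((i : ℝ) + 1) / N) - 1 :=
                Real.log_le_sub_one_of_pos hpos
            _ = ((i : ℝ) + 1) / N := by ring
            _ ≤ (t : ℝ) / N := div_le_div_of_nonneg_right hi' hNr.le
      _ = (t : ℝ) ^ 2 / N := by
          rw [Finset.sum_const, Finset.card_range, nsmul_eq_mul]
          ring

/-- Downward perturbation of `log N!`: for `2s ≤ N`, `N > 0`,
`-2s²/N ≤ log N! - log (N-s)! - s log N ≤ 0` (the sum of `log ((N-s+1+i)/N) ∈ [-2s/N, 0]`).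
[cite: Sly2010, proof of Lemma 3.2 (expansion of factorials)] -/
theorem log_factorial_sub_sub_mem (N s : ℕ) (hN : 0 < N) (hs : 2 * s ≤ N) :
    -(2 * (s : ℝ) ^ 2 / N) ≤
        Real.log (N.factorial : ℝ) - Real.log ((N - s).factorial : ℝ) - s * Real.log N ∧
      Real.log (N.factorial : ℝ) - Real.log ((N - s).factorial : ℝ) - s * Real.log N ≤ 0 := by
  obtain ⟨M, rfl⟩ : ∃ M, N = M + s := ⟨N - s, by omega⟩
  rw [Nat.add_sub_cancel]
  have hNr : (0 : ℝ) < (M : ℝ) + s := by exact_mod_cast hN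
  have key : Real.log ((M + s).factorial : ℝ) - Real.log (M.factorial : ℝ) -
      s * Real.log ((M + s : ℕ) : ℝ) =
        ∑ i ∈ Finset.range s, Real.log (((M : ℝ) + 1 + i) / ((M : ℝ) + s)) := by
    rw [log_factorial_add]
    have : (s : ℝ) * Real.log ((M + s : ℕ) : ℝ) = ∑ _i ∈ Finset.range s, Real.log ((M : ℝ) + s) := by
      rw [Finset.sum_const, Finset.card_range, nsmul_eq_mul]
      push_cast
      ring
    rw [this, add_sub_cancel_left, ← Finset.sum_sub_distrib]
    refine Finset.sum_congr rfl fun i _ => ?_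
    rw [Real.log_div (by positivity) hNr.ne']
  rw [key]
  constructor
  · -- each term is `≥ 1 - (M+s)/(M+1+i) ≥ -2s/N`
    have hterm : ∀ i ∈ Finset.range s,
        -(2 * (s : ℝ) / ((M : ℝ) + s)) ≤ Real.log (((M : ℝ) + 1 + i) / ((M : ℝ) + s)) := by
      intro i _
      have hpos : (0 : ℝ) < ((M : ℝ) + 1 + i) / ((M : ℝ) + s) := by positivity
      refine le_trans ?_ (Real.one_sub_inv_le_log_of_pos hpos)
      rw [inv_div]
      -- `1 - (M+s)/(M+1+i) ≥ -2s/(M+s)` since `s ≤ M`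
      have hM1 : (0 : ℝ) < (M : ℝ) + 1 + i := by positivity
      have hsM : (s : ℝ) ≤ M := by exact_mod_cast (show s ≤ M by omega)
      have hi0 : (0 : ℝ) ≤ i := Nat.cast_nonneg i
      rw [neg_le_sub_iff_le_add, div_le_iff₀ hM1]
      have e : (1 + 2 * (s : ℝ) / ((M : ℝ) + s)) * ((M : ℝ) + 1 + i) =
          ((M : ℝ) + 1 + i) + 2 * s * ((M : ℝ) + 1 + i) / ((M : ℝ) + s) := by ring
      rw [e]
      have h2 : (s : ℝ) ≤ 2 * s * ((M : ℝ) + 1 + i) / ((M : ℝ) + s) := by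
        rw [le_div_iff₀ hNr]
        nlinarith
      linarith
    calc -(2 * (s : ℝ) ^ 2 / ((M + s : ℕ) : ℝ)) = ∑ _i ∈ Finset.range s, -(2 * (s : ℝ) / ((M : ℝ) + s)) := by
          rw [Finset.sum_const, Finset.card_range, nsmul_eq_mul]
          push_cast
          ring
      _ ≤ _ := Finset.sum_le_sum hterm
  · refine Finset.sum_nonpos fun i hi => Real.log_nonpos (by positivity) ?_
    rw [div_le_one hNr]
    have := Finset.mem_range.1 hi
    have : (i : ℝ) + 1 ≤ s := by exact_mod_cast this
    linarith

/-- Perturbation of `log N!` in either direction: for `N > 0` and `2|N' - N| ≤ N`,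
`|log N'! - log N! - (N' - N) log N| ≤ 2 (N' - N)²/N`. [cite: Sly2010, proof of Lemma 3.2] -/
theorem abs_log_factorial_sub_le (N N' : ℕ) (hN : 0 < N) (h : 2 * |(N' : ℝ) - N| ≤ N) :
    |Real.log (N'.factorial : ℝ) - Real.log (N.factorial : ℝ) - ((N' : ℝ) - N) * Real.log N| ≤
      2 * ((N' : ℝ) - N) ^ 2 / N := by
  have hNr : (0 : ℝ) < N := by exact_mod_cast hN
  rcases le_total N N' with hle | hle
  · obtain ⟨t, rfl⟩ : ∃ t, N' = N + t := ⟨N' - N, by omega⟩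
    have ht : ((N + t : ℕ) : ℝ) - N = t := by push_cast; ring
    rw [ht]
    obtain ⟨h1, h2⟩ := log_factorial_add_sub_mem N t hN
    rw [abs_le, show 2 * (t : ℝ) ^ 2 / N = 2 * ((t : ℝ) ^ 2 / N) by ring]
    have : (0 : ℝ) ≤ (t : ℝ) ^ 2 / N := by positivity
    constructor <;> linarith
  · obtain ⟨s, rfl⟩ : ∃ s, N = N' + s := ⟨N - N', by omega⟩
    have hs2 : 2 * s ≤ N' + s := by
      have h' : 2 * |((N' : ℝ) - ((N' + s : ℕ) : ℝ))| ≤ ((N' + s : ℕ) : ℝ) := h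
      have : |((N' : ℝ) - ((N' + s : ℕ) : ℝ))| = s := by
        push_cast
        rw [show (N' : ℝ) - (N' + s) = -s by ring, abs_neg, abs_of_nonneg (Nat.cast_nonneg s)]
      rw [this] at h'
      exact_mod_cast h'
    obtain ⟨h1, h2⟩ := log_factorial_sub_sub_mem (N' + s) s hN hs2
    rw [Nat.add_sub_cancel] at h1 h2
    have hs : ((N' : ℝ) - ((N' + s : ℕ) : ℝ)) = -s := by push_cast; ring
    rw [hs]
    rw [abs_le, show 2 * (-(s : ℝ)) ^ 2 / ((N' + s : ℕ) : ℝ) = 2 * ((s : ℝ) ^ 2 / ((N' + s : ℕ) : ℝ)) by ring,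
      show Real.log (N'.factorial : ℝ) - Real.log ((N' + s).factorial : ℝ) -
          -(s : ℝ) * Real.log ((N' + s : ℕ) : ℝ) =
        -(Real.log ((N' + s).factorial : ℝ) - Real.log (N'.factorial : ℝ) -
          (s : ℝ) * Real.log ((N' + s : ℕ) : ℝ)) by ring]
    have : (0 : ℝ) ≤ (s : ℝ) ^ 2 / ((N' + s : ℕ) : ℝ) := by positivity
    rw [show 2 * (s : ℝ) ^ 2 / ((N' + s : ℕ) : ℝ) = 2 * ((s : ℝ) ^ 2 / ((N' + s : ℕ) : ℝ)) by ring] at h1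
    constructor <;> linarith
set_option maxHeartbeats 400000 in -- buildfix (bf3-g27): 160k/180k FAIL, 200k PASS at accept time; line-neutral budget line
/-- **Sly's Lemma 3.2 (perturbation of binomial coefficients), explicit form.** For integers
`0 < b < a` and perturbations `x = a' - a`, `y = b' - b` with `4|x|, 4|y| ≤ min{b, a-b}`,
`|log C(a', b') - log C(a, b) - x log (a/(a-b)) - y log ((a-b)/b)| ≤ 8 (x² + y²)/min{b, a-b}` —
the printed `C(a+x, b+y)/C(a, b) = (1 + O((x²+y²)/min{b, a-b})) (a/(a-b))^x ((a-b)/b)^y`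
("by expanding out factorials"), with the `O(·)` made explicit in logarithmic form.
[cite: Sly2010, Lemma 3.2] -/
theorem abs_log_choose_sub_le (a b a' b' : ℕ) (hb : 0 < b) (hba : b < a)
    (hx : 4 * |(a' : ℝ) - a| ≤ min (b : ℝ) ((a : ℝ) - b))
    (hy : 4 * |(b' : ℝ) - b| ≤ min (b : ℝ) ((a : ℝ) - b)) :
    |Real.log (a'.choose b' : ℝ) - Real.log (a.choose b : ℝ) -
        ((a' : ℝ) - a) * Real.log ((a : ℝ) / ((a : ℝ) - b)) -
          ((b' : ℝ) - b) * Real.log (((a : ℝ) - b) / b)| ≤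
      8 * (((a' : ℝ) - a) ^ 2 + ((b' : ℝ) - b) ^ 2) / min (b : ℝ) ((a : ℝ) - b) := by
  -- notation and basic positivity
  set x : ℝ := (a' : ℝ) - a with hxdef
  set y : ℝ := (b' : ℝ) - b with hydef
  set m : ℝ := min (b : ℝ) ((a : ℝ) - b) with hm
  have hbr : (0 : ℝ) < b := by exact_mod_cast hb
  have habr : (0 : ℝ) < (a : ℝ) - b := by
    have : (b : ℝ) < a := by exact_mod_cast hba
    linarith
  have har : (0 : ℝ) < a := by linarith
  have hm0 : 0 < m := lt_min hbr habr
  have hmb : m ≤ b := min_le_left _ _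
  have hmab : m ≤ (a : ℝ) - b := min_le_right _ _
  have hxa : |x| ≤ m / 4 := by linarith
  have hya : |y| ≤ m / 4 := by linarith
  have hxabs := abs_le.1 hxa
  have hyabs := abs_le.1 hya
  -- `b' ≤ a'` and the integer bookkeeping `a' - b' = (a - b) + (x - y)`
  have hab : b ≤ a := hba.le
  have hab' : b' ≤ a' := by
    have : (b' : ℝ) ≤ a' := by
      have h1 : (a' : ℝ) = a + x := by rw [hxdef]; ring
      have h2 : (b' : ℝ) = b + y := by rw [hydef]; ring
      rw [h1, h2]
      linarith
    exact_mod_cast this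
  have hcast : (((a' - b' : ℕ) : ℝ)) - ((a - b : ℕ) : ℝ) = x - y := by
    push_cast [Nat.cast_sub hab, Nat.cast_sub hab']
    rw [hxdef, hydef]; ring
  -- the three factorial perturbations
  have hA := abs_log_factorial_sub_le a a' (by omega) (by
    rw [← hxdef]
    linarith [le_trans hmab (by linarith : (a : ℝ) - b ≤ a)])
  have hB := abs_log_factorial_sub_le b b' hb (by rw [← hydef]; linarith)
  have hC := abs_log_factorial_sub_le (a - b) (a' - b') (by omega) (by
    rw [hcast, Nat.cast_sub hab]
    have : |x - y| ≤ |x| + |y| := abs_sub x y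
    linarith)
  rw [hcast, Nat.cast_sub hab] at hC
  rw [← hxdef] at hA
  rw [← hydef] at hB
  -- `log C = log a! - log b! - log (a-b)!`
  have hchoose : ∀ {p q : ℕ}, q ≤ p → Real.log (p.choose q : ℝ) =
      Real.log (p.factorial : ℝ) - Real.log (q.factorial : ℝ) - Real.log ((p - q).factorial : ℝ) := by
    intro p q hqp
    have h := Nat.choose_mul_factorial_mul_factorial hqp
    have h' : (p.choose q : ℝ) * (q.factorial : ℝ) * ((p - q).factorial : ℝ) = (p.factorial : ℝ) := by
      exact_mod_cast h
    have hq : (0 : ℝ) < q.factorial := by exact_mod_cast Nat.factorial_pos q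
    have hpq : (0 : ℝ) < (p - q).factorial := by exact_mod_cast Nat.factorial_pos (p - q)
    have hc : (0 : ℝ) < p.choose q := by exact_mod_cast Nat.choose_pos hqp
    rw [← h', Real.log_mul (by positivity) hpq.ne', Real.log_mul hc.ne' hq.ne']
    ring
  rw [hchoose hab', hchoose hab]
  -- main terms: `x log a - y log b - (x - y) log (a - b) = x log (a/(a-b)) + y log ((a-b)/b)`
  rw [Real.log_div har.ne' habr.ne', Real.log_div habr.ne' hbr.ne']
  have hsplit : Real.log (a'.factorial : ℝ) - Real.log (b'.factorial : ℝ) -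
        Real.log ((a' - b').factorial : ℝ) -
      (Real.log (a.factorial : ℝ) - Real.log (b.factorial : ℝ) - Real.log ((a - b).factorial : ℝ)) -
      x * (Real.log a - Real.log ((a : ℝ) - b)) - y * (Real.log ((a : ℝ) - b) - Real.log b) =
      (Real.log (a'.factorial : ℝ) - Real.log (a.factorial : ℝ) - x * Real.log a) -
      (Real.log (b'.factorial : ℝ) - Real.log (b.factorial : ℝ) - y * Real.log b) -
      (Real.log ((a' - b').factorial : ℝ) - Real.log ((a - b).factorial : ℝ) -
        (x - y) * Real.log ((a : ℝ) - b)) := by ring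
  rw [hsplit]
  -- triangle inequality and the three bounds
  have htri : ∀ p q r : ℝ, |p - q - r| ≤ |p| + |q| + |r| := by
    intro p q r
    calc |p - q - r| ≤ |p - q| + |r| := abs_sub _ _
      _ ≤ |p| + |q| + |r| := by linarith [abs_sub p q]
  refine (htri _ _ _).trans ?_
  have e1 : 2 * x ^ 2 / a ≤ 2 * x ^ 2 / m :=
    div_le_div_of_nonneg_left (by positivity) hm0 (hmab.trans (by linarith))
  have e2 : 2 * y ^ 2 / b ≤ 2 * y ^ 2 / m := div_le_div_of_nonneg_left (by positivity) hm0 hmb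
  have e3 : 2 * (x - y) ^ 2 / ((a : ℝ) - b) ≤ 2 * (x - y) ^ 2 / m :=
    div_le_div_of_nonneg_left (by positivity) hm0 hmab
  have e4 : (x - y) ^ 2 ≤ 2 * (x ^ 2 + y ^ 2) := by nlinarith [sq_nonneg (x + y)]
  calc |Real.log (a'.factorial : ℝ) - Real.log (a.factorial : ℝ) - x * Real.log a| +
        |Real.log (b'.factorial : ℝ) - Real.log (b.factorial : ℝ) - y * Real.log b| +
        |Real.log ((a' - b').factorial : ℝ) - Real.log ((a - b).factorial : ℝ) -
          (x - y) * Real.log ((a : ℝ) - b)|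
      ≤ 2 * x ^ 2 / a + 2 * y ^ 2 / b + 2 * (x - y) ^ 2 / ((a : ℝ) - b) := by
        linarith [hA, hB, hC]
    _ ≤ 2 * x ^ 2 / m + 2 * y ^ 2 / m + 2 * (2 * (x ^ 2 + y ^ 2)) / m := by
        have : 2 * (x - y) ^ 2 / m ≤ 2 * (2 * (x ^ 2 + y ^ 2)) / m :=
          div_le_div_of_nonneg_right (by linarith) hm0.le
        linarith
    _ = 6 * (x ^ 2 + y ^ 2) / m := by ring
    _ ≤ 8 * (x ^ 2 + y ^ 2) / m :=
        div_le_div_of_nonneg_right (by nlinarith [sq_nonneg x, sq_nonneg y]) hm0.le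

end Binomial


/-! ### The Mossel–Weitz–Wormald first moment, exactly

With the matching count above, the first moment of the MWW partition function restricted to
configurations of prescribed sizes is an exact identity (Sly §3, the display for `Z^{α,β}_{MWW}`
quoted from [MWW09], Prop. 3.1): modelling the random bipartite `d`-regular multigraph as `d`
independent uniform perfect matchings, `E Z^{a,b} = λ^{a+b} C(n,a) C(n,b) [C(n-b,a)/C(n,a)]^d`
(`mww_firstMoment`, a finite average over `(Perm [n])^d`; `card_perm_filter_forall_not_mem'` is the
rewriting form of the matching count, `descFactorial_mul_factorial_div_factorial` the arithmetic). -/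

section FirstMoment

open Finset

/-- `card_perm_filter_forall_not_mem` for an ARBITRARY decidability instance of the avoidance
predicate (the count does not depend on it; at `α = Fin n` Lean infers a `Fin`-specific instance,
so this is the form to rewrite with). [folklore] -/
theorem card_perm_filter_forall_not_mem' {α : Type*} [Fintype α] [DecidableEq α] (A B : Finset α)
    (inst : DecidablePred fun σ : Equiv.Perm α => ∀ a ∈ A, σ a ∉ B) :
    (@Finset.filter (Equiv.Perm α) (fun σ : Equiv.Perm α => ∀ a ∈ A, σ a ∉ B) inst
        Finset.univ).card =
      (Fintype.card α - B.card).descFactorial A.card * (Fintype.card α - A.card).factorial := by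
  convert card_perm_filter_forall_not_mem A B using 3

/-- Falling factorials against binomials: for `a ≤ n`,
`c(c-1)⋯(c-a+1) · (n-a)! / n! = C(c, a)/C(n, a)`. [folklore] -/
theorem descFactorial_mul_factorial_div_factorial (n a c : ℕ) (ha : a ≤ n) :
    ((c.descFactorial a * (n - a).factorial : ℕ) : ℝ) / (n.factorial : ℝ) =
      (c.choose a : ℝ) / (n.choose a) := by
  have h1 : (n.choose a : ℝ) * (a.factorial : ℝ) * ((n - a).factorial : ℝ) = (n.factorial : ℝ) := by
    exact_mod_cast Nat.choose_mul_factorial_mul_factorial ha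
  have h2 : (c.descFactorial a : ℝ) = (a.factorial : ℝ) * (c.choose a : ℝ) := by
    exact_mod_cast Nat.descFactorial_eq_factorial_mul_choose _ _
  have hc : (0 : ℝ) < n.choose a := by exact_mod_cast Nat.choose_pos ha
  have hf1 : (0 : ℝ) < a.factorial := by exact_mod_cast Nat.factorial_pos _
  have hf2 : (0 : ℝ) < (n - a).factorial := by exact_mod_cast Nat.factorial_pos _
  push_cast
  rw [h2, ← h1]
  field_simp

/-- **The Mossel–Weitz–Wormald first moment, exactly.** Model the random bipartite `d`-regular
multigraph on `W⁺ = W⁻ = [n]` as `d` independent uniformly random perfect matchings, i.e. a uniform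
point `σ` of `(Perm [n])^d` (`σ_i` matches `w ∈ W⁺` to `σ_i w ∈ W⁻`), and let `Z^{a,b}(σ)` be the
total `λ`-weight `λ^{a+b}` of the pairs `(S ⊆ W⁺, T ⊆ W⁻)`, `|S| = a`, `|T| = b`, with `S ∪ T`
independent (no matching edge joins `S` to `T`). Then
`E Z^{a,b} = λ^{a+b} C(n,a) C(n,b) [C(n-b,a)/C(n,a)]^d` — Sly's display
"`Z^{α,β}_{MWW} = λ^{αn+βn} C(n,αn) C(n,βn) [C(n-βn,αn)/C(n,αn)]^d`" (the expectation, after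
[MWW09]) — here as the finite average over `(Perm [n])^d`: the `d` matchings avoid the rectangle
`S × T` independently, each with probability `C(n-b,a)/C(n,a)`
(`card_perm_filter_forall_not_mem_div_factorial`).
[cite: Sly2010, §3 (proof of Lemma 3.1: the display for `Z^{α,β}_{MWW}`, after Mossel–Weitz–Wormald 2009 Prop. 3.1)] -/
theorem mww_firstMoment (n d a b : ℕ) (lam : ℝ) :
    (∑ σ : Fin d → Equiv.Perm (Fin n), ∑ S ∈ (Finset.univ : Finset (Fin n)).powersetCard a,
        ∑ T ∈ (Finset.univ : Finset (Fin n)).powersetCard b,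
          if (∀ i, ∀ s ∈ S, σ i s ∉ T) then lam ^ (a + b) else 0) / ((n.factorial : ℝ) ^ d) =
      lam ^ (a + b) * (n.choose a) * (n.choose b) * (((n - b).choose a : ℝ) / (n.choose a)) ^ d := by
  have hnf : (0 : ℝ) < (n.factorial : ℝ) ^ d := by positivity
  -- bring the sum over the matchings inside and factor it over the coordinates
  rw [Finset.sum_comm]
  have inner : ∀ S ∈ (Finset.univ : Finset (Fin n)).powersetCard a,
      (∑ σ : Fin d → Equiv.Perm (Fin n), ∑ T ∈ (Finset.univ : Finset (Fin n)).powersetCard b,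
          if (∀ i, ∀ s ∈ S, σ i s ∉ T) then lam ^ (a + b) else 0) =
        ∑ _T ∈ (Finset.univ : Finset (Fin n)).powersetCard b,
          lam ^ (a + b) * (((n - b).descFactorial a * (n - a).factorial : ℕ) : ℝ) ^ d := by
    intro S hS
    rw [Finset.sum_comm]
    refine Finset.sum_congr rfl fun T hT => ?_
    have hSa : S.card = a := (Finset.mem_powersetCard.1 hS).2
    have hTb : T.card = b := (Finset.mem_powersetCard.1 hT).2
    -- the indicator of `∀ i` is the product of the indicators
    have hind : ∀ σ : Fin d → Equiv.Perm (Fin n),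
        (if (∀ i, ∀ s ∈ S, σ i s ∉ T) then lam ^ (a + b) else 0) =
          lam ^ (a + b) * ∏ i, (if (∀ s ∈ S, σ i s ∉ T) then (1 : ℝ) else 0) := by
      intro σ
      rw [Finset.prod_boole]
      by_cases h : ∀ i, ∀ s ∈ S, σ i s ∉ T
      · rw [if_pos h, if_pos (fun i _ => h i), mul_one]
      · rw [if_neg h, if_neg (fun h' => h fun i => h' i (Finset.mem_univ i)), mul_zero]
    -- the count of matchings avoiding `S × T` (bridging the decidability instances by `convert`)
    have hcount : (Finset.univ.filter fun σ : Equiv.Perm (Fin n) => ∀ s ∈ S, σ s ∉ T).card =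
        (n - b).descFactorial a * (n - a).factorial := by
      rw [card_perm_filter_forall_not_mem' S T, Fintype.card_fin, hSa, hTb]
    simp_rw [hind]
    rw [← Finset.mul_sum, ← Fintype.sum_pow (fun σ : Equiv.Perm (Fin n) =>
      if (∀ s ∈ S, σ s ∉ T) then (1 : ℝ) else 0) d, Finset.sum_boole, hcount]
  rw [Finset.sum_congr rfl inner]
  simp only [Finset.sum_const, Finset.card_powersetCard, Finset.card_univ, Fintype.card_fin,
    nsmul_eq_mul]
  by_cases ha : a ≤ n
  · rw [← descFactorial_mul_factorial_div_factorial n a (n - b) ha, div_pow]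
    field_simp
  · -- `a > n`: no `S`, both sides vanish
    rw [Nat.choose_eq_zero_of_lt (not_le.1 ha)]
    simp

end FirstMoment


/-! ### Sly's first moment for the gadget core `G̃` (eq. (e:gtEZ1)), exactly

The same computation for Sly's `G̃(n, θ, ψ)` before the trees are appended: halves
`W^{±} ∪ U^{±} = [n] ⊔ [m']`, `d - 1` uniform perfect matchings of the halves and one of `W⁺` with
`W⁻`, boundary configuration `η = (E⁺, E⁻)` on `U`:
`E Z^{a,b}(η) = λ^{a+b+η⁺+η⁻} C(n,a) C(n,b) [C(n+m'-b-η⁻, a+η⁺)/C(n+m', a+η⁺)]^{d-1} C(n-b,a)/C(n,a)`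
(`sly_firstMoment`). Together with `mww_firstMoment` this is the exact input of Sly's Lemma 3.1
(whose `1 + O(n^{-1/2})` then comes from Lemma 3.2, `abs_log_choose_sub_le`). -/

section SlyFirstMoment

open Finset

/-- The occupied vertices `S ⊆ W` and `E ⊆ U` of one half `W ∪ U = [n] ⊔ [m']` of Sly's `G̃`, as
a subset of `Fin (n + m')` (`W` first, `U` last), have `|S| + |E|` elements. [folklore] -/
theorem card_map_castAddEmb_union_map_natAddEmb {n m' : ℕ} (S : Finset (Fin n)) (E : Finset (Fin m')) :
    (S.map (Fin.castAddEmb m') ∪ E.map (Fin.natAddEmb n)).card = S.card + E.card := by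
  rw [Finset.card_union_of_disjoint, Finset.card_map, Finset.card_map]
  rw [Finset.disjoint_left]
  intro v hv hv'
  obtain ⟨i, -, rfl⟩ := Finset.mem_map.1 hv
  obtain ⟨j, -, hj⟩ := Finset.mem_map.1 hv'
  have h1 : (Fin.castAddEmb m' i : Fin (n + m')).val < n := by simp
  have h2 : n ≤ (Fin.natAddEmb n j : Fin (n + m')).val := by simp
  rw [hj] at h2
  omega

/-- An indicator of a conjunction is the product of the indicators (with a weight). [folklore] -/
theorem ite_and_eq_mul_ite_ite {P Q : Prop} [Decidable P] [Decidable Q] (c : ℝ) :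
    (if P ∧ Q then c else 0) = c * (if P then 1 else 0) * (if Q then 1 else 0) := by
  by_cases hP : P <;> by_cases hQ : Q <;> simp [hP, hQ]

/-- **Sly's first moment for the gadget core `G̃` (eq. (e:gtEZ1)), exactly.** Model `G̃(n, θ, ψ)`
before the trees are appended: each half is `W^{±} ∪ U^{±} = [n] ⊔ [m']` (as `Fin (n + m')`, `W`
first); the edges are `d - 1 = k` independent uniform perfect matchings `σ_i` of the two halves
and one more uniform perfect matching `τ` of `W⁺` with `W⁻` — a uniform point of
`(Perm [n+m'])^k × Perm [n]`. For a boundary configuration `η` on `U` occupying `E⁺ ⊆ U⁺` and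
`E⁻ ⊆ U⁻`, let `Z^{a,b}(η)` be the total weight `λ^{a+b+|E⁺|+|E⁻|}` of the pairs
`(S ⊆ W⁺, T ⊆ W⁻)`, `|S| = a`, `|T| = b`, such that `S ∪ E⁺ ∪ T ∪ E⁻` is independent. Then
`E Z^{a,b}(η) = λ^{a+b+η⁺+η⁻} C(n,a) C(n,b) [C(n+m'-b-η⁻, a+η⁺)/C(n+m', a+η⁺)]^{d-1} C(n-b,a)/C(n,a)`
("by calculating the probability that a perfect matching does not connect two 1's of the
configuration"), here as the finite average. [cite: Sly2010, proof of Lemma 3.1, eq. (e:gtEZ1)] -/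
theorem sly_firstMoment (n m' k a b : ℕ) (Ep Em : Finset (Fin m')) (lam : ℝ) :
    (∑ σ : Fin k → Equiv.Perm (Fin (n + m')), ∑ τ : Equiv.Perm (Fin n),
        ∑ S ∈ (Finset.univ : Finset (Fin n)).powersetCard a,
          ∑ T ∈ (Finset.univ : Finset (Fin n)).powersetCard b,
            if ((∀ i, ∀ v ∈ S.map (Fin.castAddEmb m') ∪ Ep.map (Fin.natAddEmb n),
                  σ i v ∉ T.map (Fin.castAddEmb m') ∪ Em.map (Fin.natAddEmb n)) ∧
                (∀ s ∈ S, τ s ∉ T))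
            then lam ^ (a + b + Ep.card + Em.card) else 0) /
        (((n + m').factorial : ℝ) ^ k * (n.factorial : ℝ)) =
      lam ^ (a + b + Ep.card + Em.card) * (n.choose a) * (n.choose b) *
        (((n + m' - (b + Em.card)).choose (a + Ep.card) : ℝ) / ((n + m').choose (a + Ep.card))) ^ k *
          (((n - b).choose a : ℝ) / (n.choose a)) := by
  -- reorder: configurations `(S, T)` outside, matchings `(σ, τ)` inside
  have hswap : ∀ (f : (Fin k → Equiv.Perm (Fin (n + m'))) → Equiv.Perm (Fin n) →
      Finset (Fin n) → Finset (Fin n) → ℝ),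
      (∑ σ : Fin k → Equiv.Perm (Fin (n + m')), ∑ τ : Equiv.Perm (Fin n),
        ∑ S ∈ (Finset.univ : Finset (Fin n)).powersetCard a,
          ∑ T ∈ (Finset.univ : Finset (Fin n)).powersetCard b, f σ τ S T) =
      ∑ S ∈ (Finset.univ : Finset (Fin n)).powersetCard a,
        ∑ T ∈ (Finset.univ : Finset (Fin n)).powersetCard b,
          ∑ σ : Fin k → Equiv.Perm (Fin (n + m')), ∑ τ : Equiv.Perm (Fin n), f σ τ S T := by
    intro f
    rw [Finset.sum_comm]
    refine (Finset.sum_congr rfl fun τ _ => Finset.sum_comm).trans ?_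
    rw [Finset.sum_comm]
    refine Finset.sum_congr rfl fun S _ => ?_
    refine (Finset.sum_congr rfl fun τ _ => Finset.sum_comm).trans ?_
    rw [Finset.sum_comm]
    refine Finset.sum_congr rfl fun T _ => ?_
    exact Finset.sum_comm
  rw [hswap]
  -- the inner double sum, for fixed `S`, `T` of the prescribed sizes
  have inner : ∀ S ∈ (Finset.univ : Finset (Fin n)).powersetCard a,
      ∀ T ∈ (Finset.univ : Finset (Fin n)).powersetCard b,
      (∑ σ : Fin k → Equiv.Perm (Fin (n + m')), ∑ τ : Equiv.Perm (Fin n),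
          if ((∀ i, ∀ v ∈ S.map (Fin.castAddEmb m') ∪ Ep.map (Fin.natAddEmb n),
                σ i v ∉ T.map (Fin.castAddEmb m') ∪ Em.map (Fin.natAddEmb n)) ∧
              (∀ s ∈ S, τ s ∉ T))
          then lam ^ (a + b + Ep.card + Em.card) else 0) =
        lam ^ (a + b + Ep.card + Em.card) *
          ((((n + m' - (b + Em.card)).descFactorial (a + Ep.card) *
              (n + m' - (a + Ep.card)).factorial : ℕ) : ℝ) ^ k) *
          (((n - b).descFactorial a * (n - a).factorial : ℕ) : ℝ) := by
    intro S hS T hT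
    have hSa : S.card = a := (Finset.mem_powersetCard.1 hS).2
    have hTb : T.card = b := (Finset.mem_powersetCard.1 hT).2
    set L : Finset (Fin (n + m')) := S.map (Fin.castAddEmb m') ∪ Ep.map (Fin.natAddEmb n) with hL
    set R : Finset (Fin (n + m')) := T.map (Fin.castAddEmb m') ∪ Em.map (Fin.natAddEmb n) with hR
    have hLcard : L.card = a + Ep.card := by rw [hL, card_map_castAddEmb_union_map_natAddEmb, hSa]
    have hRcard : R.card = b + Em.card := by rw [hR, card_map_castAddEmb_union_map_natAddEmb, hTb]
    -- split the indicator and factor the sums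
    simp_rw [ite_and_eq_mul_ite_ite]
    have hbig : ∀ σ : Fin k → Equiv.Perm (Fin (n + m')),
        (if (∀ i, ∀ v ∈ L, σ i v ∉ R) then (1 : ℝ) else 0) =
          ∏ i, (if (∀ v ∈ L, σ i v ∉ R) then (1 : ℝ) else 0) := by
      intro σ
      rw [Finset.prod_boole]
      by_cases h : ∀ i, ∀ v ∈ L, σ i v ∉ R
      · rw [if_pos h, if_pos (fun i _ => h i)]
      · rw [if_neg h, if_neg (fun h' => h fun i => h' i (Finset.mem_univ i))]
    simp_rw [hbig]
    simp_rw [← Finset.mul_sum, ← Finset.sum_mul, ← Finset.mul_sum]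
    rw [← Fintype.sum_pow (fun σ : Equiv.Perm (Fin (n + m')) =>
        if (∀ v ∈ L, σ v ∉ R) then (1 : ℝ) else 0) k,
      Finset.sum_boole, Finset.sum_boole, card_perm_filter_forall_not_mem' L R,
      card_perm_filter_forall_not_mem' S T, Fintype.card_fin, Fintype.card_fin, hLcard, hRcard,
      hSa, hTb]
  rw [Finset.sum_congr rfl fun S hS => Finset.sum_congr rfl fun T hT => inner S hS T hT]
  simp only [Finset.sum_const, Finset.card_powersetCard, Finset.card_univ, Fintype.card_fin,
    nsmul_eq_mul]
  have hnf : (0 : ℝ) < ((n + m').factorial : ℝ) ^ k * (n.factorial : ℝ) := by positivity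
  by_cases ha : a ≤ n
  · have hbig := descFactorial_mul_factorial_div_factorial (n + m') (a + Ep.card)
      (n + m' - (b + Em.card)) (by
        have : Ep.card ≤ m' := by simpa using Ep.card_le_univ
        omega)
    have hsmall := descFactorial_mul_factorial_div_factorial n a (n - b) ha
    rw [← hbig, ← hsmall, div_pow]
    field_simp
  · rw [Nat.choose_eq_zero_of_lt (not_le.1 ha)]
    simp

end SlyFirstMoment


/-! ### The asymmetric critical point `(p⁺, p⁻)` of `Φ₁`

From the two-cycle `(q⁺, q⁻)` of the tree recursion, Sly's relation (e:pqRelation)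
`q^{±} = p^{±}/(1 - p^{∓})` defines densities `p^{±} = q^{±}(1-q^{∓})/(1-q⁺q⁻)`, and the two-cycle
equations become the two critical equations of the first-moment exponent `Φ₁` of §1.3,
`λ(1-p⁺-p⁻)^d = p^{±}(1-p^{±})^{d-1}` (`∂_α Φ₁ = ∂_β Φ₁ = 0`, i.e. `p⁻ = h(p⁺)`, `p⁺ = h(p⁻)` with
DFJ's `h`): `exists_slyCriticalDensities` — existence of the asymmetric pair among "the solutions to
`h(α) = β`, `h(β) = α`", for every `λ > λ_c(𝕋_d)`. -/

section CriticalPoint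

/-- **The asymmetric critical point `(p⁺, p⁻)` of the first-moment exponent.** For `d ≥ 3` and
`λ > λ_c(𝕋_d)` there are densities `0 < p⁻ < p⁺`, `p⁺ + p⁻ < 1`, solving both critical equations
of Sly's `Φ₁` — `λ(1-p⁺-p⁻)^d = p⁺(1-p⁺)^{d-1}` (`∂_α Φ₁ = 0`, i.e. `p⁻ = h(p⁺)`) and
`λ(1-p⁺-p⁻)^d = p⁻(1-p⁻)^{d-1}` (`∂_β Φ₁ = 0`, i.e. `p⁺ = h(p⁻)`), with DFJ's
`h(x) = (1-x)[1-(x/(λ(1-x)))^{1/d}]` — together with `0 < q⁻ < q⁺ < 1` related to them by Sly's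
(e:pqRelation) `q^{±} = p^{±}/(1-p^{∓})` and satisfying the tree recursion
`q^{±} = λ(1-q^{∓})^{d-1}/(1+λ(1-q^{∓})^{d-1})` ("the solutions to `h(α) = β, h(β) = α` … are
exactly `(p⁺,p⁻)`, `(p⁻,p⁺)` and `(p*,p*)`"; here: existence of the asymmetric pair, obtained from
the two-cycle `exists_hardCore_treeTwoCycle` by `p^{±} = q^{±}(1-q^{∓})/(1-q⁺q⁻)`).
[cite: Sly2010, §1.3 (first bullet, after MWW09 §4 and DFJ02 Claim 2.2; eq. (e:pqRelation))] -/
theorem exists_slyCriticalDensities {d : ℕ} (hd : 3 ≤ d) {lam : ℝ}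
    (hlam : hardCoreThreshold d < lam) :
    ∃ pp pm qp qm : ℝ, 0 < pm ∧ pm < pp ∧ pp + pm < 1 ∧
      lam * (1 - pp - pm) ^ d = pp * (1 - pp) ^ (d - 1) ∧
      lam * (1 - pp - pm) ^ d = pm * (1 - pm) ^ (d - 1) ∧
      0 < qm ∧ qm < qp ∧ qp < 1 ∧ qp = pp / (1 - pm) ∧ qm = pm / (1 - pp) ∧
      qp = lam * (1 - qm) ^ (d - 1) / (1 + lam * (1 - qm) ^ (d - 1)) ∧
      qm = lam * (1 - qp) ^ (d - 1) / (1 + lam * (1 - qp) ^ (d - 1)) := by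
  obtain ⟨qp, qm, hqm, hlt, hqp, hqp_eq, hqm_eq⟩ := exists_hardCore_treeTwoCycle hd hlam
  obtain ⟨k, rfl⟩ : ∃ k, d = k + 1 := ⟨d - 1, by omega⟩
  simp only [Nat.add_sub_cancel] at hqp_eq hqm_eq ⊢
  have hlam0 : 0 < lam := (hardCoreThreshold_pos hd).trans hlam
  have hqp0 : 0 < qp := hqm.trans hlt
  have hqm1 : qm < 1 := hlt.trans hqp
  set D : ℝ := 1 - qp * qm with hD
  have hD0 : 0 < D := by rw [hD]; nlinarith
  -- clear the denominators of the two-cycle equations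
  have hden_m : 0 < 1 + lam * (1 - qm) ^ k := by positivity
  have hden_p : 0 < 1 + lam * (1 - qp) ^ k := by positivity
  have cyc_p : qp = lam * (1 - qm) ^ k * (1 - qp) := by
    have := hqp_eq
    rw [eq_div_iff hden_m.ne'] at this
    linarith
  have cyc_m : qm = lam * (1 - qp) ^ k * (1 - qm) := by
    have := hqm_eq
    rw [eq_div_iff hden_p.ne'] at this
    linarith
  refine ⟨qp * (1 - qm) / D, qm * (1 - qp) / D, qp, qm, ?_, ?_, ?_, ?_, ?_, hqm, hlt, hqp, ?_, ?_,
    hqp_eq, hqm_eq⟩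
  · positivity
  · rw [div_lt_div_iff_of_pos_right hD0]; nlinarith
  · rw [← add_div, div_lt_one hD0, hD]; nlinarith
  · -- `∂_α Φ₁ = 0` at `(p⁺, p⁻)` is the equation `q⁺ = λ(1-q⁻)^k (1-q⁺)`
    have e1 : 1 - qp * (1 - qm) / D - qm * (1 - qp) / D = (1 - qp) * (1 - qm) / D := by
      field_simp; rw [hD]; ring
    have e2 : 1 - qp * (1 - qm) / D = (1 - qp) / D := by
      field_simp; rw [hD]; ring
    have key : lam * ((1 - qp) * (1 - qm)) ^ (k + 1) = qp * (1 - qm) * (1 - qp) ^ k := by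
      rw [mul_pow]
      calc lam * ((1 - qp) ^ (k + 1) * (1 - qm) ^ (k + 1))
          = (lam * (1 - qm) ^ k * (1 - qp)) * ((1 - qp) ^ k * (1 - qm)) := by ring
        _ = qp * ((1 - qp) ^ k * (1 - qm)) := by rw [← cyc_p]
        _ = qp * (1 - qm) * (1 - qp) ^ k := by ring
    rw [e1, e2, div_pow, div_pow, div_mul_div_comm, ← pow_succ', ← mul_div_assoc, key]
  · -- `∂_β Φ₁ = 0` at `(p⁺, p⁻)` is the equation `q⁻ = λ(1-q⁺)^k (1-q⁻)`
    have e1 : 1 - qp * (1 - qm) / D - qm * (1 - qp) / D = (1 - qp) * (1 - qm) / D := by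
      field_simp; rw [hD]; ring
    have e2 : 1 - qm * (1 - qp) / D = (1 - qm) / D := by
      field_simp; rw [hD]; ring
    have key : lam * ((1 - qp) * (1 - qm)) ^ (k + 1) = qm * (1 - qp) * (1 - qm) ^ k := by
      rw [mul_pow]
      calc lam * ((1 - qp) ^ (k + 1) * (1 - qm) ^ (k + 1))
          = (lam * (1 - qp) ^ k * (1 - qm)) * ((1 - qm) ^ k * (1 - qp)) := by ring
        _ = qm * ((1 - qm) ^ k * (1 - qp)) := by rw [← cyc_m]
        _ = qm * (1 - qp) * (1 - qm) ^ k := by ring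
    rw [e1, e2, div_pow, div_pow, div_mul_div_comm, ← pow_succ', ← mul_div_assoc, key]
  · -- `q⁺ = p⁺/(1 - p⁻)`
    have e2 : 1 - qm * (1 - qp) / D = (1 - qm) / D := by
      field_simp; rw [hD]; ring
    rw [e2, div_div_div_cancel_right₀ hD0.ne', mul_div_assoc, div_self (by linarith), mul_one]
  · -- `q⁻ = p⁻/(1 - p⁺)`
    have e2 : 1 - qp * (1 - qm) / D = (1 - qp) / D := by
      field_simp; rw [hD]; ring
    rw [e2, div_div_div_cancel_right₀ hD0.ne', mul_div_assoc, div_self (by linarith), mul_one]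

end CriticalPoint


/-! ### Sly's Lemma 3.1: the ratio of the two first moments

`E Z^{α,β}_{G̃}(η)/E Z^{α,β}_{MWW} = λ^{η⁺+η⁻} [C(n+m'-b-η⁻, a+η⁺)/C(n+m', a+η⁺)]^{d-1} [C(n,a)/C(n-b,a)]^{d-1}`
(`sly_firstMoment` over `mww_firstMoment`, `a = αn`, `b = βn`); two applications of Lemma 3.2 give its
logarithm up to `O((m'² + |η|²)/min{a, n-a-b})` = `O(n^{-1/2})` in Sly's regime `|U| = O(n^{1/4})`
(`sly_lemma31_abs_log_ratio_sub_le`). -/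

section Lemma31

/-- **Sly's Lemma 3.1, quantitative core.** The ratio of the two first moments
(`sly_firstMoment` over `mww_firstMoment` with `d = k + 1`) is
`R = λ^{η⁺+η⁻} [C(n+m'-b-η⁻, a+η⁺)/C(n+m', a+η⁺)]^k [C(n,a)/C(n-b,a)]^k`; by Lemma 3.2
(`abs_log_choose_sub_le`, applied to the two binomial perturbations),
`log R = (η⁺+η⁻) log λ + k[(m'-η⁻) log((n-b)/(n-b-a)) + η⁺ log((n-b-a)/a) - m' log(n/(n-a)) - η⁺ log((n-a)/a)] + E`
with `|E| ≤ 8k[(m'-η⁻)² + m'² + 2(η⁺)²]/min{a, n-a-b}` — Sly's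
`E Z^{α,β}_{G̃}(η) = (1 + O(n^{-1/2})) C* (λ((1-α-β)/(1-β))^{d-1})^{η⁻} (λ((1-α-β)/(1-α))^{d-1})^{η⁺} E Z^{α,β}_{MWW}`
with `a = αn`, `b = βn`, `|U| = O(n^{1/4})`, the main term regrouping as
`k m' log((1-α)(1-β)/(1-α-β)) + η⁻ log(λ((1-α-β)/(1-β))^k) + η⁺ log(λ((1-α-β)/(1-α))^k)`
(`C* = ((1-α)(1-β)/(1-α-β))^{m'}` per matching). Hypotheses: `0 < a`, `a + b < n`, `η⁻ ≤ m'`,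
`4(m'+η⁻), 4η⁺ ≤ min{a, n-a-b}`. [cite: Sly2010, Lemma 3.1 and its proof (eq. (e:gtEZ1) and Lemma 3.2)] -/
theorem sly_lemma31_abs_log_ratio_sub_le (n mp a b ep em k : ℕ) {lam : ℝ} (hlam : 0 < lam)
    (ha : 0 < a) (hab : a + b < n) (hem : em ≤ mp)
    (h1 : 4 * ((mp : ℝ) + em) ≤ min (a : ℝ) ((n : ℝ) - a - b))
    (h2 : 4 * (ep : ℝ) ≤ min (a : ℝ) ((n : ℝ) - a - b)) :
    |Real.log (lam ^ (ep + em) *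
          (((n + mp - b - em).choose (a + ep) : ℝ) / ((n + mp).choose (a + ep))) ^ k *
          ((n.choose a : ℝ) / ((n - b).choose a)) ^ k) -
        ((ep + em) * Real.log lam +
          k * (((mp : ℝ) - em) * Real.log (((n : ℝ) - b) / ((n : ℝ) - b - a)) +
            ep * Real.log (((n : ℝ) - b - a) / a) -
            mp * Real.log ((n : ℝ) / ((n : ℝ) - a)) - ep * Real.log (((n : ℝ) - a) / a)))| ≤
      8 * k * ((((mp : ℝ) - em) ^ 2 + (ep : ℝ) ^ 2) + ((mp : ℝ) ^ 2 + (ep : ℝ) ^ 2)) /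
        min (a : ℝ) ((n : ℝ) - a - b) := by
  -- positivity bookkeeping
  have hbn : b ≤ n := by omega
  have habn : a < n - b := by omega
  have han : a < n := by omega
  have hmin_le : min (a : ℝ) ((n : ℝ) - a - b) ≤ min (a : ℝ) ((n : ℝ) - a) :=
    min_le_min le_rfl (by
      have : (0 : ℝ) ≤ b := Nat.cast_nonneg b
      linarith)
  have hmin0 : 0 < min (a : ℝ) ((n : ℝ) - a - b) := by
    refine lt_min (by exact_mod_cast ha) ?_
    have : ((a : ℝ) + b) < n := by exact_mod_cast hab
    linarith
  -- the two applications of Lemma 3.2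
  have hA := abs_log_choose_sub_le (n - b) a (n + mp - b - em) (a + ep) ha habn (by
      rw [Nat.cast_sub hbn, show ((n + mp - b - em : ℕ) : ℝ) = n + mp - b - em by
        rw [Nat.cast_sub (by omega), Nat.cast_sub (by omega)]; push_cast; ring]
      rw [show (n : ℝ) + mp - b - em - (n - b) = mp - em by ring,
        show (n : ℝ) - b - a = (n : ℝ) - a - b by ring]
      have : |(mp : ℝ) - em| ≤ mp + em := by
        rw [abs_le]; constructor <;> linarith [Nat.cast_nonneg (α := ℝ) mp, Nat.cast_nonneg (α := ℝ) em]
      linarith) (by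
      rw [Nat.cast_sub hbn, show ((a + ep : ℕ) : ℝ) - a = ep by push_cast; ring,
        show (n : ℝ) - b - a = (n : ℝ) - a - b by ring, abs_of_nonneg (Nat.cast_nonneg ep)]
      exact h2)
  have hB := abs_log_choose_sub_le n a (n + mp) (a + ep) ha han (by
      rw [show ((n + mp : ℕ) : ℝ) - n = mp by push_cast; ring, abs_of_nonneg (Nat.cast_nonneg mp)]
      have : (0 : ℝ) ≤ em := Nat.cast_nonneg em
      linarith [hmin_le]) (by
      rw [show ((a + ep : ℕ) : ℝ) - a = ep by push_cast; ring, abs_of_nonneg (Nat.cast_nonneg ep)]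
      linarith [hmin_le])
  -- casts inside `hA`, `hB`
  rw [Nat.cast_sub hbn] at hA
  have e1 : ((n + mp - b - em : ℕ) : ℝ) - ((n : ℝ) - b) = mp - em := by
    rw [Nat.cast_sub (by omega), Nat.cast_sub (by omega)]; push_cast; ring
  have e2 : ((a + ep : ℕ) : ℝ) - a = ep := by push_cast; ring
  have e3 : ((n + mp : ℕ) : ℝ) - n = mp := by push_cast; ring
  rw [e1, e2] at hA
  rw [e3, e2] at hB
  -- integer consequences of the smallness hypotheses
  have hep : ep + a + b ≤ n := by
    have h : (ep : ℝ) ≤ (n : ℝ) - a - b := by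
      linarith [min_le_right (a : ℝ) ((n : ℝ) - a - b), Nat.cast_nonneg (α := ℝ) ep]
    have : ((ep + a + b : ℕ) : ℝ) ≤ n := by push_cast; linarith
    exact_mod_cast this
  -- positivity of the binomials and of `λ`
  have c1 : (0 : ℝ) < ((n + mp - b - em).choose (a + ep) : ℝ) := by
    exact_mod_cast Nat.choose_pos (by omega)
  have c2 : (0 : ℝ) < ((n + mp).choose (a + ep) : ℝ) := by exact_mod_cast Nat.choose_pos (by omega)
  have c3 : (0 : ℝ) < (n.choose a : ℝ) := by exact_mod_cast Nat.choose_pos (by omega)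
  have c4 : (0 : ℝ) < ((n - b).choose a : ℝ) := by exact_mod_cast Nat.choose_pos (by omega)
  -- expand the logarithm of the ratio
  rw [Real.log_mul (by positivity) (by positivity), Real.log_mul (by positivity) (by positivity),
    Real.log_pow, Real.log_pow, Real.log_pow, Real.log_div c1.ne' c2.ne', Real.log_div c3.ne' c4.ne']
  -- regroup into the two Lemma-3.2 differences
  have hsplit : (ep + em : ℕ) * Real.log lam +
      k * (Real.log ((n + mp - b - em).choose (a + ep) : ℝ) - Real.log ((n + mp).choose (a + ep) : ℝ)) +
        k * (Real.log (n.choose a : ℝ) - Real.log ((n - b).choose a : ℝ)) -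
      ((ep + em) * Real.log lam +
        k * (((mp : ℝ) - em) * Real.log (((n : ℝ) - b) / ((n : ℝ) - b - a)) +
          ep * Real.log (((n : ℝ) - b - a) / a) -
          mp * Real.log ((n : ℝ) / ((n : ℝ) - a)) - ep * Real.log (((n : ℝ) - a) / a))) =
      k * ((Real.log ((n + mp - b - em).choose (a + ep) : ℝ) - Real.log ((n - b).choose a : ℝ) -
          ((mp : ℝ) - em) * Real.log (((n : ℝ) - b) / ((n : ℝ) - b - a)) -
          ep * Real.log (((n : ℝ) - b - a) / a)) -
        (Real.log ((n + mp).choose (a + ep) : ℝ) - Real.log (n.choose a : ℝ) -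
          mp * Real.log ((n : ℝ) / ((n : ℝ) - a)) - ep * Real.log (((n : ℝ) - a) / a))) := by
    push_cast; ring
  rw [hsplit, abs_mul, abs_of_nonneg (Nat.cast_nonneg k)]
  have hk : (0 : ℝ) ≤ k := Nat.cast_nonneg k
  have htri := abs_sub
    (Real.log ((n + mp - b - em).choose (a + ep) : ℝ) - Real.log ((n - b).choose a : ℝ) -
      ((mp : ℝ) - em) * Real.log (((n : ℝ) - b) / ((n : ℝ) - b - a)) -
      ep * Real.log (((n : ℝ) - b - a) / a))
    (Real.log ((n + mp).choose (a + ep) : ℝ) - Real.log (n.choose a : ℝ) -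
      mp * Real.log ((n : ℝ) / ((n : ℝ) - a)) - ep * Real.log (((n : ℝ) - a) / a))
  -- the second bound, with the smaller `min`
  have hB' : |Real.log ((n + mp).choose (a + ep) : ℝ) - Real.log (n.choose a : ℝ) -
      mp * Real.log ((n : ℝ) / ((n : ℝ) - a)) - ep * Real.log (((n : ℝ) - a) / a)| ≤
      8 * ((mp : ℝ) ^ 2 + (ep : ℝ) ^ 2) / min (a : ℝ) ((n : ℝ) - a - b) :=
    hB.trans (div_le_div_of_nonneg_left (by positivity) hmin0 hmin_le)
  rw [show (n : ℝ) - b - a = (n : ℝ) - a - b by ring] at hA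
  calc (k : ℝ) * |_| ≤ k * (8 * (((mp : ℝ) - em) ^ 2 + (ep : ℝ) ^ 2) / min (a : ℝ) ((n : ℝ) - a - b) +
        8 * ((mp : ℝ) ^ 2 + (ep : ℝ) ^ 2) / min (a : ℝ) ((n : ℝ) - a - b)) := by
        refine mul_le_mul_of_nonneg_left (htri.trans ?_) hk
        rw [show (n : ℝ) - a - b = (n : ℝ) - b - a by ring] at hA hB' ⊢
        exact add_le_add hA hB'
    _ = _ := by ring

end Lemma31


/-! ### The symmetric fixed point `q*` and its loss of stability at `λ_c`

The recursion `q ↦ λ(1-q)^{d-1}/(1+λ(1-q)^{d-1})` has exactly one fixed point `q* ∈ (0, 1)`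
(`existsUnique_hardCore_treeFixedPoint`; Sly's `p* = q*/(1+q*)`), and `(d-1) q* > 1` — instability,
the mechanism of the two-cycle above — holds exactly when `λ > λ_c(𝕋_d)`
(`hardCore_treeFixedPoint_unstable_iff`). -/

section FixedPoint

/-- **The symmetric fixed point `q*` of the tree recursion** (the translation-invariant / free
measure: Sly §1.3, "a unique translation invariant Gibbs measure … with occupation density `p*`",
`q* = p*/(1-p*)` by (e:pqRelation)): for `d ≥ 2` and `λ > 0` the recursion
`q ↦ λ(1-q)^{d-1}/(1+λ(1-q)^{d-1})` has exactly one fixed point in `(0, 1)`.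
[cite: Sly2010, §1.3 (the free measure and `p*`; tree recursions)] -/
theorem existsUnique_hardCore_treeFixedPoint {d : ℕ} (hd : 2 ≤ d) {lam : ℝ} (hlam : 0 < lam) :
    ∃! q : ℝ, (0 < q ∧ q < 1) ∧ q = lam * (1 - q) ^ (d - 1) / (1 + lam * (1 - q) ^ (d - 1)) := by
  obtain ⟨k, rfl⟩ : ∃ k, d = k + 1 := ⟨d - 1, by omega⟩
  simp only [Nat.add_sub_cancel]
  -- in `s = 1 - q` the fixed-point equation is `s (1 + λ s^k) = 1`
  have key : ∀ q : ℝ, 0 < q → q < 1 →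
      (q = lam * (1 - q) ^ k / (1 + lam * (1 - q) ^ k) ↔ (1 - q) * (1 + lam * (1 - q) ^ k) = 1) := by
    intro q hq0 hq1
    have hden : 0 < 1 + lam * (1 - q) ^ k := by positivity
    rw [eq_div_iff hden.ne']
    constructor <;> intro h <;> linarith
  -- existence by the intermediate value theorem
  obtain ⟨s, ⟨hs0, hs1⟩, hfix⟩ : ∃ s ∈ Set.Ioo (0 : ℝ) 1, s * (1 + lam * s ^ k) - 1 = 0 := by
    have hcont : ContinuousOn (fun s : ℝ => s * (1 + lam * s ^ k) - 1) (Set.Icc 0 1) := by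
      fun_prop
    refine intermediate_value_Ioo (zero_le_one' ℝ) hcont ⟨?_, ?_⟩
    · simp
    · simp [hlam]
  -- strict monotonicity of `s ↦ s (1 + λ s^k)` on `s ≥ 0` gives uniqueness
  have hmono : ∀ s₁ s₂ : ℝ, 0 ≤ s₁ → s₁ < s₂ →
      s₁ * (1 + lam * s₁ ^ k) < s₂ * (1 + lam * s₂ ^ k) := by
    intro s₁ s₂ h1 h12
    have hpow : s₁ ^ k ≤ s₂ ^ k := pow_le_pow_left₀ h1 h12.le k
    have hs₂ : 0 < s₂ := by linarith
    have h2 : s₁ * s₁ ^ k ≤ s₂ * s₂ ^ k := mul_le_mul h12.le hpow (pow_nonneg h1 k) hs₂.le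
    have h3 := mul_le_mul_of_nonneg_left h2 hlam.le
    have e1 : s₁ * (1 + lam * s₁ ^ k) = s₁ + lam * (s₁ * s₁ ^ k) := by ring
    have e2 : s₂ * (1 + lam * s₂ ^ k) = s₂ + lam * (s₂ * s₂ ^ k) := by ring
    rw [e1, e2]
    linarith
  refine ⟨1 - s, ⟨⟨by linarith, by linarith⟩, ?_⟩, ?_⟩
  · rw [key (1 - s) (by linarith) (by linarith), sub_sub_cancel]
    linarith
  · rintro q ⟨⟨hq0, hq1⟩, hq⟩
    rw [key q hq0 hq1] at hq
    -- `1 - q` and `s` are both roots of the strictly increasing function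
    by_contra hne
    rcases lt_or_gt_of_ne (show 1 - q ≠ s by intro h; exact hne (by linarith)) with hlt | hgt
    · have := hmono (1 - q) s (by linarith) hlt
      linarith
    · have := hmono s (1 - q) hs0.le hgt
      linarith

/-- **Instability of the symmetric fixed point is exactly `λ > λ_c`.** For `d ≥ 3`, `λ > 0` and the
fixed point `q*` of `existsUnique_hardCore_treeFixedPoint`: `(d-1) q* > 1 ⟺ λ > λ_c(𝕋_d)`.
(`|F'(q*)| = (d-1) q*` for `F(q) = λ(1-q)^{d-1}/(1+λ(1-q)^{d-1})`; with `t* = λ(1-q*)^{d-1}` one has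
`q* = t*/(1+t*)`, `λ = t*(1+t*)^{d-1}`, and `t ↦ t(1+t)^{d-1}` is strictly increasing with value
`λ_c(𝕋_d)` at `t = 1/(d-2)`, `hardCoreThreshold_eq_critical`.) This is the loss of stability at the
uniqueness threshold behind Kelly's theorem as quoted by Sly ("uniqueness when `λ ≤ λ_c` and
non-uniqueness when `λ > λ_c`"). [cite: Sly2010, §1.3 (the threshold `λ_c(d)`, after Kelly 1985)] -/
theorem hardCore_treeFixedPoint_unstable_iff {d : ℕ} (hd : 3 ≤ d) {lam q : ℝ} (hlam : 0 < lam)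
    (hq0 : 0 < q) (hq1 : q < 1)
    (hfix : q = lam * (1 - q) ^ (d - 1) / (1 + lam * (1 - q) ^ (d - 1))) :
    1 < ((d : ℝ) - 1) * q ↔ hardCoreThreshold d < lam := by
  obtain ⟨K, rfl⟩ : ∃ K, d = K + 2 := ⟨d - 2, by omega⟩
  have hK : 1 ≤ K := by omega
  have hK0 : (0 : ℝ) < K := by exact_mod_cast (show 0 < K by omega)
  rw [show K + 2 - 1 = K + 1 from rfl] at hfix
  have hdK : ((K + 2 : ℕ) : ℝ) - 1 = (K : ℝ) + 1 := by push_cast; ring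
  rw [hdK]
  set s : ℝ := 1 - q with hs
  have hs0 : 0 < s := by rw [hs]; linarith
  set t : ℝ := lam * s ^ (K + 1) with ht
  have ht0 : 0 < t := by positivity
  have hden : 0 < 1 + t := by linarith
  -- `q = t/(1+t)` and `λ = t (1+t)^{K+1}`
  have hqt : q * (1 + t) = t := by
    have h := hfix
    rw [eq_div_iff hden.ne'] at h
    linarith
  have hst : s * (1 + t) = 1 := by rw [hs]; linarith
  have hlam_eq : lam = t * (1 + t) ^ (K + 1) := by
    have h1t : 1 + t = 1 / s := by
      field_simp
      linarith
    have hss : s ^ (K + 1) * (1 / s) ^ (K + 1) = 1 := by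
      rw [← mul_pow, mul_one_div_cancel hs0.ne', one_pow]
    rw [h1t, ht, mul_assoc, hss, mul_one]
  -- `(K+1) q > 1 ⟺ K t > 1`
  have hiff : 1 < ((K : ℝ) + 1) * q ↔ 1 / K < t := by
    rw [div_lt_iff₀ hK0]
    constructor
    · intro h; nlinarith
    · intro h; nlinarith
  rw [hiff, hardCoreThreshold_eq_critical K hK, hlam_eq]
  -- strict monotonicity of `t ↦ t (1+t)^{K+1}`
  constructor
  · intro h
    have hpow : (1 + 1 / (K : ℝ)) ^ (K + 1) < (1 + t) ^ (K + 1) :=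
      pow_lt_pow_left₀ (by linarith) (by positivity) (by omega)
    exact mul_lt_mul'' h hpow (by positivity) (by positivity)
  · intro h
    by_contra hle
    push Not at hle
    have hpow : (1 + t) ^ (K + 1) ≤ (1 + 1 / (K : ℝ)) ^ (K + 1) :=
      pow_le_pow_left₀ (by positivity) (by linarith) _
    have := mul_le_mul hle hpow (by positivity) (by positivity)
    linarith

end FixedPoint

/-! ### Kelly's uniqueness: the two-cycle of the tree recursion is unique (and absent for `λ ≤ λ_c`)

A two-cycle `q⁻ < q⁺` of `q ↦ λ(1-q)^k/(1+λ(1-q)^k)` has activity ratios `a = q⁻/(1-q⁻) = λ(1-q⁺)^k`,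
`b = q⁺/(1-q⁺) = λ(1-q⁻)^k`; with `r = (1-q⁻)/(1-q⁺) = (1+b)/(1+a) > 1` one gets `b = r^k a`, hence
`a(r^k - r) = r - 1`, i.e. `a = 1/(r S(r))` with `S(r) = 1 + r + ⋯ + r^{k-2}`, and
`λ = a(1+b)^k = Λ(r) := (1 + r S)^k/(r S^{k+1})`. So the two-cycles at activity `λ` correspond to the
solutions `r > 1` of `Λ(r) = λ`, and Kelly's theorem (at most one two-cycle; none for `λ ≤ λ_c`)
is the strict monotonicity of `Λ` on `[1, ∞)` together with `Λ(1) = k^k/(k-1)^{k+1} = λ_c`. The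
monotonicity: `r S (1+rS) Λ'/Λ = N` with `(r-1) N = r S² + (1 + r^k) S - (k²-1) r^{k-1}` (an identity
needing only `(r-1) S = r^{k-1} - 1` and its derivative), and the right side is positive for `r > 1`
by two AM–GM pairings of its `k² - 1` monomials against `r^{k-1}` (`kelly_key_pos`). -/

section TwoCycleUniqueness

open Finset

/-- Two-term AM–GM for powers of one base: `2 r^c ≤ r^i + r^j` whenever `i + j = 2c` and `r ≥ 0`
(`r^i + r^{i+2t} - 2r^{i+t} = r^i (r^t - 1)^2`). [folklore] -/
theorem two_mul_pow_le_pow_add_pow {r : ℝ} (hr : 0 ≤ r) {i j c : ℕ} (h : i + j = 2 * c) :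
    2 * r ^ c ≤ r ^ i + r ^ j := by
  wlog hij : i ≤ j generalizing i j
  · rw [add_comm]; exact this (by omega) (by omega)
  obtain ⟨t, rfl⟩ : ∃ t, j = i + 2 * t := ⟨c - i, by omega⟩
  obtain rfl : c = i + t := by omega
  have key : r ^ i + r ^ (i + 2 * t) - 2 * r ^ (i + t) = r ^ i * (r ^ t - 1) ^ 2 := by ring
  nlinarith [mul_nonneg (pow_nonneg hr i) (sq_nonneg (r ^ t - 1))]

/-- **AM–GM for a geometric sum**: `(m+1)^2 r^m ≤ (1 + r + ⋯ + r^m)^2` for `r ≥ 0` (pair the term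
`r^{i+j}` of the square with `r^{(m-i)+(m-j)}`). [folklore] -/
theorem sq_mul_pow_le_geom_sum_sq {r : ℝ} (hr : 0 ≤ r) (m : ℕ) :
    ((m : ℝ) + 1) ^ 2 * r ^ m ≤ (∑ i ∈ range (m + 1), r ^ i) ^ 2 := by
  have h1 : (∑ i ∈ range (m + 1), r ^ i) ^ 2 =
      ∑ i ∈ range (m + 1), ∑ j ∈ range (m + 1), r ^ (i + j) := by
    rw [sq, Finset.sum_mul_sum]
    refine Finset.sum_congr rfl fun i _ => Finset.sum_congr rfl fun j _ => ?_
    rw [pow_add]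
  have h2 : (∑ i ∈ range (m + 1), r ^ i) ^ 2 =
      ∑ i ∈ range (m + 1), ∑ j ∈ range (m + 1), r ^ ((m - i) + (m - j)) := by
    rw [h1, ← Finset.sum_range_reflect (fun i => ∑ j ∈ range (m + 1), r ^ (i + j)) (m + 1)]
    refine Finset.sum_congr rfl fun i _ => ?_
    rw [← Finset.sum_range_reflect (fun j => r ^ ((m + 1 - 1 - i) + j)) (m + 1)]
    rfl
  have h4 : ∑ i ∈ range (m + 1), ∑ j ∈ range (m + 1), (2 * r ^ m) ≤
      ∑ i ∈ range (m + 1), ∑ j ∈ range (m + 1), (r ^ (i + j) + r ^ ((m - i) + (m - j))) := by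
    refine Finset.sum_le_sum fun i hi => Finset.sum_le_sum fun j hj => ?_
    rw [Finset.mem_range] at hi hj
    exact two_mul_pow_le_pow_add_pow hr (by omega)
  simp only [Finset.sum_const, Finset.card_range, nsmul_eq_mul, Finset.sum_add_distrib] at h4
  rw [← h1, ← h2] at h4
  push_cast at h4
  nlinarith [h4]

/-- `2(m+1) r^{m+1} < (1 + r^{m+2})(1 + r + ⋯ + r^m)` for `r > 1` (pair `r^i` with `r^{2m+2-i}`;
the pair `i = 0` is strict). [folklore] -/
theorem two_mul_pow_lt_mul_geom_sum {r : ℝ} (hr : 1 < r) (m : ℕ) :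
    2 * ((m : ℝ) + 1) * r ^ (m + 1) < (1 + r ^ (m + 2)) * ∑ i ∈ range (m + 1), r ^ i := by
  have hr0 : 0 ≤ r := by linarith
  have h1 : (1 + r ^ (m + 2)) * ∑ i ∈ range (m + 1), r ^ i =
      ∑ i ∈ range (m + 1), (r ^ i + r ^ (2 * m + 2 - i)) := by
    rw [Finset.mul_sum]
    have : ∑ i ∈ range (m + 1), (1 + r ^ (m + 2)) * r ^ i =
        ∑ i ∈ range (m + 1), r ^ i + ∑ i ∈ range (m + 1), r ^ (m + 2 + i) := by
      rw [← Finset.sum_add_distrib]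
      refine Finset.sum_congr rfl fun i _ => ?_
      rw [pow_add]; ring
    rw [this, Finset.sum_add_distrib]
    congr 1
    rw [← Finset.sum_range_reflect (fun i => r ^ (2 * m + 2 - i)) (m + 1)]
    refine Finset.sum_congr rfl fun i hi => ?_
    rw [Finset.mem_range] at hi
    congr 1
    omega
  rw [h1]
  have h2 : ∑ i ∈ range (m + 1), (2 * r ^ (m + 1)) <
      ∑ i ∈ range (m + 1), (r ^ i + r ^ (2 * m + 2 - i)) := by
    apply Finset.sum_lt_sum
    · intro i hi
      rw [Finset.mem_range] at hi
      exact two_mul_pow_le_pow_add_pow hr0 (by omega)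
    · refine ⟨0, by simp, ?_⟩
      simp only [pow_zero, Nat.sub_zero]
      have h3 : 1 < r ^ (m + 1) := one_lt_pow₀ hr (by omega)
      have h4 : r ^ (2 * m + 2) = (r ^ (m + 1)) ^ 2 := by ring
      nlinarith [h3, h4, sq_nonneg (r ^ (m + 1) - 1)]
  simp only [Finset.sum_const, Finset.card_range, nsmul_eq_mul] at h2
  push_cast at h2
  linarith

/-- **The positivity behind Kelly's uniqueness.** For `r > 1` and `S = 1 + r + ⋯ + r^m`:
`((m+2)^2 - 1) r^{m+1} < r S^2 + (1 + r^{m+2}) S` — the sum of the two AM–GM estimates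
`sq_mul_pow_le_geom_sum_sq` and `two_mul_pow_lt_mul_geom_sum`. [folklore] -/
theorem kelly_key_pos {r : ℝ} (hr : 1 < r) (m : ℕ) :
    (((m : ℝ) + 2) ^ 2 - 1) * r ^ (m + 1) <
      r * (∑ i ∈ range (m + 1), r ^ i) ^ 2 + (1 + r ^ (m + 2)) * ∑ i ∈ range (m + 1), r ^ i := by
  have h1 := sq_mul_pow_le_geom_sum_sq (zero_le_one.trans hr.le) m
  have h2 := two_mul_pow_lt_mul_geom_sum hr m
  have h3 : r * (((m : ℝ) + 1) ^ 2 * r ^ m) = ((m : ℝ) + 1) ^ 2 * r ^ (m + 1) := by ring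
  nlinarith [mul_le_mul_of_nonneg_left h1 (zero_le_one.trans hr.le)]

/-- **The derivative of a geometric sum, implicitly**: `S(x) = 1 + x + ⋯ + x^m` has a derivative `S'`
at `r` with `S(r) + (r-1) S' = (m+1) r^m` (differentiate `(x-1) S(x) = x^{m+1} - 1`). [folklore] -/
theorem exists_hasDerivAt_geom_sum (m : ℕ) (r : ℝ) :
    ∃ S' : ℝ, HasDerivAt (fun x : ℝ => ∑ i ∈ range (m + 1), x ^ i) S' r ∧
      (∑ i ∈ range (m + 1), r ^ i) + (r - 1) * S' = (m + 1) * r ^ m := by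
  have hS : HasDerivAt (fun x : ℝ => ∑ i ∈ range (m + 1), x ^ i)
      (∑ i ∈ range (m + 1), (i : ℝ) * r ^ (i - 1)) r :=
    HasDerivAt.fun_sum fun i _ => hasDerivAt_pow i r
  refine ⟨_, hS, ?_⟩
  have hg1 : HasDerivAt (fun x : ℝ => (∑ i ∈ range (m + 1), x ^ i) * (x - 1))
      ((∑ i ∈ range (m + 1), (i : ℝ) * r ^ (i - 1)) * (r - 1) +
        (∑ i ∈ range (m + 1), r ^ i) * 1) r :=
    hS.mul ((hasDerivAt_id r).sub_const 1)
  have hg2 : HasDerivAt (fun x : ℝ => (∑ i ∈ range (m + 1), x ^ i) * (x - 1))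
      (((m + 1 : ℕ) : ℝ) * r ^ (m + 1 - 1)) r := by
    have : (fun x : ℝ => (∑ i ∈ range (m + 1), x ^ i) * (x - 1)) = fun x => x ^ (m + 1) - 1 := by
      funext x; exact geom_sum_mul x (m + 1)
    rw [this]
    exact (hasDerivAt_pow (m + 1) r).sub_const 1
  have := hg1.unique hg2
  simp only [Nat.add_sub_cancel, mul_one] at this
  push_cast at this
  linarith

/-- **Kelly's monotonicity.** Along the curve of two-cycles of the hard-core recursion on the
`(m+2)`-ary tree (equivalently, of asymmetric critical points of Sly's `Φ₁` for `d = m+3`),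
parametrised by `r > 1`, the activity is `Λ(r) = (1 + r S)^{m+2}/(r S^{m+3})`, `S = 1 + r + ⋯ + r^m`;
this function is strictly increasing on `[1, ∞)` (its logarithmic derivative, times
`(r-1) r S (1 + r S)`, is `r S^2 + (1 + r^{m+2}) S - ((m+2)^2 - 1) r^{m+1} > 0`, `kelly_key_pos`).
[cite: Sly2010, §1.3 ("uniqueness when `λ ≤ λ_c` and non-uniqueness when `λ > λ_c` [Kelly:85]")] -/
theorem kelly_curve_strictMonoOn (m : ℕ) :
    StrictMonoOn (fun r : ℝ => (1 + r * ∑ i ∈ range (m + 1), r ^ i) ^ (m + 2) /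
      (r * (∑ i ∈ range (m + 1), r ^ i) ^ (m + 3))) (Set.Ici 1) := by
  apply strictMonoOn_of_deriv_pos (convex_Ici 1)
  · refine ContinuousOn.div (by fun_prop) (by fun_prop) fun r hr => ?_
    have hr0 : 0 < r := zero_lt_one.trans_le hr
    exact (mul_pos hr0 (pow_pos (geom_sum_pos hr0.le (Nat.succ_ne_zero m)) _)).ne'
  · intro r hr
    rw [interior_Ici] at hr
    have hr1 : 1 < r := hr
    have hr0 : 0 < r := zero_lt_one.trans hr1
    obtain ⟨S', hS, hc1⟩ := exists_hasDerivAt_geom_sum m r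
    set S : ℝ := ∑ i ∈ range (m + 1), r ^ i with hSdef
    have hS0 : 0 < S := geom_sum_pos hr0.le (Nat.succ_ne_zero m)
    have hc2 : S * (r - 1) = r ^ (m + 1) - 1 := geom_sum_mul r (m + 1)
    have hA0 : 0 < 1 + r * S := by positivity
    -- derivatives of numerator and denominator
    have hF : HasDerivAt (fun x : ℝ => (1 + x * ∑ i ∈ range (m + 1), x ^ i) ^ (m + 2))
        (((m + 2 : ℕ) : ℝ) * (1 + r * S) ^ (m + 2 - 1) * (1 * S + r * S')) r :=
      (((hasDerivAt_id r).mul hS).const_add 1).pow (m + 2)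
    have hG : HasDerivAt (fun x : ℝ => x * (∑ i ∈ range (m + 1), x ^ i) ^ (m + 3))
        (1 * S ^ (m + 3) + r * (((m + 3 : ℕ) : ℝ) * S ^ (m + 3 - 1) * S')) r :=
      (hasDerivAt_id r).mul (hS.pow (m + 3))
    have hGne : r * S ^ (m + 3) ≠ 0 := (mul_pos hr0 (pow_pos hS0 _)).ne'
    have hΛ := hF.fun_div hG hGne
    rw [hΛ.deriv]
    apply div_pos _ (by positivity)
    rw [show m + 2 - 1 = m + 1 from rfl, show m + 3 - 1 = m + 2 from rfl]
    push_cast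
    -- the numerator factors as `(1 + rS)^{m+1} S^{m+2} N` with `(r-1) N = P > 0`
    set N : ℝ := ((m : ℝ) + 2) * (S + r * S') * r * S - (1 + r * S) * S -
      ((m : ℝ) + 3) * r * (1 + r * S) * S' with hN
    have key : ((m : ℝ) + 2) * (1 + r * S) ^ (m + 1) * (1 * S + r * S') * (r * S ^ (m + 3)) -
        (1 + r * S) ^ (m + 2) * (1 * S ^ (m + 3) + r * (((m : ℝ) + 3) * S ^ (m + 2) * S')) =
        (1 + r * S) ^ (m + 1) * S ^ (m + 2) * N := by
      rw [hN]; ring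
    rw [key]
    have hP : (r - 1) * N =
        r * S ^ 2 + (1 + r ^ (m + 2)) * S - (((m : ℝ) + 2) ^ 2 - 1) * r ^ (m + 1) := by
      rw [hN]
      linear_combination (((m : ℝ) + 2) * r ^ 2 * S - ((m : ℝ) + 3) * r * (1 + r * S)) * hc1 +
        (((m : ℝ) + 2) * r * S) * hc2
    have hP0 : 0 < (r - 1) * N := by
      rw [hP]
      linarith [kelly_key_pos hr1 m]
    have hN0 : 0 < N := (mul_pos_iff_of_pos_left (by linarith)).1 hP0
    positivity

/-- **Parametrising the two-cycles by `r = (1-q⁻)/(1-q⁺)`.** For a two-cycle `0 < q⁻ < q⁺ < 1` of the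
hard-core recursion `q ↦ λ(1-q)^k/(1+λ(1-q)^k)` on the `k`-ary tree, `k = m+2`, `λ > 0`: the ratio
`r = (1-q⁻)/(1-q⁺)` exceeds `1`, the activity ratio `a = q⁻/(1-q⁻)` is `1/(r S(r))` with
`S(r) = 1 + r + ⋯ + r^m`, and `λ = (1 + r S)^{m+2}/(r S^{m+3})` lies on Kelly's curve
(`kelly_curve_strictMonoOn`). (From `a = λ(1-q⁺)^k`, `b = λ(1-q⁻)^k = q⁺/(1-q⁺)`: `b = r^k a`,
`1 + b = r(1+a)`, so `a(r^k - r) = r - 1`, i.e. `a r S (r-1) = r - 1`.) [folklore] -/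
theorem hardCore_treeTwoCycle_param {m : ℕ} {lam qp qm : ℝ} (hlam : 0 < lam)
    (hlt : qm < qp) (hqp : qp < 1)
    (hp : qp = lam * (1 - qm) ^ (m + 2) / (1 + lam * (1 - qm) ^ (m + 2)))
    (hm : qm = lam * (1 - qp) ^ (m + 2) / (1 + lam * (1 - qp) ^ (m + 2))) :
    1 < (1 - qm) / (1 - qp) ∧
      qm / (1 - qm) * ((1 - qm) / (1 - qp) *
        ∑ i ∈ range (m + 1), ((1 - qm) / (1 - qp)) ^ i) = 1 ∧
      lam = (1 + (1 - qm) / (1 - qp) * ∑ i ∈ range (m + 1), ((1 - qm) / (1 - qp)) ^ i) ^ (m + 2) /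
        ((1 - qm) / (1 - qp) * (∑ i ∈ range (m + 1), ((1 - qm) / (1 - qp)) ^ i) ^ (m + 3)) := by
  set sp : ℝ := 1 - qp with hsp_def
  set sm : ℝ := 1 - qm with hsm_def
  have hsp : 0 < sp := by rw [hsp_def]; linarith
  have hsm : 0 < sm := by rw [hsm_def]; linarith
  have hspm : sp < sm := by rw [hsp_def, hsm_def]; linarith
  set r : ℝ := sm / sp with hr_def
  have hr1 : 1 < r := (one_lt_div hsp).2 hspm
  have hr0 : 0 < r := zero_lt_one.trans hr1
  set S : ℝ := ∑ i ∈ range (m + 1), r ^ i with hS_def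
  have hS0 : 0 < S := geom_sum_pos hr0.le (Nat.succ_ne_zero m)
  have hgeom : S * (r - 1) = r ^ (m + 1) - 1 := geom_sum_mul r (m + 1)
  set a : ℝ := lam * sp ^ (m + 2) with ha_def
  set b : ℝ := lam * sm ^ (m + 2) with hb_def
  have ha0 : 0 < a := by positivity
  have hb0 : 0 < b := by positivity
  -- the recursion, cleared of denominators: `sm (1 + a) = 1`, `sp (1 + b) = 1`, `qm = a sm`
  have hm' : qm * (1 + a) = a := by
    have h := hm
    rwa [eq_div_iff (by positivity : (1 + a : ℝ) ≠ 0)] at h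
  have hp' : qp * (1 + b) = b := by
    have h := hp
    rwa [eq_div_iff (by positivity : (1 + b : ℝ) ≠ 0)] at h
  have hma : sm * (1 + a) = 1 := by linear_combination (-1 : ℝ) * hm' + (1 + a) * hsm_def
  have hpb : sp * (1 + b) = 1 := by linear_combination (-1 : ℝ) * hp' + (1 + b) * hsp_def
  -- `b = r^k a` and `r (1 + a) = 1 + b`
  have hrsp : r * sp = sm := by rw [hr_def]; exact div_mul_cancel₀ sm hsp.ne'
  have hba : b = r ^ (m + 2) * a := by
    rw [hb_def, ha_def, ← hrsp, mul_pow]; ring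
  have hra : r * (1 + a) = 1 + b := by
    have h1 : r * (1 + a) * sp = (1 + b) * sp := by
      calc r * (1 + a) * sp = r * sp * (1 + a) := by ring
        _ = 1 := by rw [hrsp, hma]
        _ = (1 + b) * sp := by rw [mul_comm, hpb]
    exact mul_right_cancel₀ hsp.ne' h1
  have key : a * (r ^ (m + 2) - r) = r - 1 := by linear_combination (-1 : ℝ) * hra - hba
  -- hence `a r S = 1`
  have haS : a * (r * S) = 1 := by
    have h1 : (a * (r * S) - 1) * (r - 1) = 0 := by linear_combination (a * r) * hgeom + key
    rcases mul_eq_zero.1 h1 with h | h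
    · linarith
    · exact absurd h (by linarith)
  have hqa : qm / sm = a := by
    rw [div_eq_iff hsm.ne']
    linear_combination sm * hm' - qm * hma
  refine ⟨hr1, by rw [hqa, haS], ?_⟩
  -- `λ = a (r (1+a))^k` and `a = 1/(rS)`
  have h1 : r * (1 + a) * sp = 1 := by rw [hra, mul_comm, hpb]
  have hlam_eq : lam = a * (r * (1 + a)) ^ (m + 2) := by
    calc lam = lam * (r * (1 + a) * sp) ^ (m + 2) := by rw [h1, one_pow, mul_one]
      _ = a * (r * (1 + a)) ^ (m + 2) := by rw [mul_pow, ha_def]; ring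
  have ha_eq : a = (r * S)⁻¹ := eq_inv_of_mul_eq_one_left haS
  have hr0' : r ≠ 0 := hr0.ne'
  have hS0' : S ≠ 0 := hS0.ne'
  have e1 : r * (1 + (r * S)⁻¹) = (1 + r * S) * S⁻¹ := by
    field_simp
    ring
  rw [hlam_eq, ha_eq, e1, mul_pow, div_eq_mul_inv, mul_inv, mul_inv, inv_pow, pow_succ' S (m + 2),
    mul_inv]
  ring

/-- **Kelly's theorem, uniqueness half: the two-cycle is unique.** For `d ≥ 3` and `λ > 0` the
hard-core recursion `q ↦ λ(1-q)^{d-1}/(1+λ(1-q)^{d-1})` on the `(d-1)`-ary tree has at most one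
two-cycle `q⁻ < q⁺ < 1` (so the pair of `exists_hardCore_treeTwoCycle` — the root densities of
the two extremal semi-translation-invariant measures, Sly's `q^{±}` — is well defined).
Proof: both two-cycles lie on Kelly's curve `λ = Λ(r)`, which is strictly increasing
(`kelly_curve_strictMonoOn`), so they have the same `r`, hence the same `q⁻/(1-q⁻) = 1/(r S(r))`.
[cite: Sly2010, §1.3 ("non-uniqueness when `λ > λ_c` [Kelly:85]"; the densities `q⁺, q⁻` of `μ̂_{±}`)] -/
theorem hardCore_treeTwoCycle_unique {d : ℕ} (hd : 3 ≤ d) {lam qp qm qp' qm' : ℝ} (hlam : 0 < lam)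
    (hlt : qm < qp) (hqp : qp < 1)
    (hp : qp = lam * (1 - qm) ^ (d - 1) / (1 + lam * (1 - qm) ^ (d - 1)))
    (hm : qm = lam * (1 - qp) ^ (d - 1) / (1 + lam * (1 - qp) ^ (d - 1)))
    (hlt' : qm' < qp') (hqp' : qp' < 1)
    (hp' : qp' = lam * (1 - qm') ^ (d - 1) / (1 + lam * (1 - qm') ^ (d - 1)))
    (hm' : qm' = lam * (1 - qp') ^ (d - 1) / (1 + lam * (1 - qp') ^ (d - 1))) :
    qp = qp' ∧ qm = qm' := by
  obtain ⟨m, rfl⟩ : ∃ m, d = m + 3 := ⟨d - 3, by omega⟩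
  rw [show m + 3 - 1 = m + 2 from rfl] at hp hm hp' hm'
  obtain ⟨hr1, haS, hl⟩ := hardCore_treeTwoCycle_param hlam hlt hqp hp hm
  obtain ⟨hr1', haS', hl'⟩ := hardCore_treeTwoCycle_param hlam hlt' hqp' hp' hm'
  have hrr : (1 - qm) / (1 - qp) = (1 - qm') / (1 - qp') :=
    (kelly_curve_strictMonoOn m).injOn (Set.mem_Ici.2 hr1.le) (Set.mem_Ici.2 hr1'.le)
      (hl.symm.trans hl')
  rw [hrr] at haS
  have hne : (1 - qm') / (1 - qp') * ∑ i ∈ range (m + 1), ((1 - qm') / (1 - qp')) ^ i ≠ 0 := by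
    intro h0
    rw [h0, mul_zero] at haS'
    exact zero_ne_one haS'
  have ha : qm / (1 - qm) = qm' / (1 - qm') := mul_right_cancel₀ hne (haS.trans haS'.symm)
  have hqmeq : qm = qm' := by
    rw [div_eq_div_iff (by linarith : (1 - qm : ℝ) ≠ 0) (by linarith : (1 - qm' : ℝ) ≠ 0)] at ha
    linear_combination ha
  refine ⟨?_, hqmeq⟩
  rw [hp, hp', hqmeq]

/-- The value of Kelly's curve at `r = 1` is the uniqueness threshold:
`(m+2)^{m+2}/(m+1)^{m+3} = λ_c(𝕋_{m+3})`. [cite: Sly2010, §1.3 (`λ_c(d) = (d-1)^{d-1}/(d-2)^d`)] -/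
theorem kelly_curve_one (m : ℕ) :
    (1 + (1 : ℝ) * ∑ i ∈ range (m + 1), (1 : ℝ) ^ i) ^ (m + 2) /
        ((1 : ℝ) * (∑ i ∈ range (m + 1), (1 : ℝ) ^ i) ^ (m + 3)) = hardCoreThreshold (m + 3) := by
  simp only [one_pow, Finset.sum_const, Finset.card_range, nsmul_eq_mul, mul_one, one_mul,
    hardCoreThreshold]
  rw [show m + 3 - 1 = m + 2 from rfl]
  push_cast
  congr 1 <;> ring

/-- A two-cycle forces a positive activity. [folklore] -/
theorem pos_of_hardCore_treeTwoCycle {k : ℕ} {lam qp qm : ℝ} (hqm : 0 < qm) (hlt : qm < qp)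
    (hqp : qp < 1) (hm : qm = lam * (1 - qp) ^ k / (1 + lam * (1 - qp) ^ k)) : 0 < lam := by
  by_contra h
  push Not at h
  set x : ℝ := lam * (1 - qp) ^ k with hx_def
  have hx : x ≤ 0 := mul_nonpos_of_nonpos_of_nonneg h (pow_nonneg (by linarith) _)
  rcases lt_trichotomy (1 + x) 0 with h1 | h1 | h1
  · have : 1 < x / (1 + x) := by
      rw [lt_div_iff_of_neg h1]
      linarith
    linarith
  · rw [h1, div_zero] at hm
    linarith
  · have : x / (1 + x) ≤ 0 := div_nonpos_of_nonpos_of_nonneg hx h1.le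
    linarith

/-- **Kelly's theorem, uniqueness half: no two-cycle at or below the threshold.** For `d ≥ 3` and
`λ ≤ λ_c(𝕋_d) = (d-1)^{d-1}/(d-2)^d` the recursion `q ↦ λ(1-q)^{d-1}/(1+λ(1-q)^{d-1})` has no
two-cycle `0 < q⁻ < q⁺ < 1` (its only point of period `≤ 2` in `(0,1)` is the fixed point `q*`):
a two-cycle lies on Kelly's curve at some `r > 1`, where `Λ(r) > Λ(1) = λ_c`.
[cite: Sly2010, §1.3 ("uniqueness when `λ ≤ λ_c` … [Kelly:85]")] -/
theorem not_hardCore_treeTwoCycle_of_le {d : ℕ} (hd : 3 ≤ d) {lam qp qm : ℝ}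
    (hlam : lam ≤ hardCoreThreshold d) (hqm : 0 < qm) (hlt : qm < qp) (hqp : qp < 1)
    (hp : qp = lam * (1 - qm) ^ (d - 1) / (1 + lam * (1 - qm) ^ (d - 1)))
    (hm : qm = lam * (1 - qp) ^ (d - 1) / (1 + lam * (1 - qp) ^ (d - 1))) : False := by
  obtain ⟨m, rfl⟩ : ∃ m, d = m + 3 := ⟨d - 3, by omega⟩
  rw [show m + 3 - 1 = m + 2 from rfl] at hp hm
  have hlam0 : 0 < lam := pos_of_hardCore_treeTwoCycle hqm hlt hqp hm
  obtain ⟨hr1, -, hl⟩ := hardCore_treeTwoCycle_param hlam0 hlt hqp hp hm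
  have hmono := kelly_curve_strictMonoOn m (Set.mem_Ici.2 le_rfl) (Set.mem_Ici.2 hr1.le) hr1
  dsimp only at hmono
  rw [kelly_curve_one, ← hl] at hmono
  linarith

end TwoCycleUniqueness

/-! ### The critical points of `Φ₁` (Sly §1.3, first bullet) -/

section CriticalClassification

open Finset

/-- **From an asymmetric critical point of `Φ₁` to a two-cycle** (Sly's (e:pqRelation)
`q^{±} = p^{±}/(1-p^{∓})`, read backwards). For `d ≥ 1`, `0 < β < α`, `α + β < 1` solving both critical
equations `λ(1-α-β)^d = α(1-α)^{d-1}` (`∂_α Φ₁ = 0`) and `λ(1-α-β)^d = β(1-β)^{d-1}` (`∂_β Φ₁ = 0`),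
the densities `q⁺ = α/(1-β)`, `q⁻ = β/(1-α)` form a two-cycle `q⁻ < q⁺ < 1` of the tree recursion
`q ↦ λ(1-q)^{d-1}/(1+λ(1-q)^{d-1})`. [cite: Sly2010, §1.3 (eq. (e:pqRelation) and the display after it)] -/
theorem hardCore_treeTwoCycle_of_critical {d : ℕ} (hd : 1 ≤ d) {lam α β : ℝ} (hβ : 0 < β)
    (hlt : β < α) (hαβ : α + β < 1)
    (hEα : lam * (1 - α - β) ^ d = α * (1 - α) ^ (d - 1))
    (hEβ : lam * (1 - α - β) ^ d = β * (1 - β) ^ (d - 1)) :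
    β / (1 - α) < α / (1 - β) ∧ α / (1 - β) < 1 ∧
      α / (1 - β) = lam * (1 - β / (1 - α)) ^ (d - 1) / (1 + lam * (1 - β / (1 - α)) ^ (d - 1)) ∧
      β / (1 - α) = lam * (1 - α / (1 - β)) ^ (d - 1) / (1 + lam * (1 - α / (1 - β)) ^ (d - 1)) := by
  obtain ⟨k, rfl⟩ : ∃ k, d = k + 1 := ⟨d - 1, by omega⟩
  simp only [Nat.add_sub_cancel] at hEα hEβ ⊢
  have h1 : 0 < 1 - α := by linarith
  have h2 : 0 < 1 - β := by linarith
  have hu : 0 < 1 - α - β := by linarith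
  have hlam : 0 < lam := by
    by_contra h
    push Not at h
    have : lam * (1 - α - β) ^ (k + 1) ≤ 0 := mul_nonpos_of_nonpos_of_nonneg h (by positivity)
    have : 0 < β * (1 - β) ^ k := by positivity
    linarith
  refine ⟨?_, ?_, ?_, ?_⟩
  · rw [div_lt_div_iff₀ h1 h2]; nlinarith
  · rw [div_lt_one h2]; linarith
  · have e : 1 - β / (1 - α) = (1 - α - β) / (1 - α) := one_sub_div h1.ne'
    set v : ℝ := ((1 - α - β) / (1 - α)) ^ k with hv_def
    have hv : v * (1 - α) ^ k = (1 - α - β) ^ k := by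
      rw [hv_def, div_pow, div_mul_cancel₀ _ (pow_ne_zero k h1.ne')]
    have hv0 : 0 ≤ v := by positivity
    have key : α * (1 + lam * v) = lam * v * (1 - β) := by
      apply mul_right_cancel₀ (pow_ne_zero k h1.ne')
      linear_combination (-1 : ℝ) * hEα - lam * (1 - α - β) * hv
    rw [e, div_eq_div_iff h2.ne' (by positivity)]
    exact key
  · have e : 1 - α / (1 - β) = (1 - α - β) / (1 - β) := by
      rw [one_sub_div h2.ne', show (1 : ℝ) - β - α = 1 - α - β by ring]
    set w : ℝ := ((1 - α - β) / (1 - β)) ^ k with hw_def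
    have hw : w * (1 - β) ^ k = (1 - α - β) ^ k := by
      rw [hw_def, div_pow, div_mul_cancel₀ _ (pow_ne_zero k h2.ne')]
    have hw0 : 0 ≤ w := by positivity
    have key : β * (1 + lam * w) = lam * w * (1 - α) := by
      apply mul_right_cancel₀ (pow_ne_zero k h2.ne')
      linear_combination (-1 : ℝ) * hEβ - lam * (1 - α - β) * hw
    rw [e, div_eq_div_iff h1.ne' (by positivity)]
    exact key

/-- **Uniqueness of the asymmetric critical point of `Φ₁`.** For `d ≥ 3` and any `λ`, the system
`λ(1-α-β)^d = α(1-α)^{d-1} = β(1-β)^{d-1}` has at most one solution with `0 < β < α`, `α + β < 1`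
(the point `(p⁺, p⁻)` of Sly §1.3): two solutions give two two-cycles of the tree recursion
(`hardCore_treeTwoCycle_of_critical`), which coincide by Kelly's theorem
(`hardCore_treeTwoCycle_unique`), and `(α, β) ↦ (α/(1-β), β/(1-α))` is injective on the triangle.
[cite: Sly2010, §1.3 (first bullet: "the solutions to `h(α) = β, h(β) = α` … are exactly `(p⁺,p⁻)`, `(p⁻,p⁺)` and `(p*,p*)`")] -/
theorem slyCritical_asymm_unique {d : ℕ} (hd : 3 ≤ d) {lam α β α' β' : ℝ}
    (hβ : 0 < β) (hlt : β < α) (hαβ : α + β < 1)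
    (hEα : lam * (1 - α - β) ^ d = α * (1 - α) ^ (d - 1))
    (hEβ : lam * (1 - α - β) ^ d = β * (1 - β) ^ (d - 1))
    (hβ' : 0 < β') (hlt' : β' < α') (hαβ' : α' + β' < 1)
    (hEα' : lam * (1 - α' - β') ^ d = α' * (1 - α') ^ (d - 1))
    (hEβ' : lam * (1 - α' - β') ^ d = β' * (1 - β') ^ (d - 1)) : α = α' ∧ β = β' := by
  have hd1 : 1 ≤ d := by omega
  have hlam : 0 < lam := by
    by_contra h
    push Not at h
    have : lam * (1 - α - β) ^ d ≤ 0 :=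
      mul_nonpos_of_nonpos_of_nonneg h (pow_nonneg (by linarith) _)
    have : 0 < β * (1 - β) ^ (d - 1) := mul_pos hβ (pow_pos (by linarith) _)
    linarith
  obtain ⟨c1, c2, c3, c4⟩ := hardCore_treeTwoCycle_of_critical hd1 hβ hlt hαβ hEα hEβ
  obtain ⟨c1', c2', c3', c4'⟩ := hardCore_treeTwoCycle_of_critical hd1 hβ' hlt' hαβ' hEα' hEβ'
  obtain ⟨hq1, hq2⟩ := hardCore_treeTwoCycle_unique hd hlam c1 c2 c3 c4 c1' c2' c3' c4'
  rw [div_eq_div_iff (by linarith : (1 - β : ℝ) ≠ 0) (by linarith : (1 - β' : ℝ) ≠ 0)] at hq1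
  rw [div_eq_div_iff (by linarith : (1 - α : ℝ) ≠ 0) (by linarith : (1 - α' : ℝ) ≠ 0)] at hq2
  have hsum : α + β = α' + β' := by linear_combination hq1 + hq2
  have hα : (α - α') * (1 - α - β) = 0 := by linear_combination hq1 - α * hsum
  rcases mul_eq_zero.1 hα with h | h
  · exact ⟨by linarith, by linarith⟩
  · exact absurd h (by linarith)

/-- **No asymmetric critical point at or below the threshold.** For `d ≥ 3` and `λ ≤ λ_c(𝕋_d)` the
system `λ(1-α-β)^d = α(1-α)^{d-1} = β(1-β)^{d-1}` has no solution with `0 < β < α`, `α + β < 1`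
(it would give a two-cycle of the tree recursion, `not_hardCore_treeTwoCycle_of_le`).
[cite: Sly2010, §1.3 (first bullet, "for `λ > λ_c`"; uniqueness below `λ_c` after Kelly 1985)] -/
theorem not_slyCritical_asymm_of_le {d : ℕ} (hd : 3 ≤ d) {lam α β : ℝ}
    (hlam : lam ≤ hardCoreThreshold d) (hβ : 0 < β) (hlt : β < α) (hαβ : α + β < 1)
    (hEα : lam * (1 - α - β) ^ d = α * (1 - α) ^ (d - 1))
    (hEβ : lam * (1 - α - β) ^ d = β * (1 - β) ^ (d - 1)) : False := by
  obtain ⟨c1, c2, c3, c4⟩ := hardCore_treeTwoCycle_of_critical (by omega) hβ hlt hαβ hEα hEβ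
  exact not_hardCore_treeTwoCycle_of_le hd hlam (div_pos hβ (by linarith)) c1 c2 c3 c4

/-- **The symmetric critical point `(p*, p*)` exists** for every `d ≥ 2`, `λ > 0`: a solution
`0 < p* < 1/2` of `λ(1-2p)^d = p(1-p)^{d-1}` (both critical equations on the diagonal), namely
`p* = q*/(1+q*)` for the fixed point `q*` of the tree recursion (`existsUnique_hardCore_treeFixedPoint`;
Sly's free measure, `q* = p*/(1-p*)` by (e:pqRelation)).
[cite: Sly2010, §1.3 (the free measure with density `p*`; first bullet)] -/
theorem exists_slyCritical_symm {d : ℕ} (hd : 2 ≤ d) {lam : ℝ} (hlam : 0 < lam) :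
    ∃ p : ℝ, 0 < p ∧ 2 * p < 1 ∧ lam * (1 - 2 * p) ^ d = p * (1 - p) ^ (d - 1) := by
  obtain ⟨q, ⟨⟨hq0, hq1⟩, hfix⟩, -⟩ := existsUnique_hardCore_treeFixedPoint hd hlam
  obtain ⟨k, rfl⟩ : ∃ k, d = k + 1 := ⟨d - 1, by omega⟩
  simp only [Nat.add_sub_cancel] at hfix ⊢
  have hden : 0 < 1 + lam * (1 - q) ^ k := by positivity
  have hfix' : q = lam * (1 - q) ^ (k + 1) := by
    rw [eq_div_iff hden.ne'] at hfix
    linear_combination hfix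
  have h1q : 0 < 1 + q := by linarith
  refine ⟨q / (1 + q), by positivity, ?_, ?_⟩
  · rw [← lt_div_iff₀' two_pos, div_lt_div_iff₀ h1q two_pos]; linarith
  · have e1 : 1 - 2 * (q / (1 + q)) = (1 - q) / (1 + q) := by
      rw [eq_div_iff h1q.ne']; field_simp; ring
    have e2 : 1 - q / (1 + q) = 1 / (1 + q) := by
      rw [one_sub_div h1q.ne', add_sub_cancel_right]
    rw [e1, e2, div_pow, div_pow, one_pow, div_mul_div_comm, mul_one, ← pow_succ', ← mul_div_assoc,
      ← hfix']

/-- **The symmetric critical point is unique** (`d ≥ 1`, any `λ`): `p ↦ p(1-p)^{d-1}/(1-2p)^d` is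
strictly increasing on `(0, 1/2)` (product of the increasing positive factors `p`,
`((1-p)/(1-2p))^{d-1}` and `1/(1-2p)`). [cite: Sly2010, §1.3 (first bullet: `(p*, p*)`)] -/
theorem slyCritical_symm_unique {d : ℕ} (hd : 1 ≤ d) {lam p p' : ℝ} (hp : 0 < p) (h2p : 2 * p < 1)
    (hE : lam * (1 - 2 * p) ^ d = p * (1 - p) ^ (d - 1)) (hp' : 0 < p') (h2p' : 2 * p' < 1)
    (hE' : lam * (1 - 2 * p') ^ d = p' * (1 - p') ^ (d - 1)) : p = p' := by
  obtain ⟨k, rfl⟩ : ∃ k, d = k + 1 := ⟨d - 1, by omega⟩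
  simp only [Nat.add_sub_cancel] at hE hE'
  -- the strictly increasing function `ψ(p) (1-2p')^{k+1} (1-2p)^{k+1}`-comparison
  have key : ∀ x y : ℝ, 0 < x → x < y → 2 * y < 1 →
      x * (1 - x) ^ k * (1 - 2 * y) ^ (k + 1) < y * (1 - y) ^ k * (1 - 2 * x) ^ (k + 1) := by
    intro x y hx hxy hy
    have hA : (1 - x) * (1 - 2 * y) < (1 - y) * (1 - 2 * x) := by nlinarith
    have hA' : ((1 - x) * (1 - 2 * y)) ^ k ≤ ((1 - y) * (1 - 2 * x)) ^ k :=
      pow_le_pow_left₀ (by nlinarith) hA.le k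
    rw [mul_pow, mul_pow] at hA'
    have hB : x * (1 - 2 * y) < y * (1 - 2 * x) := by nlinarith
    have hP : 0 < (1 - x) ^ k * (1 - 2 * y) ^ k :=
      mul_pos (pow_pos (by linarith) k) (pow_pos (by linarith) k)
    calc x * (1 - x) ^ k * (1 - 2 * y) ^ (k + 1)
        = (x * (1 - 2 * y)) * ((1 - x) ^ k * (1 - 2 * y) ^ k) := by ring
      _ < (y * (1 - 2 * x)) * ((1 - y) ^ k * (1 - 2 * x) ^ k) :=
          mul_lt_mul hB hA' hP (by nlinarith)
      _ = y * (1 - y) ^ k * (1 - 2 * x) ^ (k + 1) := by ring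
  by_contra hne
  rcases lt_or_gt_of_ne hne with h | h
  · have h1 := key p p' hp h h2p'
    have h2 : lam * (1 - 2 * p) ^ (k + 1) * (1 - 2 * p') ^ (k + 1) =
        lam * (1 - 2 * p') ^ (k + 1) * (1 - 2 * p) ^ (k + 1) := by ring
    rw [hE, hE'] at h2
    linarith
  · have h1 := key p' p hp' h h2p
    have h2 : lam * (1 - 2 * p') ^ (k + 1) * (1 - 2 * p) ^ (k + 1) =
        lam * (1 - 2 * p) ^ (k + 1) * (1 - 2 * p') ^ (k + 1) := by ring
    rw [hE, hE'] at h2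
    linarith

/-- **`p* > 1/d` exactly above the threshold.** For `d ≥ 3`, `λ > 0` and the symmetric critical point
`p*` (`λ(1-2p*)^d = p*(1-p*)^{d-1}`, `0 < p* < 1/2`): `p* > 1/d ⟺ λ > λ_c(𝕋_d)`; equivalently
(`q* = p*/(1-p*)`) the instability `(d-1) q* > 1` of the free fixed point,
`hardCore_treeFixedPoint_unstable_iff` ("when `λ ↓ λ_c` we have that `p*, p⁺, p⁻ → 1/d`").
[cite: Sly2010, §1.3 (first bullet; `λ_c(d) = (d-1)^{d-1}/(d-2)^d`)] -/
theorem inv_lt_slyCritical_symm_iff {d : ℕ} (hd : 3 ≤ d) {lam p : ℝ} (hlam : 0 < lam) (hp : 0 < p)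
    (h2p : 2 * p < 1) (hE : lam * (1 - 2 * p) ^ d = p * (1 - p) ^ (d - 1)) :
    1 / (d : ℝ) < p ↔ hardCoreThreshold d < lam := by
  have h1p : 0 < 1 - p := by linarith
  -- `q = p/(1-p)` is the fixed point of the tree recursion
  have hfix : p / (1 - p) = lam * (1 - p / (1 - p)) ^ (d - 1) / (1 + lam * (1 - p / (1 - p)) ^ (d - 1)) := by
    obtain ⟨k, rfl⟩ : ∃ k, d = k + 1 := ⟨d - 1, by omega⟩
    simp only [Nat.add_sub_cancel] at hE ⊢
    have e : 1 - p / (1 - p) = (1 - 2 * p) / (1 - p) := by field_simp; ring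
    set v : ℝ := ((1 - 2 * p) / (1 - p)) ^ k with hv_def
    have hv : v * (1 - p) ^ k = (1 - 2 * p) ^ k := by
      rw [hv_def, div_pow, div_mul_cancel₀ _ (pow_ne_zero k h1p.ne')]
    have hv0 : 0 ≤ v := by rw [hv_def]; exact pow_nonneg (div_nonneg (by linarith) h1p.le) k
    have key : p * (1 + lam * v) = lam * v * (1 - p) := by
      apply mul_right_cancel₀ (pow_ne_zero k h1p.ne')
      linear_combination (-1 : ℝ) * hE - lam * (1 - 2 * p) * hv
    rw [e, div_eq_div_iff h1p.ne' (by positivity)]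
    exact key
  have hiff := hardCore_treeFixedPoint_unstable_iff hd hlam (div_pos hp h1p)
    (by rw [div_lt_one h1p]; linarith) hfix
  rw [← hiff]
  have hd0 : (0 : ℝ) < d := by exact_mod_cast (show 0 < d by omega)
  rw [div_lt_iff₀ hd0, ← mul_div_assoc, lt_div_iff₀ h1p]
  constructor <;> intro h <;> nlinarith

/-- **The partner map is decreasing.** If `(x, a)` and `(y, b)` solve the same critical equation
`λ(1-a-x)^d = x(1-x)^{d-1}`, `λ(1-b-y)^d = y(1-y)^{d-1}` (`a = h(x)`, `b = h(y)` with DFJ's `h`), with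
`0 < x < y`, `a + x < 1`, `b + y < 1`, `b > 0`, then `b < a`: DFJ's `h(t) = (1-t)[1-(t/(λ(1-t)))^{1/d}]`
is strictly decreasing where it is positive. [cite: Sly2010, §1.3 (first bullet, the function `h`)] -/
theorem slyCritical_partner_lt {d : ℕ} (hd : 1 ≤ d) {lam x y a b : ℝ} (hx : 0 < x) (hxy : x < y)
    (hax : a + x < 1) (hby : b + y < 1) (hb : 0 < b)
    (hEx : lam * (1 - a - x) ^ d = x * (1 - x) ^ (d - 1))
    (hEy : lam * (1 - b - y) ^ d = y * (1 - y) ^ (d - 1)) : b < a := by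
  obtain ⟨k, rfl⟩ : ∃ k, d = k + 1 := ⟨d - 1, by omega⟩
  simp only [Nat.add_sub_cancel] at hEx hEy
  have hy1 : 0 < 1 - y := by linarith
  have hx1 : 0 < 1 - x := by linarith
  have hu' : 0 < 1 - b - y := by linarith
  have hlam : 0 < lam := by
    by_contra h
    push Not at h
    have : lam * (1 - b - y) ^ (k + 1) ≤ 0 := mul_nonpos_of_nonpos_of_nonneg h (by positivity)
    have : 0 < y * (1 - y) ^ k := mul_pos (hx.trans hxy) (pow_pos hy1 k)
    linarith
  have hu : 0 < 1 - a - x := by linarith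
  -- compare `λ (u(1-y))^{k+1} = [x(1-y)]·[(1-x)(1-y)]^k` with `λ (u'(1-x))^{k+1} = [y(1-x)]·[(1-x)(1-y)]^k`
  have hpow : ((1 - a - x) * (1 - y)) ^ (k + 1) < ((1 - b - y) * (1 - x)) ^ (k + 1) := by
    have hP : 0 < (1 - x) ^ k * (1 - y) ^ k := mul_pos (pow_pos hx1 k) (pow_pos hy1 k)
    have h1 : lam * ((1 - a - x) ^ (k + 1) * (1 - y) ^ (k + 1)) <
        lam * ((1 - b - y) ^ (k + 1) * (1 - x) ^ (k + 1)) := by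
      calc lam * ((1 - a - x) ^ (k + 1) * (1 - y) ^ (k + 1))
          = (lam * (1 - a - x) ^ (k + 1)) * (1 - y) ^ (k + 1) := by ring
        _ = (x * (1 - y)) * ((1 - x) ^ k * (1 - y) ^ k) := by rw [hEx]; ring
        _ < (y * (1 - x)) * ((1 - x) ^ k * (1 - y) ^ k) := by
            apply mul_lt_mul_of_pos_right _ hP
            nlinarith
        _ = (lam * (1 - b - y) ^ (k + 1)) * (1 - x) ^ (k + 1) := by rw [hEy]; ring
        _ = lam * ((1 - b - y) ^ (k + 1) * (1 - x) ^ (k + 1)) := by ring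
    rw [mul_pow, mul_pow]
    exact lt_of_mul_lt_mul_left h1 hlam.le
  have hlt : (1 - a - x) * (1 - y) < (1 - b - y) * (1 - x) :=
    lt_of_pow_lt_pow_left₀ (k + 1) (by positivity) hpow
  nlinarith [mul_pos hb (sub_pos.2 hxy)]

/-- **The order `p⁻ < p* < p⁺`** ("These densities satisfy `p⁻ < p* < p⁺`"): for the asymmetric
critical point `(p⁺, p⁻)` (`0 < p⁻ < p⁺`, `p⁺ + p⁻ < 1`) and the symmetric one `(p*, p*)` of the
system `λ(1-α-β)^d = α(1-α)^{d-1} = β(1-β)^{d-1}` (`d ≥ 1`), one has `p⁻ < p* < p⁺` — because the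
partner map `h` is strictly decreasing (`slyCritical_partner_lt`) with `h(p⁺) = p⁻`, `h(p⁻) = p⁺`,
`h(p*) = p*`. [cite: Sly2010, §1.3 (first bullet)] -/
theorem slyCritical_order {d : ℕ} (hd : 1 ≤ d) {lam ps pp pm : ℝ} (hpm : 0 < pm) (hlt : pm < pp)
    (hsum : pp + pm < 1)
    (hEα : lam * (1 - pp - pm) ^ d = pp * (1 - pp) ^ (d - 1))
    (hEβ : lam * (1 - pp - pm) ^ d = pm * (1 - pm) ^ (d - 1))
    (hps : 0 < ps) (h2 : 2 * ps < 1) (hEs : lam * (1 - 2 * ps) ^ d = ps * (1 - ps) ^ (d - 1)) :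
    pm < ps ∧ ps < pp := by
  have hd0 : d ≠ 0 := by omega
  have hlam : 0 < lam := by
    by_contra h
    push Not at h
    have : lam * (1 - 2 * ps) ^ d ≤ 0 := mul_nonpos_of_nonpos_of_nonneg h (pow_nonneg (by linarith) _)
    have : 0 < ps * (1 - ps) ^ (d - 1) := mul_pos hps (pow_pos (by linarith) _)
    linarith
  have hEs' : lam * (1 - ps - ps) ^ d = ps * (1 - ps) ^ (d - 1) := by
    rw [show (1 : ℝ) - ps - ps = 1 - 2 * ps by ring]; exact hEs
  have hEα' : lam * (1 - pm - pp) ^ d = pp * (1 - pp) ^ (d - 1) := by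
    rw [show (1 : ℝ) - pm - pp = 1 - pp - pm by ring]; exact hEα
  constructor
  · by_contra h
    push Not at h
    rcases h.lt_or_eq with h | h
    · -- `p* < p⁻ < p⁺` contradicts `h` decreasing: `h(p*) = p* > h(p⁻) = p⁺`
      have := slyCritical_partner_lt hd hps h (by linarith) (by linarith) (hpm.trans hlt) hEs' hEβ
      linarith
    · -- `p* = p⁻`: equal partners, `p⁺ = p*`
      rw [h] at hEs'
      have h1 : (1 - pm - pm) ^ d = (1 - pp - pm) ^ d := by
        apply mul_left_cancel₀ hlam.ne'
        rw [hEs', hEβ]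
      rw [pow_left_inj₀ (by linarith) (by linarith) hd0] at h1
      linarith
  · by_contra h
    push Not at h
    rcases h.lt_or_eq with h | h
    · -- `p⁻ < p⁺ < p*` contradicts `h(p⁺) = p⁻ > h(p*) = p*`
      have := slyCritical_partner_lt hd (hpm.trans hlt) h (by linarith) (by linarith) hps hEα' hEs'
      linarith
    · rw [← h] at hEs'
      have h1 : (1 - pm - pp) ^ d = (1 - pp - pp) ^ d := by
        apply mul_left_cancel₀ hlam.ne'
        rw [hEα', hEs']
      rw [pow_left_inj₀ (by linarith) (by linarith) hd0] at h1
      linarith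

/-- **The critical points of `Φ₁` above the threshold** (Sly §1.3, first bullet, after
Mossel–Weitz–Wormald 2009 §4 and Dyer–Frieze–Jerrum 2002 Claim 2.2): for `d ≥ 3` and
`λ > λ_c(𝕋_d)` there are densities `0 < p⁻ < p* < p⁺`, `p⁺ + p⁻ < 1`, `p* < 1/2`, `p* > 1/d`, such that
the solutions in the open triangle `{α, β > 0, α + β < 1}` of the two critical equations of `Φ₁`,
`λ(1-α-β)^d = α(1-α)^{d-1}` (`∂_α Φ₁ = 0`, i.e. `β = h(α)`) and `λ(1-α-β)^d = β(1-β)^{d-1}`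
(`∂_β Φ₁ = 0`, i.e. `α = h(β)`), "are exactly `(p⁺, p⁻)`, `(p⁻, p⁺)` and `(p*, p*)`". (On the closed
triangle the corners `(1, 0)`, `(0, 1)` also solve the polynomial system, trivially; the statement is
about the interior, where it is the critical-point equation of `Φ₁`, `deriv_slyPhi1_right_eq_zero_iff`.)
Existence: `exists_slyCriticalDensities` (from the two-cycle) and `exists_slyCritical_symm`;
exhaustiveness: `slyCritical_asymm_unique` (Kelly's uniqueness of the two-cycle) and
`slyCritical_symm_unique`; order: `slyCritical_order`; `p* > 1/d`: `inv_lt_slyCritical_symm_iff`.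
[cite: Sly2010, §1.3 (first bullet: "The solutions to `h(α) = β, h(β) = α` … are exactly `(p⁺,p⁻)`, `(p⁻,p⁺)` and `(p*,p*)`. These densities satisfy `p⁻ < p* < p⁺`")] -/
theorem sly_criticalPoints {d : ℕ} (hd : 3 ≤ d) {lam : ℝ} (hlam : hardCoreThreshold d < lam) :
    ∃ ps pp pm : ℝ, 0 < pm ∧ pm < ps ∧ ps < pp ∧ pp + pm < 1 ∧ 2 * ps < 1 ∧ 1 / (d : ℝ) < ps ∧
      lam * (1 - 2 * ps) ^ d = ps * (1 - ps) ^ (d - 1) ∧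
      lam * (1 - pp - pm) ^ d = pp * (1 - pp) ^ (d - 1) ∧
      lam * (1 - pp - pm) ^ d = pm * (1 - pm) ^ (d - 1) ∧
      ∀ α β : ℝ, 0 < α → 0 < β → α + β < 1 →
        (lam * (1 - α - β) ^ d = α * (1 - α) ^ (d - 1) ∧
            lam * (1 - α - β) ^ d = β * (1 - β) ^ (d - 1) ↔
          (α = pp ∧ β = pm) ∨ (α = pm ∧ β = pp) ∨ (α = ps ∧ β = ps)) := by
  have hlam0 : 0 < lam := (hardCoreThreshold_pos hd).trans hlam
  obtain ⟨pp, pm, _qp, _qm, hpm, hlt, hsum, hEα, hEβ, _⟩ := exists_slyCriticalDensities hd hlam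
  obtain ⟨ps, hps, h2ps, hEs⟩ := exists_slyCritical_symm (d := d) (by omega) hlam0
  obtain ⟨h1, h2⟩ := slyCritical_order (by omega) hpm hlt hsum hEα hEβ hps h2ps hEs
  refine ⟨ps, pp, pm, hpm, h1, h2, hsum, h2ps,
    (inv_lt_slyCritical_symm_iff hd hlam0 hps h2ps hEs).2 hlam, hEs, hEα, hEβ, ?_⟩
  intro α β hα hβ hαβ
  constructor
  · rintro ⟨hA, hB⟩
    rcases lt_trichotomy β α with h | h | h
    · exact Or.inl (slyCritical_asymm_unique hd hβ h hαβ hA hB hpm hlt hsum hEα hEβ)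
    · subst h
      have hE : lam * (1 - 2 * β) ^ d = β * (1 - β) ^ (d - 1) := by
        rw [show (1 : ℝ) - 2 * β = 1 - β - β by ring]; exact hA
      have e := slyCritical_symm_unique (by omega) hβ (by linarith) hE hps h2ps hEs
      exact Or.inr (Or.inr ⟨e, e⟩)
    · have hA' : lam * (1 - β - α) ^ d = β * (1 - β) ^ (d - 1) := by
        rw [show (1 : ℝ) - β - α = 1 - α - β by ring]; exact hB
      have hB' : lam * (1 - β - α) ^ d = α * (1 - α) ^ (d - 1) := by
        rw [show (1 : ℝ) - β - α = 1 - α - β by ring]; exact hA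
      obtain ⟨e1, e2⟩ :=
        slyCritical_asymm_unique hd hα h (by linarith) hA' hB' hpm hlt hsum hEα hEβ
      exact Or.inr (Or.inl ⟨e2, e1⟩)
  · rintro (⟨hα', hβ'⟩ | ⟨hα', hβ'⟩ | ⟨hα', hβ'⟩) <;> rw [hα', hβ']
    · exact ⟨hEα, hEβ⟩
    · rw [show (1 : ℝ) - pm - pp = 1 - pp - pm by ring]
      exact ⟨hEβ, hEα⟩
    · rw [show (1 : ℝ) - ps - ps = 1 - 2 * ps by ring]
      exact ⟨hEs, hEs⟩

/-- **The critical points of `Φ₁` at or below the threshold**: for `d ≥ 3` and `0 < λ ≤ λ_c(𝕋_d)`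
the only solution of the two critical equations in the open triangle is the symmetric point
`(p*, p*)`, and `p* ≤ 1/d` (Kelly's uniqueness regime: no two-cycle, `not_slyCritical_asymm_of_le`).
[cite: Sly2010, §1.3 ("uniqueness when `λ ≤ λ_c`" [Kelly:85]; first bullet)] -/
theorem sly_criticalPoints_of_le {d : ℕ} (hd : 3 ≤ d) {lam : ℝ} (hlam0 : 0 < lam)
    (hlam : lam ≤ hardCoreThreshold d) :
    ∃ ps : ℝ, 0 < ps ∧ 2 * ps < 1 ∧ ps ≤ 1 / (d : ℝ) ∧
      lam * (1 - 2 * ps) ^ d = ps * (1 - ps) ^ (d - 1) ∧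
      ∀ α β : ℝ, 0 < α → 0 < β → α + β < 1 →
        (lam * (1 - α - β) ^ d = α * (1 - α) ^ (d - 1) ∧
            lam * (1 - α - β) ^ d = β * (1 - β) ^ (d - 1) ↔ α = ps ∧ β = ps) := by
  obtain ⟨ps, hps, h2ps, hEs⟩ := exists_slyCritical_symm (d := d) (by omega) hlam0
  refine ⟨ps, hps, h2ps, ?_, hEs, ?_⟩
  · by_contra h
    push Not at h
    exact absurd ((inv_lt_slyCritical_symm_iff hd hlam0 hps h2ps hEs).1 h) (not_lt.2 hlam)
  intro α β hα hβ hαβ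
  constructor
  · rintro ⟨hA, hB⟩
    rcases lt_trichotomy β α with h | h | h
    · exact (not_slyCritical_asymm_of_le hd hlam hβ h hαβ hA hB).elim
    · subst h
      have hE : lam * (1 - 2 * β) ^ d = β * (1 - β) ^ (d - 1) := by
        rw [show (1 : ℝ) - 2 * β = 1 - β - β by ring]; exact hA
      have e := slyCritical_symm_unique (by omega) hβ (by linarith) hE hps h2ps hEs
      exact ⟨e, e⟩
    · have hA' : lam * (1 - β - α) ^ d = β * (1 - β) ^ (d - 1) := by
        rw [show (1 : ℝ) - β - α = 1 - α - β by ring]; exact hB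
      have hB' : lam * (1 - β - α) ^ d = α * (1 - α) ^ (d - 1) := by
        rw [show (1 : ℝ) - β - α = 1 - α - β by ring]; exact hA
      exact (not_slyCritical_asymm_of_le hd hlam hα h (by linarith) hA' hB').elim
  · rintro ⟨hα', hβ'⟩
    rw [hα', hβ', show (1 : ℝ) - ps - ps = 1 - 2 * ps by ring]
    exact ⟨hEs, hEs⟩

end CriticalClassification

/-! ### The global maximum of `Φ₁` on the triangle (Sly §1.3, second bullet) -/

section GlobalMax

open Filter Topology Literature.Probability.LatticeModels

/-- `Φ₁` is continuous on the plane (with `0 log 0 = 0`, as `Real.log 0 = 0`). [folklore] -/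
theorem continuous_slyPhi1 (d : ℕ) (lam : ℝ) :
    Continuous fun p : ℝ × ℝ => slyPhi1 d lam p.1 p.2 := by
  set φ : ℝ → ℝ := fun x => x * Real.log x with hφ
  have hml : Continuous φ := Real.continuous_mul_log
  have e : (fun p : ℝ × ℝ => slyPhi1 d lam p.1 p.2) = fun p =>
      (p.1 + p.2) * Real.log lam - φ p.1 - φ p.2 - d * φ (1 - p.1 - p.2) +
        (d - 1) * (φ (1 - p.1) + φ (1 - p.2)) := by
    funext p
    simp only [slyPhi1, hφ]
    ring
  rw [e]
  fun_prop

/-- Continuity of the section `Φ₁(α, ·)`. [folklore] -/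
theorem continuous_slyPhi1_right (d : ℕ) (lam α : ℝ) : Continuous fun b : ℝ => slyPhi1 d lam α b :=
  (continuous_slyPhi1 d lam).comp (Continuous.prodMk_right α)

/-- **The section `Φ₁(α, ·)` on the closed interval `[0, 1-α]`, for `0 ≤ α < 1`**: there is a unique
critical point `β_α ∈ (0, 1-α)` (`λ(1-α-β_α)^d = β_α(1-β_α)^{d-1}`, i.e. `α = h(β_α)`), and `Φ₁(α, ·)`
is strictly increasing on `[0, β_α]` and strictly decreasing on `[β_α, 1-α]` — so `β_α` is its strict
maximum on the closed interval, endpoints included (the case `α = 0` and the endpoints are what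
`slyPhi1_right_critical_unique_max` leaves out). [cite: Sly2010, §1.3 (maxima of `Φ₁`, after DFJ02 Claim 2.2: "for fixed `α` … `Φ₁` is maximised by setting `β = h(α)`")] -/
theorem slyPhi1_right_max_Icc (d : ℕ) (hd : 1 ≤ d) {lam α : ℝ} (hlam : 0 < lam)
    (hα : 0 ≤ α) (hα1 : α < 1) :
    ∃ βs : ℝ, 0 < βs ∧ βs < 1 - α ∧ lam * (1 - α - βs) ^ d = βs * (1 - βs) ^ (d - 1) ∧
      (∀ β : ℝ, 0 < β → β < 1 - α → lam * (1 - α - β) ^ d = β * (1 - β) ^ (d - 1) → β = βs) ∧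
      StrictMonoOn (fun b => slyPhi1 d lam α b) (Set.Icc 0 βs) ∧
      StrictAntiOn (fun b => slyPhi1 d lam α b) (Set.Icc βs (1 - α)) := by
  have hd0 : (0 : ℝ) < d := by exact_mod_cast hd
  set g : ℝ → ℝ := fun b => Real.log lam - Real.log b + d * Real.log (1 - α - b) -
    (d - 1) * Real.log (1 - b) with hg
  -- `g = ∂_β Φ₁(α, ·)` is continuous and strictly decreasing on `(0, 1 - α)`
  have hg_deriv : ∀ b ∈ Set.Ioo 0 (1 - α),
      HasDerivAt g (-b⁻¹ - d * (1 - α - b)⁻¹ + (d - 1) * (1 - b)⁻¹) b :=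
    fun b hb => hasDerivAt_deriv_slyPhi1_right d lam hα hb.1 (by linarith [hb.2])
  have hg_cont : ContinuousOn g (Set.Ioo 0 (1 - α)) :=
    fun b hb => (hg_deriv b hb).continuousAt.continuousWithinAt
  have hg_anti : StrictAntiOn g (Set.Ioo 0 (1 - α)) := by
    refine strictAntiOn_of_deriv_neg (convex_Ioo _ _) hg_cont fun b hb => ?_
    rw [interior_Ioo] at hb
    rw [(hg_deriv b hb).deriv]
    exact deriv2_slyPhi1_right_neg d hα hb.1 (by linarith [hb.2])
  have hu : ∀ b : ℝ, HasDerivAt (fun b : ℝ => 1 - α - b) (-1) b := fun b => by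
    simpa using (hasDerivAt_id' b).const_sub (1 - α)
  have hv : ∀ b : ℝ, HasDerivAt (fun b : ℝ => 1 - b) (-1) b := fun b => by
    simpa using (hasDerivAt_id' b).const_sub 1
  -- limit `+∞` at `0⁺`
  have hlim0 : Tendsto g (𝓝[>] 0) atTop := by
    set r : ℝ → ℝ := fun b => Real.log lam + d * Real.log (1 - α - b) - (d - 1) * Real.log (1 - b)
      with hr
    have hr0 : ContinuousAt r 0 := by
      have e2 := ((hu 0).log (by norm_num; linarith)).const_mul (d : ℝ)
      have e3 := ((hv 0).log (by norm_num)).const_mul ((d : ℝ) - 1)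
      exact (((hasDerivAt_const (0 : ℝ) (Real.log lam)).add e2).sub e3).continuousAt
    have h1 : Tendsto (fun b : ℝ => -Real.log b) (𝓝[>] 0) atTop :=
      tendsto_neg_atBot_atTop.comp Real.tendsto_log_nhdsGT_zero
    have h2 : Tendsto r (𝓝[>] 0) (𝓝 (r 0)) := hr0.tendsto.mono_left nhdsWithin_le_nhds
    refine (h1.atTop_add h2).congr fun b => ?_
    simp only [hg, hr]
    ring
  -- near `(1-α)⁻` the derivative is eventually negative: `g ≤ log λ - log b + log(1-α-b) → -∞`
  have hlim1 : Tendsto (fun b => Real.log lam - Real.log b + Real.log (1 - α - b))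
      (𝓝[<] (1 - α)) atBot := by
    set r : ℝ → ℝ := fun b => Real.log lam - Real.log b with hr
    have hr1 : ContinuousAt r (1 - α) :=
      ((hasDerivAt_const (1 - α : ℝ) (Real.log lam)).sub
        (Real.hasDerivAt_log (show (1 : ℝ) - α ≠ 0 by linarith))).continuousAt
    have hsub : Tendsto (fun b : ℝ => 1 - α - b) (𝓝[<] (1 - α)) (𝓝[>] 0) := by
      rw [tendsto_nhdsWithin_iff]
      constructor
      · have : Tendsto (fun b : ℝ => 1 - α - b) (𝓝 (1 - α)) (𝓝 (1 - α - (1 - α))) :=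
          ((hu (1 - α)).continuousAt).tendsto
        rw [sub_self] at this
        exact this.mono_left nhdsWithin_le_nhds
      · filter_upwards [self_mem_nhdsWithin] with b hb
        exact Set.mem_Ioi.2 (by simpa using hb)
    have h1 : Tendsto (fun b : ℝ => Real.log (1 - α - b)) (𝓝[<] (1 - α)) atBot :=
      Real.tendsto_log_nhdsGT_zero.comp hsub
    have h2 : Tendsto r (𝓝[<] (1 - α)) (𝓝 (r (1 - α))) := hr1.tendsto.mono_left nhdsWithin_le_nhds
    have h3 := h2.add_atBot h1
    exact h3.congr fun b => by simp only [hr]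
  -- points where `g > 0` and `g < 0`, separated by `(1 - α)/2`
  obtain ⟨b₁, hb₁0, hb₁1, hgb₁⟩ : ∃ b₁, 0 < b₁ ∧ b₁ < (1 - α) / 2 ∧ 0 < g b₁ := by
    have h1 : ∀ᶠ b in 𝓝[>] (0 : ℝ), 0 < g b := hlim0.eventually (eventually_gt_atTop 0)
    have h2 : ∀ᶠ b in 𝓝[>] (0 : ℝ), b ∈ Set.Ioo 0 ((1 - α) / 2) := Ioo_mem_nhdsGT (by linarith)
    obtain ⟨b, hb, hb'⟩ := (h1.and h2).exists
    exact ⟨b, hb'.1, hb'.2, hb⟩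
  obtain ⟨b₂, hb₂0, hb₂1, hgb₂⟩ : ∃ b₂, (1 - α) / 2 < b₂ ∧ b₂ < 1 - α ∧ g b₂ < 0 := by
    have h1 : ∀ᶠ b in 𝓝[<] (1 - α), Real.log lam - Real.log b + Real.log (1 - α - b) < 0 :=
      hlim1.eventually (eventually_lt_atBot 0)
    have h2 : ∀ᶠ b in 𝓝[<] (1 - α), b ∈ Set.Ioo ((1 - α) / 2) (1 - α) :=
      Ioo_mem_nhdsLT (by linarith)
    obtain ⟨b, hb, hb'⟩ := (h1.and h2).exists
    refine ⟨b, hb'.1, hb'.2, ?_⟩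
    -- `g b ≤ log λ - log b + log(1-α-b)` since `log(1-α-b) ≤ log(1-b)`
    have hb0 : 0 < b := by linarith [hb'.1]
    have hlog : Real.log (1 - α - b) ≤ Real.log (1 - b) :=
      Real.log_le_log (by linarith [hb'.2]) (by linarith)
    have : g b = Real.log lam - Real.log b + Real.log (1 - α - b) +
        ((d : ℝ) - 1) * (Real.log (1 - α - b) - Real.log (1 - b)) := by
      simp only [hg]; ring
    rw [this]
    have hd1 : (0 : ℝ) ≤ (d : ℝ) - 1 := by linarith [show (1 : ℝ) ≤ d by exact_mod_cast hd]
    nlinarith [mul_nonpos_of_nonneg_of_nonpos hd1 (sub_nonpos.2 hlog)]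
  -- the critical point, by the intermediate value theorem
  obtain ⟨βs, ⟨hβs1, hβs2⟩, hgβs⟩ : ∃ βs ∈ Set.Ioo b₁ b₂, g βs = 0 := by
    have hcont : ContinuousOn g (Set.Icc b₁ b₂) :=
      hg_cont.mono fun x hx => ⟨by linarith [hx.1], by linarith [hx.2]⟩
    exact intermediate_value_Ioo' (by linarith) hcont ⟨hgb₂, hgb₁⟩
  have hβs0 : 0 < βs := by linarith
  have hβs3 : βs < 1 - α := by linarith
  have hcrit : lam * (1 - α - βs) ^ d = βs * (1 - βs) ^ (d - 1) :=
    (deriv_slyPhi1_right_eq_zero_iff d hd hlam hα hβs0 (by linarith)).1 hgβs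
  have hΦ_deriv : ∀ b ∈ Set.Ioo 0 (1 - α), HasDerivAt (fun b => slyPhi1 d lam α b) (g b) b :=
    fun b hb => hasDerivAt_slyPhi1_right d lam hα hb.1 (by linarith [hb.2])
  have hΦ_cont : Continuous fun b => slyPhi1 d lam α b := continuous_slyPhi1_right d lam α
  refine ⟨βs, hβs0, hβs3, hcrit, ?_, ?_, ?_⟩
  · intro β hβ0 hβ1 hβ
    have hgβ : g β = 0 := (deriv_slyPhi1_right_eq_zero_iff d hd hlam hα hβ0 (by linarith)).2 hβ
    exact hg_anti.injOn ⟨hβ0, hβ1⟩ ⟨hβs0, hβs3⟩ (hgβ.trans hgβs.symm)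
  · refine strictMonoOn_of_deriv_pos (convex_Icc _ _) hΦ_cont.continuousOn fun b hb => ?_
    rw [interior_Icc] at hb
    rw [(hΦ_deriv b ⟨hb.1, by linarith [hb.2]⟩).deriv]
    have := hg_anti ⟨hb.1, (by linarith [hb.2] : b < 1 - α)⟩ ⟨hβs0, hβs3⟩ hb.2
    linarith
  · refine strictAntiOn_of_deriv_neg (convex_Icc _ _) hΦ_cont.continuousOn fun b hb => ?_
    rw [interior_Icc] at hb
    rw [(hΦ_deriv b ⟨by linarith [hb.1], hb.2⟩).deriv]
    have := hg_anti ⟨hβs0, hβs3⟩ ⟨(by linarith [hb.1] : (0 : ℝ) < b), hb.2⟩ hb.1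
    linarith

/-- **The symmetric critical point is a saddle above the threshold.** For `0 < p < 1/2` with
`d·p > 1` (which for the symmetric critical point `p*` means `λ > λ_c(𝕋_d)`,
`inv_lt_slyCritical_symm_iff`), moving mass from one side to the other increases `Φ₁`:
`Φ₁(p, p) < Φ₁(p + t, p - t)` for some `0 < t < p`. Along `t ↦ Φ₁(p+t, p-t)` the derivative is
`log((p-t)/(p+t)) + (d-1) log((1-p+t)/(1-p-t)) ≥ 2t[(d-1)/(1-p+t) - 1/(p-t)] > 0` for
`0 < t < p - 1/d` (`log x ≥ 1 - 1/x`). So for `λ > λ_c` the maximum of `Φ₁` "is not achieved with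
`α = β`" (Sly, proof of Lemma 3.3). [cite: Sly2010, §1.3 (second bullet) and proof of Lemma 3.3 ("the maxima of `Φ₁(α,β)` is not achieved with `α = β`")] -/
theorem slyPhi1_symm_lt_offDiagonal (d : ℕ) (lam : ℝ) {p : ℝ} (hp : 0 < p) (h2p : 2 * p < 1)
    (hdp : 1 < d * p) : ∃ t : ℝ, 0 < t ∧ t < p ∧ slyPhi1 d lam p p < slyPhi1 d lam (p + t) (p - t) := by
  have hd0 : (0 : ℝ) < d := by
    rcases Nat.eq_zero_or_pos d with h | h
    · subst h; simp at hdp; linarith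
    · exact_mod_cast h
  have hpd : 1 / (d : ℝ) < p := by rw [div_lt_iff₀ hd0]; linarith
  set t₀ : ℝ := (p - 1 / d) / 2 with ht₀
  have ht₀0 : 0 < t₀ := by rw [ht₀]; linarith
  have ht₀p : t₀ < p - 1 / d := by rw [ht₀]; linarith
  have hdinv : 0 < 1 / (d : ℝ) := by positivity
  -- the function along the anti-diagonal and its derivative
  set φ : ℝ → ℝ := fun x => x * Real.log x with hφ
  set k : ℝ → ℝ := fun t => slyPhi1 d lam (p + t) (p - t) with hk
  have hk_eq : k = fun t => 2 * p * Real.log lam - d * ((1 - 2 * p) * Real.log (1 - 2 * p)) -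
      φ (p + t) - φ (p - t) + (d - 1) * (φ (1 - (p + t)) + φ (1 - (p - t))) := by
    funext t
    simp only [hk, hφ, slyPhi1, show (1 : ℝ) - (p + t) - (p - t) = 1 - 2 * p by ring]
    ring
  have hk_deriv : ∀ t ∈ Set.Ioo (0 : ℝ) t₀, HasDerivAt k
      (-(Real.log (p + t) + 1) + (Real.log (p - t) + 1) +
        ((d : ℝ) - 1) * (-(Real.log (1 - (p + t)) + 1) + (Real.log (1 - (p - t)) + 1))) t := by
    intro t ht
    have h1 : p + t ≠ 0 := by linarith [ht.1]
    have h2 : p - t ≠ 0 := by linarith [ht.2]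
    have h3 : 1 - (p + t) ≠ 0 := by linarith [ht.2]
    have h4 : 1 - (p - t) ≠ 0 := by linarith [ht.1]
    have ha : HasDerivAt (fun t : ℝ => p + t) 1 t := by simpa using (hasDerivAt_id' t).const_add p
    have hb : HasDerivAt (fun t : ℝ => p - t) (-1) t := by simpa using (hasDerivAt_id' t).const_sub p
    have hc : HasDerivAt (fun t : ℝ => 1 - (p + t)) (-1) t := by
      simpa using ha.const_sub 1
    have hd' : HasDerivAt (fun t : ℝ => 1 - (p - t)) 1 t := by
      simpa using hb.const_sub 1
    have e1 : HasDerivAt (fun t => φ (p + t)) ((Real.log (p + t) + 1) * 1) t :=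
      (Real.hasDerivAt_mul_log h1).comp t ha
    have e2 : HasDerivAt (fun t => φ (p - t)) ((Real.log (p - t) + 1) * -1) t :=
      (Real.hasDerivAt_mul_log h2).comp t hb
    have e3' := (Real.hasDerivAt_mul_log h3).comp t hc
    have e3 : HasDerivAt (fun t => φ (1 - (p + t))) ((Real.log (1 - (p + t)) + 1) * -1) t := e3'
    have e4' := (Real.hasDerivAt_mul_log h4).comp t hd'
    have e4 : HasDerivAt (fun t => φ (1 - (p - t))) ((Real.log (1 - (p - t)) + 1) * 1) t := e4'
    rw [hk_eq]
    have := (((hasDerivAt_const t (2 * p * Real.log lam - d * ((1 - 2 * p) * Real.log (1 - 2 * p)))).fun_sub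
      e1).fun_sub e2).fun_add ((e3.fun_add e4).const_mul ((d : ℝ) - 1))
    exact this.congr_deriv (by ring)
  -- positivity of the derivative on `(0, t₀)`
  have hk_pos : ∀ t ∈ Set.Ioo (0 : ℝ) t₀,
      0 < -(Real.log (p + t) + 1) + (Real.log (p - t) + 1) +
        ((d : ℝ) - 1) * (-(Real.log (1 - (p + t)) + 1) + (Real.log (1 - (p - t)) + 1)) := by
    intro t ht
    have ht0 : 0 < t := ht.1
    have htp : t < p - 1 / d := ht.2.trans ht₀p
    have hpt : 0 < p - t := by linarith
    have hpt' : 0 < p + t := by linarith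
    have hq : 0 < 1 - (p + t) := by linarith
    have hq' : 0 < 1 - (p - t) := by linarith
    -- `log((p-t)/(p+t)) ≥ 1 - (p+t)/(p-t) = -2t/(p-t)`
    have i1 : -(2 * t / (p - t)) ≤ Real.log (p - t) - Real.log (p + t) := by
      have h := Real.one_sub_inv_le_log_of_pos (div_pos hpt hpt')
      rw [Real.log_div hpt.ne' hpt'.ne', inv_div] at h
      have e : 1 - (p + t) / (p - t) = -(2 * t / (p - t)) := by field_simp; ring
      linarith [e]
    -- `log((1-p+t)/(1-p-t)) ≥ 1 - (1-p-t)/(1-p+t) = 2t/(1-p+t)`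
    have i2 : 2 * t / (1 - (p - t)) ≤ Real.log (1 - (p - t)) - Real.log (1 - (p + t)) := by
      have h := Real.one_sub_inv_le_log_of_pos (div_pos hq' hq)
      rw [Real.log_div hq'.ne' hq.ne', inv_div] at h
      have e : 1 - (1 - (p + t)) / (1 - (p - t)) = 2 * t / (1 - (p - t)) := by field_simp; ring
      linarith [e]
    -- `(d-1)·2t/(1-p+t) > 2t/(p-t)` because `d(p-t) > 1`
    have hd1 : (0 : ℝ) ≤ (d : ℝ) - 1 := by
      have : (1 : ℝ) < d * p := hdp
      nlinarith
    have i3 : 2 * t / (p - t) < ((d : ℝ) - 1) * (2 * t / (1 - (p - t))) := by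
      rw [← mul_div_assoc, div_lt_div_iff₀ hpt hq']
      have : 1 < (d : ℝ) * (p - t) := by
        have := (div_lt_iff₀' hd0).1 (show 1 / (d : ℝ) < p - t by linarith)
        linarith
      nlinarith
    nlinarith [mul_le_mul_of_nonneg_left i2 hd1]
  have hk_cont : Continuous k :=
    (continuous_slyPhi1 d lam).comp ((continuous_const.add continuous_id).prodMk
      (continuous_const.sub continuous_id))
  have hmono : StrictMonoOn k (Set.Icc 0 t₀) := by
    refine strictMonoOn_of_deriv_pos (convex_Icc _ _) hk_cont.continuousOn fun t ht => ?_
    rw [interior_Icc] at ht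
    rw [(hk_deriv t ht).deriv]
    exact hk_pos t ht
  refine ⟨t₀, ht₀0, by linarith, ?_⟩
  have := hmono ⟨le_rfl, ht₀0.le⟩ ⟨ht₀0.le, le_rfl⟩ ht₀0
  simpa [hk] using this

/-- **The maxima of `Φ₁` on the triangle** (Sly §1.3, second bullet, after Mossel–Weitz–Wormald
2009 §4 and Dyer–Frieze–Jerrum 2002 Claim 2.2): for `d ≥ 3` and `λ > λ_c(𝕋_d)`, on the closed
triangle `T = {α, β ≥ 0, α + β ≤ 1}` the first-moment exponent `Φ₁` attains its maximum exactly at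
the asymmetric critical points `(p⁺, p⁻)` and `(p⁻, p⁺)` (`0 < p⁻ < p⁺`, `p⁺ + p⁻ < 1`, both critical
equations; the pair of `exists_slyCriticalDensities` / `sly_criticalPoints`). Proof: `Φ₁` is
continuous on the compact `T`, so a maximiser exists; every other point of `T` can be improved —
boundary points and points off the curve `β = h(α)` by maximising the strictly concave section
`Φ₁(α, ·)` on `[0, 1-α]` (`slyPhi1_right_max_Icc`), points off `α = h(β)` symmetrically
(`slyPhi1_comm`), which leaves the three critical points (`sly_criticalPoints`), of which `(p*, p*)` is
a saddle for `λ > λ_c` (`slyPhi1_symm_lt_offDiagonal`, as `p* > 1/d`); and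
`Φ₁(p⁺, p⁻) = Φ₁(p⁻, p⁺)`. In particular "in `{(α,β) ∈ T : α ≥ β}` the function `Φ₁` is maximized at
`(p⁺, p⁻)`" (Sly, proof of Lemma 3.3).
[cite: Sly2010, §1.3 (second bullet: "The points `(p⁺,p⁻)` and `(p⁻,p⁺)` are the maxima of `Φ₁(α,β)` in `T`")] -/
theorem slyPhi1_max_triangle {d : ℕ} (hd : 3 ≤ d) {lam : ℝ} (hlam : hardCoreThreshold d < lam) :
    ∃ pp pm : ℝ, 0 < pm ∧ pm < pp ∧ pp + pm < 1 ∧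
      lam * (1 - pp - pm) ^ d = pp * (1 - pp) ^ (d - 1) ∧
      lam * (1 - pp - pm) ^ d = pm * (1 - pm) ^ (d - 1) ∧
      ∀ α β : ℝ, 0 ≤ α → 0 ≤ β → α + β ≤ 1 →
        slyPhi1 d lam α β ≤ slyPhi1 d lam pp pm ∧
          (slyPhi1 d lam α β = slyPhi1 d lam pp pm ↔ (α = pp ∧ β = pm) ∨ (α = pm ∧ β = pp)) := by
  have hd1 : 1 ≤ d := by omega
  have hd0 : (0 : ℝ) < d := by exact_mod_cast (show 0 < d by omega)
  have hlam0 : 0 < lam := (hardCoreThreshold_pos hd).trans hlam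
  obtain ⟨ps, pp, pm, hpm, h1, h2, hsum, h2ps, hinv, hEs, hEα, hEβ, hclass⟩ :=
    sly_criticalPoints hd hlam
  have hps : 0 < ps := hpm.trans h1
  have hdps : 1 < (d : ℝ) * ps := by
    have := (div_lt_iff₀' hd0).1 hinv
    linarith
  -- the section maximiser, endpoints included
  have hsec : ∀ α : ℝ, 0 ≤ α → α < 1 → ∃ βs : ℝ, 0 < βs ∧ βs < 1 - α ∧
      lam * (1 - α - βs) ^ d = βs * (1 - βs) ^ (d - 1) ∧
      ∀ β : ℝ, 0 ≤ β → β ≤ 1 - α → β ≠ βs → slyPhi1 d lam α β < slyPhi1 d lam α βs := by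
    intro α hα hα1
    obtain ⟨βs, hβs0, hβs1, hE, -, hmono, hanti⟩ := slyPhi1_right_max_Icc d hd1 hlam0 hα hα1
    refine ⟨βs, hβs0, hβs1, hE, fun β hβ0 hβ1 hne => ?_⟩
    rcases lt_or_gt_of_ne hne with h | h
    · exact hmono ⟨hβ0, h.le⟩ ⟨hβs0.le, le_rfl⟩ h
    · exact hanti ⟨le_rfl, hβs1.le⟩ ⟨h.le, hβ1⟩ h
  -- every point of `T` other than `(p⁺,p⁻)`, `(p⁻,p⁺)` can be improved inside `T`
  have improve : ∀ α β : ℝ, 0 ≤ α → 0 ≤ β → α + β ≤ 1 →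
      ¬((α = pp ∧ β = pm) ∨ (α = pm ∧ β = pp)) →
      ∃ α' β' : ℝ, 0 ≤ α' ∧ 0 ≤ β' ∧ α' + β' ≤ 1 ∧ slyPhi1 d lam α β < slyPhi1 d lam α' β' := by
    intro α β hα hβ hαβ hnot
    by_cases hα1 : α < 1
    · obtain ⟨βs, hβs0, hβs1, hEβs, hmax⟩ := hsec α hα hα1
      by_cases hβe : β = βs
      · subst hβe
        by_cases hα0 : α = 0
        · -- `(0, β_0)`: by symmetry it is the endpoint `(β_0, 0)` of the section at `β_0`
          subst hα0
          obtain ⟨βs', hβs'0, hβs'1, -, hmax'⟩ := hsec β hβ (by linarith)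
          refine ⟨β, βs', hβ, hβs'0.le, by linarith, ?_⟩
          rw [slyPhi1_comm d lam 0 β]
          exact hmax' 0 le_rfl (by linarith) (by linarith)
        · -- interior point on the curve `α = h(β)`; test the other critical equation
          have hα0' : 0 < α := lt_of_le_of_ne hα (Ne.symm hα0)
          obtain ⟨αs, hαs0, hαs1, hEαs, hmaxα⟩ := hsec β hβ (by linarith)
          by_cases hαe : α = αs
          · -- both critical equations: one of the three critical points, not asymmetric: `(p*,p*)`
            have hEa : lam * (1 - α - β) ^ d = α * (1 - α) ^ (d - 1) := by
              rw [show (1 : ℝ) - α - β = 1 - β - α by ring, hαe]; exact hEαs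
            rcases (hclass α β hα0' hβs0 (by linarith)).1 ⟨hEa, hEβs⟩ with h | h | ⟨hα', hβ'⟩
            · exact absurd (Or.inl h) hnot
            · exact absurd (Or.inr h) hnot
            · obtain ⟨t, ht0, htp, hlt⟩ := slyPhi1_symm_lt_offDiagonal d lam hps h2ps hdps
              refine ⟨ps + t, ps - t, by linarith, by linarith, by linarith, ?_⟩
              rw [hα', hβ']
              exact hlt
          · -- off the curve `β = h(α)`ᵀ: improve the section `Φ₁(·, β)` (by symmetry)
            refine ⟨αs, β, hαs0.le, hβ, by linarith, ?_⟩
            rw [slyPhi1_comm d lam α β, slyPhi1_comm d lam αs β]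
            exact hmaxα α hα (by linarith) hαe
      · exact ⟨α, βs, hα, hβs0.le, by linarith, hmax β hβ (by linarith) hβe⟩
    · -- the corner `(1, 0) = ` mirror of the endpoint `(0, 1)` of the section at `α = 0`
      have hα1' : α = 1 := le_antisymm (by linarith) (not_lt.1 hα1)
      have hβ0 : β = 0 := by linarith
      obtain ⟨βs, hβs0, hβs1, -, hmax⟩ := hsec 0 le_rfl one_pos
      refine ⟨0, βs, le_rfl, hβs0.le, by linarith, ?_⟩
      rw [hα1', hβ0, slyPhi1_comm d lam 1 0]
      exact hmax 1 zero_le_one (by linarith) (by linarith)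
  -- a maximiser on the compact triangle exists
  set T : Set (ℝ × ℝ) := {q | 0 ≤ q.1 ∧ 0 ≤ q.2 ∧ q.1 + q.2 ≤ 1} with hT
  have hTc : IsCompact T := by
    have hclosed : IsClosed T := by
      rw [hT]
      refine IsClosed.inter (isClosed_le continuous_const continuous_fst) (IsClosed.inter
        (isClosed_le continuous_const continuous_snd)
        (isClosed_le (continuous_fst.add continuous_snd) continuous_const))
    have hsub : T ⊆ Set.Icc (0 : ℝ) 1 ×ˢ Set.Icc (0 : ℝ) 1 := by
      rintro ⟨a, b⟩ ⟨ha, hb, hab⟩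
      exact ⟨⟨ha, by simpa using (by linarith : a ≤ 1)⟩, ⟨hb, by simpa using (by linarith : b ≤ 1)⟩⟩
    exact (isCompact_Icc.prod isCompact_Icc).of_isClosed_subset hclosed hsub
  have hTn : T.Nonempty := ⟨(0, 0), by rw [hT]; exact ⟨le_rfl, le_rfl, by simp⟩⟩
  obtain ⟨⟨α₀, β₀⟩, ⟨hα₀, hβ₀, hαβ₀⟩, hmax₀⟩ :=
    hTc.exists_isMaxOn hTn ((continuous_slyPhi1 d lam).continuousOn)
  -- it is one of the two asymmetric critical points
  have hq₀ : (α₀ = pp ∧ β₀ = pm) ∨ (α₀ = pm ∧ β₀ = pp) := by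
    by_contra h
    obtain ⟨α', β', hα', hβ', hαβ', hlt⟩ := improve α₀ β₀ hα₀ hβ₀ hαβ₀ h
    have key : slyPhi1 d lam α' β' ≤ slyPhi1 d lam α₀ β₀ :=
      hmax₀ (show (α', β') ∈ T from ⟨hα', hβ', hαβ'⟩)
    linarith
  have hV : slyPhi1 d lam α₀ β₀ = slyPhi1 d lam pp pm := by
    rcases hq₀ with ⟨h1', h2'⟩ | ⟨h1', h2'⟩
    · rw [h1', h2']
    · rw [h1', h2', slyPhi1_comm]
  refine ⟨pp, pm, hpm, h1.trans h2, hsum, hEα, hEβ, fun α β hα hβ hαβ => ?_⟩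
  have hle : slyPhi1 d lam α β ≤ slyPhi1 d lam pp pm := by
    have key : slyPhi1 d lam α β ≤ slyPhi1 d lam α₀ β₀ :=
      hmax₀ (show (α, β) ∈ T from ⟨hα, hβ, hαβ⟩)
    linarith
  refine ⟨hle, ⟨fun heq => ?_, ?_⟩⟩
  · by_contra h
    obtain ⟨α', β', hα', hβ', hαβ', hlt⟩ := improve α β hα hβ hαβ h
    have key : slyPhi1 d lam α' β' ≤ slyPhi1 d lam α₀ β₀ :=
      hmax₀ (show (α', β') ∈ T from ⟨hα', hβ', hαβ'⟩)
    linarith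
  · rintro (⟨h1', h2'⟩ | ⟨h1', h2'⟩)
    · rw [h1', h2']
    · rw [h1', h2', slyPhi1_comm]

end GlobalMax

/-! ### The power-law gap of `Φ₁` at its maxima (Sly, proof of Lemma 3.3)

"Clearly … the functions `Φ₁(α, h(α))` (resp. `Φ₁(h(β), β)`) are analytic in `α` (resp. `β`) when in a
neighbourhood of `p⁺` (resp. `p⁻`). It follows by expanding as a Taylor series and noting that
`(p⁺, p⁻)` is a local maxima that for some integer `ℓ ≥ 2` and constants `C, ε > 0` we have that
`|Φ₁(α, h(α)) - Φ₁(p⁺, p⁻)| ≥ C|α - p⁺|^ℓ` when `|α - p⁺| ≤ ε` … This of course implies that when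
`‖(α,β) - (p⁺,p⁻)‖_∞ ≤ ε` then `|Φ₁(α,β) - Φ₁(p⁺,p⁻)| ≥ C‖(α,β) - (p⁺,p⁻)‖_∞^ℓ`." The finite order
`ℓ` comes from the isolated-zeros principle for the real-analytic `a ↦ Φ₁(p⁺,p⁻) - Φ₁(a, h(a))`,
which is nonnegative near `p^{±}` and not identically zero there because the maximisers are the two
isolated points `(p^{±}, p^{∓})`; the transfer to the triangle maximises the strictly concave sections
`Φ₁(h(a), ·)` and inverts `h` locally (it is strictly decreasing and locally Lipschitz). -/

section PowerLawGap

open Filter Topology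

/-- **A nonnegative analytic function, not locally zero, vanishes to finite order**: if `f` is
analytic at `x₀`, `f x₀ = 0`, `f ≥ 0` near `x₀` and `f` is not identically zero near `x₀`, then
`f x ≥ c |x - x₀|^ℓ` near `x₀` for some `ℓ ∈ ℕ`, `c > 0` (write `f = (x - x₀)^ℓ g` with `g(x₀) ≠ 0`).
This is the step "by expanding as a Taylor series and noting that `(p⁺,p⁻)` is a local maxima … for
some integer `ℓ ≥ 2` and constants `C, ε > 0`" of Sly's proof of Lemma 3.3. [folklore] -/
theorem exists_pow_le_of_analyticAt_of_nonneg {f : ℝ → ℝ} {x₀ : ℝ} (hf : AnalyticAt ℝ f x₀)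
    (hpos : ∀ᶠ x in 𝓝 x₀, 0 ≤ f x) (hne : ¬∀ᶠ x in 𝓝 x₀, f x = 0) :
    ∃ (ℓ : ℕ) (c : ℝ), 0 < c ∧ ∀ᶠ x in 𝓝 x₀, c * |x - x₀| ^ ℓ ≤ f x := by
  obtain ⟨n, g, hg, hg0, hfg⟩ := hf.exists_eventuallyEq_pow_smul_nonzero_iff.2 hne
  have hgc : ContinuousAt g x₀ := hg.continuousAt
  have hg_near : ∀ᶠ x in 𝓝 x₀, |g x₀| / 2 ≤ |g x| := by
    have h1 : ∀ᶠ x in 𝓝 x₀, dist (g x) (g x₀) < |g x₀| / 2 :=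
      hgc.eventually (Metric.ball_mem_nhds _ (by positivity))
    filter_upwards [h1] with x hx
    rw [Real.dist_eq] at hx
    have := abs_sub_abs_le_abs_sub (g x₀) (g x)
    rw [abs_sub_comm] at this
    linarith
  refine ⟨n, |g x₀| / 2, by positivity, ?_⟩
  filter_upwards [hfg, hg_near, hpos] with x hx hgx hfx
  rw [hx, smul_eq_mul] at hfx ⊢
  have habs : |(x - x₀) ^ n * g x| = |x - x₀| ^ n * |g x| := by rw [abs_mul, abs_pow]
  rw [← abs_of_nonneg hfx, habs, mul_comm]
  exact mul_le_mul_of_nonneg_left hgx (by positivity)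

/-- DFJ's `h` is real-analytic on `(0, 1)` (for `λ > 0`): there `x/(λ(1-x)) > 0` and
`t^{1/d} = exp(log t / d)`. [folklore] -/
theorem analyticAt_dfjH (d : ℕ) {lam a : ℝ} (hlam : 0 < lam) (ha0 : 0 < a) (ha1 : a < 1) :
    AnalyticAt ℝ (dfjH d lam) a := by
  have hb : ∀ᶠ x in 𝓝 a, 0 < x / (lam * (1 - x)) := by
    have h1 : ∀ᶠ x in 𝓝 a, x ∈ Set.Ioo 0 1 := Ioo_mem_nhds ha0 ha1
    filter_upwards [h1] with x hx
    exact div_pos hx.1 (mul_pos hlam (by linarith [hx.2]))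
  have hbase : AnalyticAt ℝ (fun x : ℝ => x / (lam * (1 - x))) a :=
    analyticAt_id.fun_div (analyticAt_const.fun_mul (analyticAt_const.fun_sub analyticAt_id))
      (mul_pos hlam (by linarith)).ne'
  have hexp : AnalyticAt ℝ (fun x : ℝ => (1 - x) *
      (1 - Real.exp (Real.log (x / (lam * (1 - x))) * (d : ℝ)⁻¹))) a :=
    (analyticAt_const.fun_sub analyticAt_id).fun_mul (analyticAt_const.fun_sub
      (((hbase.log (div_pos ha0 (mul_pos hlam (by linarith)))).fun_mul analyticAt_const).rexp'))
  refine hexp.congr ?_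
  filter_upwards [hb] with x hx
  rw [dfjH_def, Real.rpow_def_of_pos hx]

/-- The first-moment exponent along DFJ's curve, `x ↦ Φ₁(x, h(x))`, is real-analytic at every
`a ∈ (0,1)` with `h(a) > 0`, `a + h(a) < 1` ("Clearly … the functions `Φ₁(α, h(α))` … are analytic
in `α` … in a neighbourhood of `p⁺`", Sly, proof of Lemma 3.3). [cite: Sly2010, proof of Lemma 3.3] -/
theorem analyticAt_slyPhi1_dfjH (d : ℕ) {lam a : ℝ} (hlam : 0 < lam) (ha0 : 0 < a)
    (hha : 0 < dfjH d lam a) (hsum : a + dfjH d lam a < 1) :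
    AnalyticAt ℝ (fun x => slyPhi1 d lam x (dfjH d lam x)) a := by
  have ha1 : a < 1 := by linarith
  have hh : AnalyticAt ℝ (dfjH d lam) a := analyticAt_dfjH d hlam ha0 ha1
  have hh' : AnalyticAt ℝ (fun x => dfjH d lam x) a := hh
  have hid : AnalyticAt ℝ (fun x : ℝ => x) a := analyticAt_id
  have hu : AnalyticAt ℝ (fun x : ℝ => 1 - x - dfjH d lam x) a :=
    (analyticAt_const.fun_sub hid).fun_sub hh'
  have h1x : AnalyticAt ℝ (fun x : ℝ => 1 - x) a := analyticAt_const.fun_sub hid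
  have h1h : AnalyticAt ℝ (fun x : ℝ => 1 - dfjH d lam x) a := analyticAt_const.fun_sub hh'
  have e : (fun x => slyPhi1 d lam x (dfjH d lam x)) = fun x =>
      (x + dfjH d lam x) * Real.log lam - x * Real.log x -
        dfjH d lam x * Real.log (dfjH d lam x) -
        d * (1 - x - dfjH d lam x) * Real.log (1 - x - dfjH d lam x) +
        (d - 1) * ((1 - x) * Real.log (1 - x) + (1 - dfjH d lam x) * Real.log (1 - dfjH d lam x)) := by
    funext x; rfl
  rw [e]
  exact ((((hid.fun_add hh').fun_mul analyticAt_const).fun_sub (hid.fun_mul (hid.log ha0))).fun_sub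
    (hh'.fun_mul (hh'.log hha))).fun_sub ((analyticAt_const.fun_mul hu).fun_mul (hu.log (by linarith)))
    |>.fun_add (analyticAt_const.fun_mul ((h1x.fun_mul (h1x.log (by linarith))).fun_add
      (h1h.fun_mul (h1h.log (by linarith)))))

/-- Where `h > 0` on `(0,1)` one has `x/(λ(1-x)) < 1`, i.e. `x < λ/(1+λ)`. [folklore] -/
theorem lt_div_of_dfjH_pos (d : ℕ) {lam x : ℝ} (hlam : 0 < lam) (hx0 : 0 < x) (hx1 : x < 1)
    (hh : 0 < dfjH d lam x) : x < lam / (1 + lam) := by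
  rw [dfjH_def] at hh
  have h1 : 0 < 1 - (x / (lam * (1 - x))) ^ ((d : ℝ)⁻¹) :=
    (mul_pos_iff_of_pos_left (by linarith)).1 hh
  have hb : x / (lam * (1 - x)) < 1 := by
    by_contra h
    push Not at h
    have : (1 : ℝ) ≤ (x / (lam * (1 - x))) ^ ((d : ℝ)⁻¹) := Real.one_le_rpow h (by positivity)
    linarith
  rw [div_lt_one (mul_pos hlam (by linarith))] at hb
  rw [lt_div_iff₀ (by linarith)]
  linarith

/-- DFJ's `h` is strictly decreasing on `(0, λ/(1+λ))` (both factors `1 - x` and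
`1 - (x/(λ(1-x)))^{1/d}` are positive and decreasing there). [cite: Sly2010, §1.3 (the function `h`)] -/
theorem dfjH_strictAntiOn (d : ℕ) (hd : 1 ≤ d) {lam : ℝ} (hlam : 0 < lam) :
    StrictAntiOn (dfjH d lam) (Set.Ioo 0 (lam / (1 + lam))) := by
  intro x hx y hy hxy
  have hlt1 : lam / (1 + lam) < 1 := by rw [div_lt_one (by linarith)]; linarith
  have hx1 : x < 1 := hx.2.trans hlt1
  have hy1 : y < 1 := hy.2.trans hlt1
  have hbx : 0 ≤ x / (lam * (1 - x)) := div_nonneg hx.1.le (mul_pos hlam (by linarith)).le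
  have hby1 : y / (lam * (1 - y)) < 1 := by
    rw [div_lt_one (mul_pos hlam (by linarith))]
    have := hy.2
    rw [lt_div_iff₀ (by linarith)] at this
    linarith
  have hbxy : x / (lam * (1 - x)) < y / (lam * (1 - y)) := by
    rw [div_lt_div_iff₀ (mul_pos hlam (by linarith)) (mul_pos hlam (by linarith))]
    nlinarith
  have hd' : (0 : ℝ) < (d : ℝ)⁻¹ := by
    have : (0 : ℝ) < d := by exact_mod_cast hd
    positivity
  have hr : (x / (lam * (1 - x))) ^ ((d : ℝ)⁻¹) < (y / (lam * (1 - y))) ^ ((d : ℝ)⁻¹) :=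
    Real.rpow_lt_rpow hbx hbxy hd'
  have hr1 : (y / (lam * (1 - y))) ^ ((d : ℝ)⁻¹) < 1 :=
    Real.rpow_lt_one (div_nonneg hy.1.le (mul_pos hlam (by linarith)).le) hby1 hd'
  show dfjH d lam y < dfjH d lam x
  rw [dfjH_def, dfjH_def]
  nlinarith [mul_pos (sub_pos.2 hxy) (sub_pos.2 (hr.trans hr1)), mul_pos (sub_pos.2 hy1) (sub_pos.2 hr)]

/-- **Local inverse of `h` with a Lipschitz bound.** For `0 < p < λ/(1+λ)` and `δ > 0`: every `z`
close enough to `h(p)` is `h(a)` for some `a` with `|a - p| < δ`, and `|z - h(p)| ≤ L |a - p|`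
(`h` is continuous, strictly decreasing and locally Lipschitz there — it is analytic). [folklore] -/
theorem dfjH_local_inverse (d : ℕ) (hd : 1 ≤ d) {lam p : ℝ} (hlam : 0 < lam) (hp0 : 0 < p)
    (hp1 : p < lam / (1 + lam)) {δ : ℝ} (hδ : 0 < δ) :
    ∃ L ε : ℝ, 0 < L ∧ 0 < ε ∧ ∀ z : ℝ, |z - dfjH d lam p| ≤ ε →
      ∃ a : ℝ, |a - p| < δ ∧ dfjH d lam a = z ∧ |z - dfjH d lam p| ≤ L * |a - p| := by
  have hlt1 : lam / (1 + lam) < 1 := by rw [div_lt_one (by linarith)]; linarith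
  have hp1' : p < 1 := hp1.trans hlt1
  -- local Lipschitz bound from analyticity
  obtain ⟨K, t, ht, hK⟩ :=
    ((analyticAt_dfjH d hlam hp0 hp1').contDiffAt (n := 1)).exists_lipschitzOnWith
  obtain ⟨r, hr0, hrt⟩ := Metric.mem_nhds_iff.1 ht
  -- a radius keeping us inside `(0, λ/(1+λ))`, the Lipschitz ball and `δ`
  set δ₁ : ℝ := min (δ / 2) (min (r / 2) (min (p / 2) ((lam / (1 + lam) - p) / 2))) with hδ₁
  have hδ₁0 : 0 < δ₁ := by
    rw [hδ₁]
    refine lt_min (by linarith) (lt_min (by linarith) (lt_min (by linarith) (by linarith)))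
  have hδ₁δ : δ₁ ≤ δ / 2 := min_le_left _ _
  have hδ₁r : δ₁ ≤ r / 2 := (min_le_right _ _).trans (min_le_left _ _)
  have hδ₁p : δ₁ ≤ p / 2 := ((min_le_right _ _).trans (min_le_right _ _)).trans (min_le_left _ _)
  have hδ₁q : δ₁ ≤ (lam / (1 + lam) - p) / 2 :=
    ((min_le_right _ _).trans (min_le_right _ _)).trans (min_le_right _ _)
  have hanti := dfjH_strictAntiOn d hd hlam
  have hmemI : ∀ a : ℝ, |a - p| ≤ δ₁ → a ∈ Set.Ioo 0 (lam / (1 + lam)) := by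
    intro a ha
    rw [abs_le] at ha
    exact ⟨by linarith [ha.1], by linarith [ha.2]⟩
  have hlo : dfjH d lam p < dfjH d lam (p - δ₁) :=
    hanti (hmemI (p - δ₁) (by rw [show p - δ₁ - p = -δ₁ by ring, abs_neg, abs_of_pos hδ₁0]))
      (hmemI p (by simp [hδ₁0.le])) (by linarith)
  have hhi : dfjH d lam (p + δ₁) < dfjH d lam p :=
    hanti (hmemI p (by simp [hδ₁0.le]))
      (hmemI (p + δ₁) (by rw [show p + δ₁ - p = δ₁ by ring, abs_of_pos hδ₁0])) (by linarith)
  set ε : ℝ := min (dfjH d lam (p - δ₁) - dfjH d lam p) (dfjH d lam p - dfjH d lam (p + δ₁)) with hε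
  have hε0 : 0 < ε := lt_min (by linarith) (by linarith)
  -- continuity on `[p - δ₁, p + δ₁]`
  have hcont : ContinuousOn (dfjH d lam) (Set.Icc (p - δ₁) (p + δ₁)) := by
    intro a ha
    have ha' : a ∈ Set.Ioo 0 (lam / (1 + lam)) :=
      hmemI a (abs_le.2 ⟨by linarith [ha.1], by linarith [ha.2]⟩)
    exact (analyticAt_dfjH d hlam ha'.1 (ha'.2.trans hlt1)).continuousAt.continuousWithinAt
  refine ⟨(K : ℝ) + 1, ε, by positivity, hε0, fun z hz => ?_⟩
  -- intermediate value theorem on the decreasing `h`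
  have hzI : z ∈ Set.Icc (dfjH d lam (p + δ₁)) (dfjH d lam (p - δ₁)) := by
    rw [abs_le] at hz
    constructor
    · linarith [min_le_right (dfjH d lam (p - δ₁) - dfjH d lam p) (dfjH d lam p - dfjH d lam (p + δ₁))]
    · linarith [min_le_left (dfjH d lam (p - δ₁) - dfjH d lam p) (dfjH d lam p - dfjH d lam (p + δ₁))]
  obtain ⟨a, ha, haz⟩ := intermediate_value_Icc' (by linarith : p - δ₁ ≤ p + δ₁) hcont hzI
  have hap : |a - p| ≤ δ₁ := abs_le.2 ⟨by linarith [ha.1], by linarith [ha.2]⟩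
  refine ⟨a, by linarith, haz, ?_⟩
  -- Lipschitz estimate inside the ball `B(p, r) ⊆ t`
  have hat : a ∈ t := hrt (by rw [Metric.mem_ball, Real.dist_eq]; linarith)
  have hpt : p ∈ t := hrt (Metric.mem_ball_self hr0)
  have hlip := hK.dist_le_mul a hat p hpt
  rw [Real.dist_eq, Real.dist_eq, haz] at hlip
  have habs : 0 ≤ |a - p| := abs_nonneg _
  nlinarith [hlip]

/-- **The gap along DFJ's curve.** Let `p ∈ (0,1)` with `q = h(p) > 0`, `p + q < 1`, and suppose
`K(a) = Φ₁(a, h(a))` satisfies `K ≤ M` near `p` and is not identically `M` near `p` (at the maxima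
`K(p) = M`). Then for `z` close to `q` there is `a` close to `p` with `h(a) = z` and
`K(a) + C |z - q|^ℓ ≤ M` (analyticity of `K` gives `M - K(a) ≥ c|a - p|^ℓ`,
`exists_pow_le_of_analyticAt_of_nonneg`; the local inverse of `h` gives `|z - q| ≤ L|a - p|`,
`dfjH_local_inverse`). [cite: Sly2010, proof of Lemma 3.3 ("for some integer `ℓ ≥ 2` and constants `C, ε > 0` we have that `|Φ₁(α,h(α)) - Φ₁(p⁺,p⁻)| ≥ C|α - p⁺|^ℓ`")] -/
theorem slyPhi1_curve_gap (d : ℕ) (hd : 1 ≤ d) {lam p M : ℝ} (hlam : 0 < lam) (hp0 : 0 < p)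
    (hq0 : 0 < dfjH d lam p) (hpq : p + dfjH d lam p < 1)
    (hle : ∀ᶠ a in 𝓝 p, slyPhi1 d lam a (dfjH d lam a) ≤ M)
    (hne : ¬∀ᶠ a in 𝓝 p, slyPhi1 d lam a (dfjH d lam a) = M) :
    ∃ (ℓ : ℕ) (C ε : ℝ), 0 < C ∧ 0 < ε ∧ ∀ z : ℝ, |z - dfjH d lam p| ≤ ε →
      ∃ a : ℝ, 0 < a ∧ 0 < dfjH d lam a ∧ a + dfjH d lam a < 1 ∧ dfjH d lam a = z ∧
        slyPhi1 d lam a (dfjH d lam a) + C * |z - dfjH d lam p| ^ ℓ ≤ M := by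
  have hp1 : p < 1 := by linarith
  have hK : AnalyticAt ℝ (fun x => slyPhi1 d lam x (dfjH d lam x)) p :=
    analyticAt_slyPhi1_dfjH d hlam hp0 hq0 hpq
  have hf : AnalyticAt ℝ (fun x => M - slyPhi1 d lam x (dfjH d lam x)) p := analyticAt_const.fun_sub hK
  have hpos : ∀ᶠ x in 𝓝 p, 0 ≤ M - slyPhi1 d lam x (dfjH d lam x) := by
    filter_upwards [hle] with x hx
    linarith
  have hne' : ¬∀ᶠ x in 𝓝 p, M - slyPhi1 d lam x (dfjH d lam x) = 0 := by
    intro h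
    apply hne
    filter_upwards [h] with x hx
    linarith
  obtain ⟨ℓ, c, hc, hgap⟩ := exists_pow_le_of_analyticAt_of_nonneg hf hpos hne'
  -- side conditions hold near `p`, by continuity of `h`
  have hcont : ContinuousAt (dfjH d lam) p := (analyticAt_dfjH d hlam hp0 hp1).continuousAt
  have hside : ∀ᶠ a in 𝓝 p, 0 < a ∧ 0 < dfjH d lam a ∧ a + dfjH d lam a < 1 := by
    have h1 : ∀ᶠ a in 𝓝 p, 0 < a := lt_mem_nhds hp0
    have h2 : ∀ᶠ a in 𝓝 p, 0 < dfjH d lam a := hcont.eventually (lt_mem_nhds hq0)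
    have h3 : ∀ᶠ a in 𝓝 p, a + dfjH d lam a < 1 :=
      (continuousAt_id.add hcont).eventually (gt_mem_nhds hpq)
    exact h1.and (h2.and h3)
  obtain ⟨δ, hδ0, hδ⟩ := Metric.eventually_nhds_iff.1 (hgap.and hside)
  have hpl : p < lam / (1 + lam) := lt_div_of_dfjH_pos d hlam hp0 hp1 hq0
  obtain ⟨L, ε, hL, hε, hinv⟩ := dfjH_local_inverse d hd hlam hp0 hpl hδ0
  refine ⟨ℓ, c / L ^ ℓ, ε, by positivity, hε, fun z hz => ?_⟩
  obtain ⟨a, hap, haz, hzL⟩ := hinv z hz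
  have ha := hδ (by rw [Real.dist_eq]; exact hap)
  obtain ⟨hga, ha0, hha0, hsum⟩ := ha
  refine ⟨a, ha0, hha0, hsum, haz, ?_⟩
  -- `c/L^ℓ |z - q|^ℓ ≤ c |a - p|^ℓ ≤ M - K(a)`
  have h1 : |z - dfjH d lam p| ^ ℓ ≤ (L * |a - p|) ^ ℓ :=
    pow_le_pow_left₀ (abs_nonneg _) hzL ℓ
  have h2 : c / L ^ ℓ * |z - dfjH d lam p| ^ ℓ ≤ c * |a - p| ^ ℓ := by
    rw [mul_pow] at h1
    rw [div_mul_eq_mul_div, div_le_iff₀ (by positivity)]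
    calc c * |z - dfjH d lam p| ^ ℓ ≤ c * (L ^ ℓ * |a - p| ^ ℓ) :=
          mul_le_mul_of_nonneg_left h1 hc.le
      _ = c * |a - p| ^ ℓ * L ^ ℓ := by ring
  linarith

/-- **Maximum of the section `Φ₁(h(a), ·)` is at `a`** (for `a ∈ (0,1)` with `h(a) ≥ 0`,
`a + h(a) < 1`): the critical equation `∂_β Φ₁(h(a), β) = 0` holds at `β = a` by the very definition
of `h` (`slyPhi1_critical_iff_eq_dfjH`), and the section is maximised at its unique critical point
(`slyPhi1_right_max_Icc`). [cite: Sly2010, §1.3 (after DFJ02 Claim 2.2)] -/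
theorem slyPhi1_dfjH_section_le (d : ℕ) (hd : 1 ≤ d) {lam a : ℝ} (hlam : 0 < lam) (ha0 : 0 < a)
    (hha : 0 ≤ dfjH d lam a) (hsum : a + dfjH d lam a < 1) {y : ℝ} (hy0 : 0 ≤ y)
    (hy1 : y ≤ 1 - dfjH d lam a) :
    slyPhi1 d lam (dfjH d lam a) y ≤ slyPhi1 d lam (dfjH d lam a) a := by
  obtain ⟨βs, hβs0, hβs1, -, huniq, hmono, hanti⟩ :=
    slyPhi1_right_max_Icc d hd hlam hha (by linarith)
  have hE : lam * (1 - dfjH d lam a - a) ^ d = a * (1 - a) ^ (d - 1) :=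
    (slyPhi1_critical_iff_eq_dfjH d hd hlam hha ha0 (by linarith)).2 rfl
  have haβ : a = βs := huniq a ha0 (by linarith) hE
  subst haβ
  rcases le_total y a with h | h
  · exact hmono.monotoneOn ⟨hy0, h⟩ ⟨ha0.le, le_rfl⟩ h
  · exact hanti.antitoneOn ⟨le_rfl, by linarith⟩ ⟨h, hy1⟩ h

/-- **The maxima of `Φ₁`, in input form**: any asymmetric critical point `(p⁺, p⁻)` (with
`0 < p⁻ < p⁺`, `p⁺ + p⁻ < 1`) of `Φ₁` is one of its two maximisers on the closed triangle, for
`λ > λ_c(𝕋_d)`, `d ≥ 3` (`slyPhi1_max_triangle` + uniqueness of the asymmetric critical point,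
`slyCritical_asymm_unique`). [cite: Sly2010, §1.3 (second bullet)] -/
theorem slyPhi1_le_of_critical {d : ℕ} (hd : 3 ≤ d) {lam pp pm : ℝ} (hlam : hardCoreThreshold d < lam)
    (hpm : 0 < pm) (hlt : pm < pp) (hsum : pp + pm < 1)
    (hEα : lam * (1 - pp - pm) ^ d = pp * (1 - pp) ^ (d - 1))
    (hEβ : lam * (1 - pp - pm) ^ d = pm * (1 - pm) ^ (d - 1)) :
    ∀ α β : ℝ, 0 ≤ α → 0 ≤ β → α + β ≤ 1 →
      slyPhi1 d lam α β ≤ slyPhi1 d lam pp pm ∧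
        (slyPhi1 d lam α β = slyPhi1 d lam pp pm ↔ (α = pp ∧ β = pm) ∨ (α = pm ∧ β = pp)) := by
  obtain ⟨pp', pm', hpm', hlt', hsum', hEα', hEβ', hmax⟩ := slyPhi1_max_triangle hd hlam
  obtain ⟨e1, e2⟩ := slyCritical_asymm_unique hd hpm hlt hsum hEα hEβ hpm' hlt' hsum' hEα' hEβ'
  subst e1 e2
  exact hmax

/-- **The local power-law gap of `Φ₁` at its maximum** (Sly, proof of Lemma 3.3): for `d ≥ 3`,
`λ > λ_c(𝕋_d)` and the asymmetric critical point `(p⁺, p⁻)`, there are `ℓ ∈ ℕ` and `C, ε > 0` with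
`Φ₁(α, β) ≤ Φ₁(p⁺, p⁻) - C ‖(α,β) - (p⁺,p⁻)‖_∞^ℓ` for all `(α, β)` in the triangle with
`‖(α,β) - (p⁺,p⁻)‖_∞ ≤ ε` ("when `‖(α,β)-(p⁺,p⁻)‖_∞ ≤ ε` then
`|Φ₁(α,β) - Φ₁(p⁺,p⁻)| ≥ C‖(α,β) - (p⁺,p⁻)‖_∞^ℓ`"). Proof: the gap along DFJ's curve at `p⁺` and at
`p⁻` (`slyPhi1_curve_gap`: analyticity and finite order of vanishing — the curve `a ↦ Φ₁(a, h(a))` is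
not constant near `p^{±}` because the maximisers are isolated), transferred to the triangle by
maximising the sections `Φ₁(h(a), ·)` (`slyPhi1_dfjH_section_le`) and the symmetry of `Φ₁`.
[cite: Sly2010, proof of Lemma 3.3 (the displays with `C|α - p⁺|^ℓ` and `C‖(α,β) - (p⁺,p⁻)‖_∞^ℓ`)] -/
theorem slyPhi1_local_gap {d : ℕ} (hd : 3 ≤ d) {lam pp pm : ℝ} (hlam : hardCoreThreshold d < lam)
    (hpm : 0 < pm) (hlt : pm < pp) (hsum : pp + pm < 1)
    (hEα : lam * (1 - pp - pm) ^ d = pp * (1 - pp) ^ (d - 1))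
    (hEβ : lam * (1 - pp - pm) ^ d = pm * (1 - pm) ^ (d - 1)) :
    ∃ (ℓ : ℕ) (C ε : ℝ), 0 < C ∧ 0 < ε ∧ ∀ α β : ℝ, 0 ≤ α → 0 ≤ β → α + β ≤ 1 →
      |α - pp| ≤ ε → |β - pm| ≤ ε →
        slyPhi1 d lam α β + C * max |α - pp| |β - pm| ^ ℓ ≤ slyPhi1 d lam pp pm := by
  have hd1 : 1 ≤ d := by omega
  have hlam0 : 0 < lam := (hardCoreThreshold_pos hd).trans hlam
  have hpp1 : pp < 1 := by linarith
  have hpm1 : pm < 1 := by linarith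
  set M : ℝ := slyPhi1 d lam pp pm with hM
  have hmax := slyPhi1_le_of_critical hd hlam hpm hlt hsum hEα hEβ
  -- `h(p⁻) = p⁺` and `h(p⁺) = p⁻`
  have hhm : dfjH d lam pm = pp :=
    ((slyPhi1_critical_iff_eq_dfjH d hd1 hlam0 (hpm.trans hlt).le hpm hsum).1 hEβ).symm
  have hhp : dfjH d lam pp = pm := by
    have hEα' : lam * (1 - pm - pp) ^ d = pp * (1 - pp) ^ (d - 1) := by
      rw [show (1 : ℝ) - pm - pp = 1 - pp - pm by ring]; exact hEα
    exact ((slyPhi1_critical_iff_eq_dfjH d hd1 hlam0 hpm.le (hpm.trans hlt) (by linarith)).1 hEα').symm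
  -- the curve `K(a) = Φ₁(a, h(a))` stays `≤ M` near `p⁺` and near `p⁻` …
  have hK_le : ∀ p : ℝ, 0 < p → p < 1 → 0 < dfjH d lam p → p + dfjH d lam p < 1 →
      ∀ᶠ a in 𝓝 p, slyPhi1 d lam a (dfjH d lam a) ≤ M := by
    intro p hp0 hp1 hq0 hpq
    have hcont : ContinuousAt (dfjH d lam) p := (analyticAt_dfjH d hlam0 hp0 hp1).continuousAt
    have h1 : ∀ᶠ a in 𝓝 p, 0 < a := lt_mem_nhds hp0
    have h2 : ∀ᶠ a in 𝓝 p, 0 < dfjH d lam a := hcont.eventually (lt_mem_nhds hq0)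
    have h3 : ∀ᶠ a in 𝓝 p, a + dfjH d lam a < 1 :=
      (continuousAt_id.add hcont).eventually (gt_mem_nhds hpq)
    filter_upwards [h1, h2, h3] with a ha1 ha2 ha3
    exact (hmax a (dfjH d lam a) ha1.le ha2.le ha3.le).1
  -- … and is not constant there (the maximisers are the two isolated points)
  have hK_ne : ∀ p : ℝ, 0 < p → p < 1 → 0 < dfjH d lam p → p + dfjH d lam p < 1 →
      (p = pp ∨ p = pm) → ¬∀ᶠ a in 𝓝 p, slyPhi1 d lam a (dfjH d lam a) = M := by
    intro p hp0 hp1 hq0 hpq hp hev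
    have hcont : ContinuousAt (dfjH d lam) p := (analyticAt_dfjH d hlam0 hp0 hp1).continuousAt
    have h1 : ∀ᶠ a in 𝓝 p, 0 < a := lt_mem_nhds hp0
    have h2 : ∀ᶠ a in 𝓝 p, 0 < dfjH d lam a := hcont.eventually (lt_mem_nhds hq0)
    have h3 : ∀ᶠ a in 𝓝 p, a + dfjH d lam a < 1 :=
      (continuousAt_id.add hcont).eventually (gt_mem_nhds hpq)
    have h4 : ∀ᶠ a in 𝓝 p, dist a p < pp - pm := Metric.ball_mem_nhds p (by linarith)
    have hall := (((hev.and h1).and (h2.and h3)).and h4).filter_mono (nhdsWithin_le_nhds (s := {p}ᶜ))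
    obtain ⟨a, ⟨⟨⟨haM, ha1⟩, ha2, ha3⟩, ha4⟩, hane⟩ := (hall.and self_mem_nhdsWithin).exists
    rw [Real.dist_eq] at ha4
    have hne : a ≠ p := hane
    rcases (hmax a (dfjH d lam a) ha1.le ha2.le ha3.le).2.1 haM with ⟨h1', -⟩ | ⟨h1', -⟩
    · rcases hp with rfl | rfl
      · exact hne h1'
      · rw [h1', abs_of_pos (by linarith)] at ha4; linarith
    · rcases hp with rfl | rfl
      · rw [h1', abs_of_neg (by linarith)] at ha4; linarith
      · exact hne h1'
  -- the curve gap at `p⁺` (inverting `h` near `p⁺`, `h(p⁺) = p⁻`) and at `p⁻`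
  have hq_pp : 0 < dfjH d lam pp := by rw [hhp]; exact hpm
  have hq_pm : 0 < dfjH d lam pm := by rw [hhm]; exact hpm.trans hlt
  have hs_pp : pp + dfjH d lam pp < 1 := by rw [hhp]; exact hsum
  have hs_pm : pm + dfjH d lam pm < 1 := by rw [hhm]; linarith
  obtain ⟨ℓ₁, C₁, ε₁, hC₁, hε₁, hgap₁⟩ := slyPhi1_curve_gap d hd1 hlam0 (hpm.trans hlt) hq_pp hs_pp
    (hK_le pp (hpm.trans hlt) hpp1 hq_pp hs_pp)
    (hK_ne pp (hpm.trans hlt) hpp1 hq_pp hs_pp (Or.inl rfl))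
  obtain ⟨ℓ₂, C₂, ε₂, hC₂, hε₂, hgap₂⟩ := slyPhi1_curve_gap d hd1 hlam0 hpm hq_pm hs_pm
    (hK_le pm hpm hpm1 hq_pm hs_pm) (hK_ne pm hpm hpm1 hq_pm hs_pm (Or.inr rfl))
  rw [hhp] at hgap₁
  rw [hhm] at hgap₂
  refine ⟨max ℓ₁ ℓ₂, min C₁ C₂, min (min ε₁ ε₂) 1, lt_min hC₁ hC₂,
    lt_min (lt_min hε₁ hε₂) zero_lt_one, fun α β hα hβ hαβ hαe hβe => ?_⟩
  have hαe₂ : |α - pp| ≤ ε₂ := hαe.trans ((min_le_left _ _).trans (min_le_right _ _))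
  have hβe₁ : |β - pm| ≤ ε₁ := hβe.trans ((min_le_left _ _).trans (min_le_left _ _))
  have hα1 : |α - pp| ≤ 1 := hαe.trans (min_le_right _ _)
  have hβ1 : |β - pm| ≤ 1 := hβe.trans (min_le_right _ _)
  -- the `β`-direction: `Φ₁(α,β) = Φ₁(h(a), α) ≤ Φ₁(h(a), a) = K(a)` with `h(a) = β`, `a` near `p⁺`
  obtain ⟨a, ha0, hha0, has, haz, hKa⟩ := hgap₁ β hβe₁
  have hβdir : slyPhi1 d lam α β + C₁ * |β - pm| ^ ℓ₁ ≤ M := by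
    have h1 : slyPhi1 d lam α β ≤ slyPhi1 d lam a (dfjH d lam a) := by
      rw [slyPhi1_comm d lam α β, slyPhi1_comm d lam a, ← haz]
      exact slyPhi1_dfjH_section_le d hd1 hlam0 ha0 hha0.le has hα (by rw [haz]; linarith)
    linarith
  -- the `α`-direction: `Φ₁(α,β) = Φ₁(h(b), β) ≤ Φ₁(h(b), b) = K(b)` with `h(b) = α`, `b` near `p⁻`
  obtain ⟨b, hb0, hhb0, hbs, hbz, hKb⟩ := hgap₂ α hαe₂
  have hαdir : slyPhi1 d lam α β + C₂ * |α - pp| ^ ℓ₂ ≤ M := by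
    have h1 : slyPhi1 d lam α β ≤ slyPhi1 d lam b (dfjH d lam b) := by
      rw [slyPhi1_comm d lam b, ← hbz]
      exact slyPhi1_dfjH_section_le d hd1 hlam0 hb0 hhb0.le hbs hβ (by rw [hbz]; linarith)
    linarith
  -- combine
  rcases le_total |α - pp| |β - pm| with h | h
  · rw [max_eq_right h]
    have hp1 : |β - pm| ^ max ℓ₁ ℓ₂ ≤ |β - pm| ^ ℓ₁ :=
      pow_le_pow_of_le_one (abs_nonneg _) hβ1 (le_max_left _ _)
    have : min C₁ C₂ * |β - pm| ^ max ℓ₁ ℓ₂ ≤ C₁ * |β - pm| ^ ℓ₁ :=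
      mul_le_mul (min_le_left _ _) hp1 (by positivity) hC₁.le
    linarith
  · rw [max_eq_left h]
    have hp1 : |α - pp| ^ max ℓ₁ ℓ₂ ≤ |α - pp| ^ ℓ₂ :=
      pow_le_pow_of_le_one (abs_nonneg _) hα1 (le_max_right _ _)
    have : min C₁ C₂ * |α - pp| ^ max ℓ₁ ℓ₂ ≤ C₂ * |α - pp| ^ ℓ₂ :=
      mul_le_mul (min_le_right _ _) hp1 (by positivity) hC₂.le
    linarith

/-- **The uniform gap away from the two maxima**: for every `ε > 0` there is `δ > 0` with
`Φ₁(α, β) ≤ Φ₁(p⁺, p⁻) - δ` at every point of the triangle at `ℓ_∞`-distance `≥ ε` from both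
`(p⁺, p⁻)` and `(p⁻, p⁺)` (continuity of `Φ₁` on the compact triangle and uniqueness of the
maximisers, `slyPhi1_max_triangle`); together with `slyPhi1_local_gap` this is the input
"`Σ_{‖(α,β)-(p⁺,p⁻)‖_∞ > n^{-1/(2ℓ)}} Z^{α,β} ≤ exp(-(C/2) n^{1/2}) E Z⁺`" of Sly's proof of Lemma 3.3.
[cite: Sly2010, proof of Lemma 3.3 (eq. (e:gtEZ2))] -/
theorem slyPhi1_uniform_gap {d : ℕ} (hd : 3 ≤ d) {lam pp pm : ℝ} (hlam : hardCoreThreshold d < lam)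
    (hpm : 0 < pm) (hlt : pm < pp) (hsum : pp + pm < 1)
    (hEα : lam * (1 - pp - pm) ^ d = pp * (1 - pp) ^ (d - 1))
    (hEβ : lam * (1 - pp - pm) ^ d = pm * (1 - pm) ^ (d - 1)) {ε : ℝ} (hε : 0 < ε) :
    ∃ δ : ℝ, 0 < δ ∧ ∀ α β : ℝ, 0 ≤ α → 0 ≤ β → α + β ≤ 1 →
      ε ≤ max |α - pp| |β - pm| → ε ≤ max |α - pm| |β - pp| →
        slyPhi1 d lam α β + δ ≤ slyPhi1 d lam pp pm := by
  have hmax := slyPhi1_le_of_critical hd hlam hpm hlt hsum hEα hEβ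
  set S : Set (ℝ × ℝ) := {q | (0 ≤ q.1 ∧ 0 ≤ q.2 ∧ q.1 + q.2 ≤ 1) ∧
    ε ≤ max |q.1 - pp| |q.2 - pm| ∧ ε ≤ max |q.1 - pm| |q.2 - pp|} with hS
  have hSc : IsCompact S := by
    have hclosed : IsClosed S := by
      rw [hS]
      refine IsClosed.inter (IsClosed.inter (isClosed_le continuous_const continuous_fst)
        (IsClosed.inter (isClosed_le continuous_const continuous_snd)
        (isClosed_le (continuous_fst.add continuous_snd) continuous_const))) (IsClosed.inter ?_ ?_)
      · exact isClosed_le continuous_const (((continuous_fst.sub continuous_const).abs).max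
          ((continuous_snd.sub continuous_const).abs))
      · exact isClosed_le continuous_const (((continuous_fst.sub continuous_const).abs).max
          ((continuous_snd.sub continuous_const).abs))
    have hsub : S ⊆ Set.Icc (0 : ℝ) 1 ×ˢ Set.Icc (0 : ℝ) 1 := by
      rintro ⟨a, b⟩ ⟨⟨ha, hb, hab⟩, -⟩
      exact ⟨⟨ha, by simpa using (by linarith : a ≤ 1)⟩, ⟨hb, by simpa using (by linarith : b ≤ 1)⟩⟩
    exact (isCompact_Icc.prod isCompact_Icc).of_isClosed_subset hclosed hsub
  rcases S.eq_empty_or_nonempty with hSe | hSn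
  · refine ⟨1, one_pos, fun α β hα hβ hαβ h1 h2 => ?_⟩
    have : (α, β) ∈ S := ⟨⟨hα, hβ, hαβ⟩, h1, h2⟩
    rw [hSe] at this
    exact absurd this (Set.notMem_empty _)
  obtain ⟨⟨α₀, β₀⟩, ⟨⟨hα₀, hβ₀, hαβ₀⟩, h1₀, h2₀⟩, hmax₀⟩ :=
    hSc.exists_isMaxOn hSn ((continuous_slyPhi1 d lam).continuousOn)
  have hlt₀ : slyPhi1 d lam α₀ β₀ < slyPhi1 d lam pp pm := by
    obtain ⟨hle, hiff⟩ := hmax α₀ β₀ hα₀ hβ₀ hαβ₀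
    refine lt_of_le_of_ne hle fun heq => ?_
    rcases hiff.1 heq with ⟨rfl, rfl⟩ | ⟨rfl, rfl⟩
    · simp at h1₀; linarith
    · simp at h2₀; linarith
  refine ⟨slyPhi1 d lam pp pm - slyPhi1 d lam α₀ β₀, by linarith, fun α β hα hβ hαβ h1 h2 => ?_⟩
  have key : slyPhi1 d lam α β ≤ slyPhi1 d lam α₀ β₀ :=
    hmax₀ (show (α, β) ∈ S from ⟨⟨hα, hβ, hαβ⟩, h1, h2⟩)
  linarith

end PowerLawGap

end Literature.Computability.Complexity
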